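import Summits.ValiantsHypothesis.ValiantsHypothesis.Theses.DivisionGap
import Summits.ValiantsHypothesis.ValiantsHypothesis.Theorems.PerDivisionHard.Negative.LoadBearing
import Summits.ValiantsHypothesis.ValiantsHypothesis.Theorems.PerDivisionHard.Negative.VarsCounting
import Summits.ValiantsHypothesis.ValiantsHypothesis.Theorems.PerDivisionHard.Negative.BooleanShadow
import Literature.Computability.AlgebraicComplexity.RealTauConjectureDepthFour
import Literature.Computability.AlgebraicComplexity.OrbitClosure
import Literature.Computability.AlgebraicComplexity.GCT
import Literature.Computability.AlgebraicComplexity.ArithCircuitProofs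
import Literature.Computability.AlgebraicComplexity.PermanentIrreducible
import Summits.ValiantsHypothesis.ValiantsHypothesis.Theorems.PerDivisionHard.Negative.PlainBridge

/-!
# Disproof of `PerMultiplesHard` — findings of the standing disprover (crux `stmt-ValiantsHypothesis-5068`)

Crux (route `DivisionGap`, the strong form of H1, `h` NOT charged):
`PerMultiplesHard := ∀ c, ∃ n₀, ∀ n ≥ n₀, ∀ h : ℝ≥0[x_ij] (n × n), h ≠ 0 →
  2 ^ ((Nat.log 2 n + c) ^ c) < L(per_n · h)`,
`L = Literature.Computability.AlgebraicComplexity.complexity` over the semiring `ℝ≥0` (monotone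
fan-in-two circuits, `ℝ≥0`-weighted sum gates, constants and inputs free).  In words: **the monotone
EXCLUSION COMPLEXITY of the permanent** (Bürgisser 2004, §1.1: `EC(g) := min {L(f) : f ≠ 0, g ∣ f}`,
here with `L = L⁺` over `ℝ≥0`) is super-quasi-polynomial almost everywhere.  In print this is
Hrubeš–Yehudayoff 2021 §6 Open Problem 3 instantiated at `f = per` (quasi-polynomial strength);
Jukna 2023 §6.4 Problem 4.

## VERDICT (cycle 1): NO KILL, NOT MISSTATED — a refutation would be a GCT-grade breakthrough — and THE
## LINEAR-DEGREE FLOOR PROVED (§(l), sorry-free): every counterexample h must have total degree > n/3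
## (`perMultiplesHard_rung_third`, for all c, all large n; closed form `js_bound_totalDegree_proj`:
## m(2^{m-1}-1) ≤ 2 L⁺(per_n h) + 2 for some m ≥ n − 2·deg h).  Rungs deg ≤ 1, 2, n/16 were the warm-ups.

1. **Faithful.** Read back symbol by symbol (`perMultiplesHard_iff_over_nnreal` is `Iff.rfl`):
   threshold `2 ^ ((Nat.log 2 n + c) ^ c) : ℕ`, strict `<` in `ℕ`; `h` in the same `n²` variables;
   `per_n * h ≠ 0` for `h ≠ 0` (`ℝ≥0[x]` has no zero divisors), so `complexity` never takes its junk
   value for a relevant reason; `c = 0, 1` rungs hold outright (`perMultiplesHardAt_zero/one`, from the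
   sibling seat's variable count `n² ≤ 2 L(per_n h) + 1`), so a counterexample exponent is `≥ 2`.
2. **Where the planner's caveat "h may be huge — not known to follow from VP ≠ VNP" ends.**
   `exists_complex_multiple_le` (sorry-free): a monotone circuit for `per_n · h` IS a circuit over `ℂ`
   for the nonzero complex multiple `per_n · h_ℂ`, so `EC_ℂ(per_n) ≤ L⁺(per_n · h)` for every `h ≠ 0`, and
   `exclusion_quasipoly_io_of_not_perMultiplesHard` (sorry-free): a refutation makes the complex
   exclusion complexity of `per_n` quasi-polynomial for infinitely many `n`.  Bürgisser 2004
   (*The complexity of factors of multivariate polynomials*, FoCM 4; arXiv:1812.06828), **Thm 1.3**: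
   over a field of characteristic zero `L̲(g) ≤ O(M(d)M(d⁴)·EC(g) + d^{2γ}M(d)²)`, `d = deg g`,
   `L̲` = APPROXIMATIVE (border) complexity — the multiplicity `e` of `g` in the cheap multiple, which
   Kaltofen's exact-complexity theorem (ibid. **Thm 1.2**: `L(g) ≤ O(M(d³e)(L(f) + d log e))`) cannot
   avoid, is removed by perturbation.  With `d = n`: `L̲_ℂ(per_n) ≤ poly(n) · EC_ℂ(per_n)`.  Depth
   reduction over `ℂ(ε)` plus universality of the determinant turn an approximative circuit of size `S`
   for the degree-`n` form `per_n` into a border determinantal expression of size `S^{O(log n)}`.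
   HENCE: `¬ PerMultiplesHard ⇒ \underline{dc}(per_n) ≤ 2^{polylog n}` for infinitely many `n`, i.e. the
   quasi-polynomial Mulmuley–Sohoni conjecture (`per ∉ \overline{VQP}`, a.e. form) FAILS.  Conversely
   the crux FOLLOWS from that conjecture.  Checked here modulo the single literature hypothesis
   `ExclusionControlsBorderDc` (Bürgisser Thm 1.3 ∘ depth reduction, not in the tree):
   `not_borderDcPerSuperQuasiPoly_of_not_perMultiplesHard`.  For multiples of BOUNDED multiplicity
   (`h = per^{e-1} h₀`, `e ≤ qpoly`) Thm 1.2 gives the non-border conclusion `per ∈ VQP_ℝ` i.o.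
   So: no small model, degenerate regime, computation or "huge h" trick can bite; a kill is exactly as
   hard as refuting border-quasi-polynomial GCT for the permanent, infinitely often.
3. **Boolean shadow (what a would-be counterexample must ALSO do).**  A monotone circuit for `per_n · h`
   decides, on 0/1 inputs read as bipartite graphs `S`, the monotone function `PM(S) ∧ H(S)` with
   `H = shadow(h)` (`shadow_is_perfectMatching` for `coeff 0 h ≠ 0`: then it is PERFECT MATCHING and
   Razborov 1985 gives `n^{Ω(log n)}` — super-polynomial, NOT super-quasi-polynomial; nothing better is
   known for monotone PM since 1985, and no `n^{O(log n)}` monotone PM circuit is known either).  With `h`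
   uncharged the shadow can be made harmless (`H ⊆ PM`, e.g. `x^{P_id} ∣ h`, or Dirac thresholds
   `H = "all degrees ≥ n/2"` via Hall) — the Boolean transfer proves NO instance `c ≥ 2` of this crux.
4. **Free normalisations — NOW CHECKED (section (h), namespace `…Disproof.TopForm`, sorry-free;
   landing copy `Negative/TopForms.lean`):** over `ℝ≥0` TOP FORMS ARE FREE — for every weight
   `w : σ → ℕ`, `L⁺(topForm_w f) ≤ L⁺(f)` (`complexity_topForm_le`: no cancellation in sums,
   `topForm_list_sum`; no zero divisors in products, `topForm_mul`; explicit gate-by-gate transformation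
   `newGate`/`exists_gates_topForm`).  `per_n` is homogeneous for every potential weight
   `w(r,c) = a r + b c` (`isWeightedHomogeneous_perPoly_pot/row/col`), so
   `L⁺(per_n · multiTop h) ≤ L⁺(per_n · h)` with `multiTop h ≠ 0` MULTIHOMOGENEOUS (all row and column
   degrees of its monomials fixed): `exists_multihomogeneous_multiple_le`, and the crux is EQUIVALENT to
   its restriction to multihomogeneous multipliers (`perMultiplesHard_iff_multihomogeneous`).  FACES (checked):
   for `G ⊇` a perfect matching, `topForm_{1_G}(per_n) = per_n|_G` (`topForm_graph_perPoly`) and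
   `exists_face_multiple_le`: a cheap multiple of `per_n` gives an equally cheap multiple of every face
   restriction `per_n|_G` — counterexamples are hereditary to faces of the Birkhoff polytope (every face
   instance is again open; no contradiction).  Still on paper: by Jukna–Seiwert–Sergeev 2022 Thm 1 /
   HY21 Prop 43(3) WLOG `h` has no monomial factor (quadratic cost).
5. **Refuted natural strengthenings / load-bearing hypotheses** (all sorry-free below): drop `h ≠ 0`
   (`h = 0`); drop `n₀` (`n = 0, 1`); swap to `∃ n₀ ∀ c`; replace `ℝ≥0` by any ring of characteristic two
   (`per = det`, Berkowitz: monotonicity is load-bearing); raise the threshold to `(n+1)·n!` (`h = 1`).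
   "Multiples never help ANY monotone polynomial" is false in print (Jerrum–Snir `ST_n`: monotone
   `2^{Ω(n)}`, tree `JerrumSnir1982_spanningTree_holds`, yet `ST_n · h` has `O(n³)` monotone circuits,
   Fomin–Grigoriev–Koshevoy 2014 Thm 7.2 = route item `StDivisionEasy`) — the phenomenon the crux must
   exclude for `per` is real.
6. **Data.** None can bite (`∀ c ∃ n₀` is immune to finite computation); no kit job filed this cycle.

## CHECKED CONTENT (sorry-free unless marked)
(a) load-bearing: `perMultiplesHard_false_without_nonzero`, `perMultiplesHard_false_without_threshold`,
    `multiple_at_one_eq_zero`, `perMultiplesHard_false_uniform`, `not_perMultiplesHardOver_of_charTwo`,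
    `not_perMultiplesHardOver_zmod2`.
(b) tightness: `exists_multiple_le_factorial`, `not_perMultiplesHardFactorialRate`.
(c) floor: `perMultiplesHardAt_zero`, `perMultiplesHardAt_one`, `two_le_of_not_perMultiplesHardAt`, `floor`.
(d) shadow: `shadow_is_perfectMatching`, `shadow_void_at_prod_X` (sibling lemmas, valid verbatim);
    NEW `mem_support_perPoly_mul_monomial`, `shadow_perPoly_mul_monomial_iff`,
    `shadow_perPoly_mul_diagonal_iff` (monomial multipliers containing a matching trivialise the shadow).
(e) exclusion bridge: `monotoneEC`, `perMultiplesHard_iff_monotoneEC` (the crux is about one number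
    per `n`), `complexity_map_le`, `exists_complex_multiple_le`,
    `exclusion_quasipoly_io_of_not_perMultiplesHard`, `not_perMultiplesHard_of_not_perDivisionHard`,
    `borderDc_quasipoly_io_of_not_perMultiplesHard` / `not_borderDcPerSuperQuasiPoly_of_not_perMultiplesHard`
    / `perMultiplesHard_of_qpMS` (modulo `ExclusionControlsBorderDc`).
    Landing copies (no defs): `Theorems/PerMultiplesHard/Negative/{LoadBearing,ExclusionBridge,MonomialShadow}.lean`.
(f) Targets: none (payload `stuck_stubs = []`).
(g) Near-miss (sorried, literature): `exclusionControlsBorderDc_holds`.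
(i) division by a variable (namespace `…Disproof.DivX`, landing copy `Negative/DivX.lean`):
    `complexity_le_of_X_mul` (`L(f) ≤ 8 L(x_v f)`), `complexity_P0_le`, `complexity_P1_le`.
(j) NEW RUNG (namespace `…Disproof.Rung`): `js_bound_totalDegree_le_one`
    (`n(2^{n-1}-1) ≤ 16 L⁺(per_n h) + 2` for every nonzero `h` of total degree ≤ 1),
    `perMultiplesHard_rung_totalDegree_le_one` (the crux's bound for all `c`, all such `h`),
    `polylog_eventually`, `exists_eq_monomial`.
(l) THE LINEAR-DEGREE FLOOR (namespace `…Disproof.General`): `js_bound_rowcol` (DEGREE-FREE structure theorem: the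
    multihomogeneous top part of any counterexample is spread over r + c ≥ n − polylog rows+columns),
    `js_bound_totalDegree_proj` + `perMultiplesHard_rung_third`
    (projection x_v ↦ 1 outside Jᶜ×Jᶜ is free: no stripping cost; threshold 3·deg h ≤ n); earlier `js_bound_totalDegree` (for `2d < n`, every
    nonzero `h` of total degree `≤ d`: some `m ≥ n - 2d` has `m(2^{m-1}-1) ≤ 2·8^{3d}·(L⁺(per_n h)+1)`),
    `perMultiplesHard_rung_sublinear` (∀ c ∃ n₀ ∀ n ≥ n₀ ∀ h ≠ 0, `16·deg h ≤ n →` crux bound),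
    `perMultiplesHard_rung_totalDegree_le` (every fixed degree).  Tools: `rename_prodMap_perPoly`,
    `rename_colMap_perPoly`, `rounds` (single-cell top forms shrink the multiplier for free),
    `complexity_le_of_monomial_mul` (`L(q) ≤ 8^{deg D} L(x^D q)`), `perRestrict_diagBlock`
    (the face `diag(J) ∪ (Jᶜ×Jᶜ)` of `per_n` is `x^{diag J}` times the renamed permanent of `Jᶜ`, via
    `Equiv.Perm.ofSubtype`), `isWeightedHomogeneous_perRestrict_cell`.
(k) SECOND NEW RUNG (namespace `…Disproof.Rung2`): `complexity_perPoly_le_of_deleted` (the column-swap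
    trick: `L⁺(per_n) ≤ 9 L⁺(per_n %ᵐ x_{rc'}) + 2`), `pairwise_degree_le_two` (multihomogeneous degree-2
    supports are a monomial or the two diagonals of a 2×2 block), `js_bound_totalDegree_le_two`
    (`n(2^{n-1}-1) ≤ 9216 L⁺(per_n h) + 40`), `perMultiplesHard_rung_totalDegree_le_two`.
(h) top forms (namespace `…Disproof.TopForm`): `topForm`, `topForm_list_sum`, `topForm_mul`,
    `complexity_topForm_le`, `isWeightedHomogeneous_perPoly_pot/row/col`, `complexity_mul_multiTop_le`,
    `exists_multihomogeneous_multiple_le`, `perMultiplesHard_iff_multihomogeneous`; faces: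
    `perRestrict`, `topForm_graph_perPoly`, `exists_face_multiple_le` (hereditary to Birkhoff faces).

## LITERATURE (2026-08-16)
Bürgisser 2004 (`Burgisser2004Factors`, arXiv:1812.06828) §1.1 (EC, Lemma 1.1), Thm 1.2 (Kaltofen), Thm 1.3
(read pp. 3–4); its 2020 correction (`Burgisser2020FactorsCorrection`) touches only Thm 5.7 (order of
approximation), not Thm 1.3.  Andrews–Forbes 2022 (`AndrewsForbes2022`, STOC'22, arXiv:2112.00792) §1.1,
read p. 4: "if we are content to operate in the setting of border complexity, then the work of [Bürgisser
2004] shows that up to polynomial factors, the complexity of a principal ideal ⟨f⟩ is governed by the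
border complexity of its generator f" and "the Factor Conjecture … remains open" — i.e. exactly the frame
used in item 2: `PerMultiplesHard` is a lower bound for the MONOTONE part of the principal ideal ⟨per_n⟩,
which dominates the complexity of ⟨per_n⟩ over `ℂ` ≈ `\underline{L}(per_n)`.  (Their ideal lower bounds
are for determinantal/Pfaffian ideals in restricted NON-monotone models; nothing monotone.)  HY21 §6
(Problem 2 / Open Problem 3, Prop 43, Rem 45–46) and Jukna 2023 §6.4 as recorded by the sibling seat
`Cruxes/PerDivisionHard/Disproof.lean` (whose Negative/ lemmas are imported here).  Search this cycle was
DEGRADED (searchd rc 75; OpenAlex budget exhausted; S2 429): crossref/arXiv/galaxy/`lit citing`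
(Bürgisser 2004: 69 citers scanned, none proves the Factor Conjecture or a monotone ideal bound) only.
-/

noncomputable section

set_option linter.dupNamespace false

namespace Summit.ValiantsHypothesis.ValiantsHypothesis.Cruxes.PerMultiplesHard.Disproof

open Literature.Computability.AlgebraicComplexity MvPolynomial
open Summit.ValiantsHypothesis.ValiantsHypothesis.Theses.DivisionGap (PerMultiplesHard PerDivisionHard)
open Summit.ValiantsHypothesis.Theorems.PerDivisionHardNegative
open scoped NNReal

/-! ### The crux and its variants as named propositions (workfile only) -/

/-- `PerMultiplesHard` with the coefficient semiring `ℝ≥0` replaced by an arbitrary commutative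
semiring `k`; the crux is the instance `k = ℝ≥0` (`perMultiplesHard_iff_over_nnreal`). -/
def PerMultiplesHardOver (k : Type) [CommSemiring k] : Prop :=
  ∀ c : ℕ, ∃ n₀ : ℕ, ∀ n ≥ n₀, ∀ h : MvPolynomial (Fin n × Fin n) k, h ≠ 0 →
    2 ^ ((Nat.log 2 n + c) ^ c) < complexity (perPoly (Fin n) k * h)

/-- The crux is literally the `ℝ≥0` instance. -/
theorem perMultiplesHard_iff_over_nnreal : PerMultiplesHard ↔ PerMultiplesHardOver ℝ≥0 := Iff.rfl

/-- The matrix of the crux at a fixed exponent `c`. -/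
def PerMultiplesHardAt (c : ℕ) : Prop :=
  ∃ n₀ : ℕ, ∀ n ≥ n₀, ∀ h : MvPolynomial (Fin n × Fin n) ℝ≥0, h ≠ 0 →
    2 ^ ((Nat.log 2 n + c) ^ c) < complexity (perPoly (Fin n) ℝ≥0 * h)

/-- Unfolding. -/
theorem perMultiplesHard_iff_forall_at : PerMultiplesHard ↔ ∀ c, PerMultiplesHardAt c := Iff.rfl

/-- The crux with `h ≠ 0` dropped. -/
def PerMultiplesHardWithoutNonzero : Prop :=
  ∀ c : ℕ, ∃ n₀ : ℕ, ∀ n ≥ n₀, ∀ h : MvPolynomial (Fin n × Fin n) ℝ≥0,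
    2 ^ ((Nat.log 2 n + c) ^ c) < complexity (perPoly (Fin n) ℝ≥0 * h)

/-- The crux with the threshold dropped (claimed for every `n`). -/
def PerMultiplesHardWithoutThreshold : Prop :=
  ∀ c : ℕ, ∀ n : ℕ, ∀ h : MvPolynomial (Fin n × Fin n) ℝ≥0, h ≠ 0 →
    2 ^ ((Nat.log 2 n + c) ^ c) < complexity (perPoly (Fin n) ℝ≥0 * h)

/-- The crux with the quantifiers swapped (`n₀` uniform in `c`). -/
def PerMultiplesHardUniform : Prop :=
  ∃ n₀ : ℕ, ∀ c : ℕ, ∀ n ≥ n₀, ∀ h : MvPolynomial (Fin n × Fin n) ℝ≥0, h ≠ 0 →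
    2 ^ ((Nat.log 2 n + c) ^ c) < complexity (perPoly (Fin n) ℝ≥0 * h)

/-- The crux with the threshold raised to the factorial rate `(n+1)·n!`. -/
def PerMultiplesHardFactorialRate : Prop :=
  ∃ n₀ : ℕ, ∀ n ≥ n₀, ∀ h : MvPolynomial (Fin n × Fin n) ℝ≥0, h ≠ 0 →
    (n + 1) * n.factorial < complexity (perPoly (Fin n) ℝ≥0 * h)

/-! ### Relation to the weaker crux `PerDivisionHard` -/

/-- `PerMultiplesHard → PerDivisionHard` (dropping the charge for `h` only strengthens the lower
bound), stated contrapositively: a refutation of the WEAKER crux H1 refutes this one. [folklore] -/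
theorem not_perMultiplesHard_of_not_perDivisionHard (hneg : ¬ PerDivisionHard) : ¬ PerMultiplesHard :=
  fun H => hneg fun c => (H c).imp fun _ hn₀ n hn g hg =>
    Nat.lt_of_lt_of_le (hn₀ n hn g hg) (Nat.le_add_right _ _)

/-! ### (a) Load-bearing hypotheses -/

/-- Any proof must use `h ≠ 0`: with it deleted the statement is false (`h = 0`). [folklore] -/
theorem perMultiplesHard_false_without_nonzero : ¬ PerMultiplesHardWithoutNonzero := by
  intro H
  obtain ⟨n₀, hn₀⟩ := H 0
  have h := hn₀ n₀ le_rfl 0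
  rw [mul_zero, complexity_zero] at h
  exact Nat.not_lt_zero _ h

/-- Any proof must use the threshold `n₀`: claimed for every `n` it is false at `n = 0`, `h = 1`
(`per_0 · 1 = 1` is a free constant). [folklore] -/
theorem perMultiplesHard_false_without_threshold : ¬ PerMultiplesHardWithoutThreshold := by
  intro H
  have h := H 0 0 1 one_ne_zero
  rw [mul_one, perPoly_fin_zero, complexity_one] at h
  exact Nat.not_lt_zero _ h

/-- … and at `n = 1`: `L(per_1 · 1) = L(x₀₀) = 0`, below every threshold. [folklore] -/
theorem multiple_at_one_eq_zero : complexity (perPoly (Fin 1) ℝ≥0 * 1) = 0 := by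
  rw [mul_one, perPoly_fin_one, complexity_X_holds]

/-- The dependence `c ↦ n₀(c)` is load-bearing: with one `n₀` for all `c` the statement is false
(at `n = n₀`, `h = 1`, exponent `c = L(per_{n₀}) + 1`). [folklore] -/
theorem perMultiplesHard_false_uniform : ¬ PerMultiplesHardUniform := by
  rintro ⟨n₀, H⟩
  set D := complexity (perPoly (Fin n₀) ℝ≥0 * 1) with hD
  have h := H (D + 1) n₀ le_rfl 1 one_ne_zero
  rw [← hD] at h
  have h1 : D + 1 ≤ (Nat.log 2 n₀ + (D + 1)) ^ (D + 1) := by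
    calc D + 1 ≤ Nat.log 2 n₀ + (D + 1) := Nat.le_add_left _ _
      _ = (Nat.log 2 n₀ + (D + 1)) ^ 1 := (pow_one _).symm
      _ ≤ (Nat.log 2 n₀ + (D + 1)) ^ (D + 1) := Nat.pow_le_pow_right (by omega) (by omega)
  have h2 : (Nat.log 2 n₀ + (D + 1)) ^ (D + 1) < 2 ^ ((Nat.log 2 n₀ + (D + 1)) ^ (D + 1)) :=
    Nat.lt_two_pow_self
  omega

/-- Monotonicity (no cancellation in `ℝ≥0`) is load-bearing: over a nontrivial commutative ring of
characteristic two `per = det` has polynomial-size circuits (Berkowitz, `L(det_n) ≤ 8(n+1)^7`), so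
the multiple `h = 1` is cheap; witness `c = 4`. [cite: Burgisser2000, §2.1] -/
theorem not_perMultiplesHardOver_of_charTwo (k : Type) [CommRing k] [CharP k 2] [Nontrivial k] :
    ¬ PerMultiplesHardOver k := by
  intro H
  obtain ⟨n₀, hn₀⟩ := H 4
  have h := hn₀ n₀ le_rfl 1 one_ne_zero
  rw [mul_one, perPoly_eq_detPoly_of_charP_two] at h
  have hdet := complexity_detPoly_le k n₀
  have hqp := berkowitz_bound_le_qp n₀
  omega

/-- Instance `𝔽₂`. [cite: Burgisser2000, §2.1] -/
theorem not_perMultiplesHardOver_zmod2 : ¬ PerMultiplesHardOver (ZMod 2) :=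
  not_perMultiplesHardOver_of_charTwo (ZMod 2)

/-! ### (b) Tightness window -/

/-- The trivial multiple `h = 1` costs at most `(n+1)·n!`. [cite: JerrumSnir1982, §4.3] -/
theorem exists_multiple_le_factorial (n : ℕ) :
    ∃ h : MvPolynomial (Fin n × Fin n) ℝ≥0, h ≠ 0 ∧
      complexity (perPoly (Fin n) ℝ≥0 * h) ≤ (n + 1) * n.factorial :=
  ⟨1, one_ne_zero, by rw [mul_one]; exact complexity_perPoly_le_factorial n⟩

/-- The threshold cannot be raised to `(n+1)·n!`. [cite: JerrumSnir1982, §4.3] -/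
theorem not_perMultiplesHardFactorialRate : ¬ PerMultiplesHardFactorialRate := by
  rintro ⟨n₀, H⟩
  obtain ⟨h, hne, hle⟩ := exists_multiple_le_factorial n₀
  exact absurd (H n₀ le_rfl h hne) (not_lt.mpr hle)

/-! ### (c) The floor: instances `c = 0, 1` hold, so counterexamples need `c ≥ 2` -/

/-- The universal floor: `n² ≤ 2·L(per_n · h) + 1` for every `h ≠ 0` (every variable occurs). -/
theorem floor (n : ℕ) {h : MvPolynomial (Fin n × Fin n) ℝ≥0} (hh : h ≠ 0) :
    n * n ≤ 2 * complexity (perPoly (Fin n) ℝ≥0 * h) + 1 :=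
  sq_le_of_pair hh

/-- `c = 0` holds (from `n = 3`). [folklore] -/
theorem perMultiplesHardAt_zero : PerMultiplesHardAt 0 := by
  refine ⟨3, fun n hn h hh => ?_⟩
  have hsq := sq_le_of_pair hh
  have h9 : 3 * 3 ≤ n * n := Nat.mul_le_mul hn hn
  rw [pow_zero, pow_one]
  omega

/-- `c = 1` holds (from `n = 5`). [folklore] -/
theorem perMultiplesHardAt_one : PerMultiplesHardAt 1 := by
  refine ⟨5, fun n hn h hh => ?_⟩
  have hsq := sq_le_of_pair hh
  have h25 : 5 * n ≤ n * n := Nat.mul_le_mul_right n hn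
  have hlog : 2 ^ Nat.log 2 n ≤ n := Nat.pow_log_le_self 2 (by omega)
  rw [pow_one, pow_succ]
  omega

/-- Hence any counterexample exponent is at least `2`. [folklore] -/
theorem two_le_of_not_perMultiplesHardAt {c : ℕ} (hc : ¬ PerMultiplesHardAt c) : 2 ≤ c := by
  by_contra h
  interval_cases c
  · exact hc perMultiplesHardAt_zero
  · exact hc perMultiplesHardAt_one

/-! ### (d) The Boolean shadow of the crux's multiples (sibling lemmas, valid verbatim) -/

/-- For `h` with a constant term the shadow of `per_n · h` is PERFECT MATCHING. -/
theorem shadow_is_perfectMatching {n : ℕ} {h : MvPolynomial (Fin n × Fin n) ℝ≥0}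
    (h0 : coeff 0 h ≠ 0) (S : Finset (Fin n × Fin n)) :
    (∃ m ∈ (perPoly (Fin n) ℝ≥0 * h).support, m.support ⊆ S) ↔
      ∃ ρ : Equiv.Perm (Fin n), ∀ j, (ρ j, j) ∈ S :=
  shadow_perPoly_mul_iff h0 S

/-- For `h = ∏ x_ij` the shadow of `per_n · h` is void. -/
theorem shadow_void_at_prod_X {n : ℕ} (S : Finset (Fin n × Fin n)) :
    (∃ m ∈ (perPoly (Fin n) ℝ≥0 * ∏ v, X v).support, m.support ⊆ S) ↔ S = Finset.univ :=
  shadow_perPoly_mul_prod_X_iff S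

/-- Support of `per_n · (a x^d)`: exactly the exponents `μ_ρ + d`. [folklore] -/
theorem mem_support_perPoly_mul_monomial {n : ℕ} {d m : (Fin n × Fin n) →₀ ℕ} {a : ℝ≥0} (ha : a ≠ 0) :
    m ∈ (perPoly (Fin n) ℝ≥0 * monomial d a).support ↔
      ∃ ρ : Equiv.Perm (Fin n), permMonomial ρ + d = m := by
  classical
  rw [mem_support_iff, coeff_mul_monomial']
  constructor
  · intro h
    split_ifs at h with hle
    · have hc : coeff (m - d) (perPoly (Fin n) ℝ≥0) ≠ 0 := fun h0 => h (by rw [h0, zero_mul])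
      obtain ⟨ρ, hρ⟩ := exists_permMonomial_eq_of_coeff_perPoly_ne_zero ℝ≥0 hc
      exact ⟨ρ, by rw [hρ, tsub_add_cancel_of_le hle]⟩
    · exact absurd rfl h
  · rintro ⟨ρ, rfl⟩
    rw [if_pos le_add_self, add_tsub_cancel_right, coeff_permMonomial_perPoly, one_mul]
    exact ha

/-- **NEW: monomial multipliers containing a perfect matching trivialise the Boolean shadow.**  If
`supp(x^d) ⊇` the pattern of some permutation `ρ₀`, the shadow of `per_n · (a x^d)` accepts `S` iff
`S ⊇ supp d` — an AND of variables.  (`d = 𝟙`: the sibling's void shadow; `d = μ_{id}`: "`S` contains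
the diagonal", `shadow_perPoly_mul_diagonal_iff`.)  With `h` uncharged such multipliers are admissible,
so the Boolean transfer proves NO instance of this crux beyond what it proves for `h = 1`. [folklore] -/
theorem shadow_perPoly_mul_monomial_iff {n : ℕ} {d : (Fin n × Fin n) →₀ ℕ} {a : ℝ≥0} (ha : a ≠ 0)
    (ρ₀ : Equiv.Perm (Fin n)) (hρ₀ : ∀ j, (ρ₀ j, j) ∈ d.support) (S : Finset (Fin n × Fin n)) :
    (∃ m ∈ (perPoly (Fin n) ℝ≥0 * monomial d a).support, m.support ⊆ S) ↔ d.support ⊆ S := by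
  classical
  constructor
  · rintro ⟨m, hm, hmS⟩
    obtain ⟨ρ, rfl⟩ := (mem_support_perPoly_mul_monomial ha).1 hm
    exact (support_subset_support_add d (permMonomial ρ)).trans (by rwa [add_comm] at hmS)
  · intro hdS
    refine ⟨permMonomial ρ₀ + d, (mem_support_perPoly_mul_monomial ha).2 ⟨ρ₀, rfl⟩, ?_⟩
    intro v hv
    rcases Finset.mem_union.1 (Finsupp.support_add hv) with h1 | h2
    · obtain ⟨i, j⟩ := v
      have hij : ρ₀ j = i := (mem_support_permMonomial ρ₀ (i, j)).1 h1
      subst hij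
      exact hdS (hρ₀ j)
    · exact hdS h2

/-- The diagonal instance: the shadow of `per_n · ∏ x_ii` is "`S` contains the diagonal". [folklore] -/
theorem shadow_perPoly_mul_diagonal_iff {n : ℕ} (S : Finset (Fin n × Fin n)) :
    (∃ m ∈ (perPoly (Fin n) ℝ≥0 * monomial (permMonomial 1) 1).support, m.support ⊆ S) ↔
      ∀ i : Fin n, (i, i) ∈ S := by
  rw [shadow_perPoly_mul_monomial_iff one_ne_zero 1 (fun j => (mem_support_permMonomial 1 _).2 rfl) S]
  constructor
  · intro h i
    exact h ((mem_support_permMonomial 1 (i, i)).2 rfl)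
  · intro h v hv
    obtain ⟨i, j⟩ := v
    have hij : j = i := by simpa using (mem_support_permMonomial 1 (i, j)).1 hv
    subst hij
    exact h j

/-! ### (e) The exclusion-complexity bridge: what a refutation would cost

`EC_ℂ(per_n) ≤ EC⁺(per_n) = min_{h ≠ 0} L⁺(per_n · h)`: base change along
`ℝ≥0 → ℝ → ℂ` maps a monotone circuit to a complex circuit of the same size computing the nonzero
multiple `per_n · h_ℂ`.  Bürgisser 2004 Thm 1.3 bounds the APPROXIMATIVE complexity of any degree-`d`
polynomial by `poly(d) · EC`, independently of the multiplicity; depth reduction turns approximative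
circuits into border determinantal expressions of quasi-polynomial size.  Both steps are literature
not yet in the tree and enter as the single hypothesis `ExclusionControlsBorderDc`. -/

section Exclusion

/-- The MONOTONE EXCLUSION COMPLEXITY of `per_n`: the least monotone circuit size of a nonzero
monotone multiple (Bürgisser 2004 §1.1 with `L = L⁺` over `ℝ≥0`).  Workfile notion. -/
def monotoneEC (n : ℕ) : ℕ :=
  sInf {s | ∃ h : MvPolynomial (Fin n × Fin n) ℝ≥0, h ≠ 0 ∧ complexity (perPoly (Fin n) ℝ≥0 * h) = s}

/-- `EC⁺(per_n) ≤ L⁺(per_n · h)` for every `h ≠ 0`. -/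
theorem monotoneEC_le {n : ℕ} {h : MvPolynomial (Fin n × Fin n) ℝ≥0} (hh : h ≠ 0) :
    monotoneEC n ≤ complexity (perPoly (Fin n) ℝ≥0 * h) :=
  Nat.sInf_le ⟨h, hh, rfl⟩

/-- The infimum is attained. -/
theorem exists_eq_monotoneEC (n : ℕ) :
    ∃ h : MvPolynomial (Fin n × Fin n) ℝ≥0, h ≠ 0 ∧ complexity (perPoly (Fin n) ℝ≥0 * h) = monotoneEC n :=
  Nat.sInf_mem (⟨_, 1, one_ne_zero, rfl⟩ :
    Set.Nonempty {s | ∃ h : MvPolynomial (Fin n × Fin n) ℝ≥0, h ≠ 0 ∧ complexity (perPoly (Fin n) ℝ≥0 * h) = s})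

/-- **The crux is a statement about ONE number per `n`:** `PerMultiplesHard` iff the monotone
exclusion complexity of `per_n` is eventually above every quasi-polynomial. -/
theorem perMultiplesHard_iff_monotoneEC :
    PerMultiplesHard ↔ ∀ c : ℕ, ∃ n₀ : ℕ, ∀ n ≥ n₀, 2 ^ ((Nat.log 2 n + c) ^ c) < monotoneEC n := by
  constructor
  · intro H c
    obtain ⟨n₀, hn₀⟩ := H c
    refine ⟨n₀, fun n hn => ?_⟩
    obtain ⟨h, hh, he⟩ := exists_eq_monotoneEC n
    rw [← he]
    exact hn₀ n hn h hh
  · intro H c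
    obtain ⟨n₀, hn₀⟩ := H c
    exact ⟨n₀, fun n hn h hh => (hn₀ n hn).trans_le (monotoneEC_le hh)⟩

/-- Base change along a ring homomorphism never increases circuit complexity (map every constant;
Bürgisser 2000 §4.1). [cite: Burgisser2000, §4.1] -/
theorem complexity_map_le {k k' : Type*} [CommSemiring k] [CommSemiring k'] {σ : Type*}
    (φ : k →+* k') (f : MvPolynomial σ k) :
    complexity (MvPolynomial.map φ f) ≤ complexity f := by
  obtain ⟨P, h2, hf, hs⟩ := ArithCircuit.exists_computes_size_eq_complexity f
  rw [← hs, ← ArithCircuit.size_map φ P]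
  exact ArithCircuit.complexity_le_size (h2.map φ) (hf.map φ)

/-- The complexification `ℝ≥0 → ℂ` is injective. [folklore] -/
theorem toC_injective : Function.Injective (Complex.ofRealHom.comp NNReal.toRealHom) := by
  intro a b h
  have h' : ((a : ℝ) : ℂ) = ((b : ℝ) : ℂ) := h
  exact_mod_cast h'

/-- **`EC_ℂ(per_n) ≤ L⁺(per_n · h)`**: every nonzero monotone multiple of the permanent is (after
complexification) a nonzero complex multiple of `per_n` of no larger circuit complexity.
[cite: Burgisser2004Factors, §1.1] -/
theorem exists_complex_multiple_le {n : ℕ} {h : MvPolynomial (Fin n × Fin n) ℝ≥0} (hh : h ≠ 0) :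
    ∃ f : MvPolynomial (Fin n × Fin n) ℂ, f ≠ 0 ∧ perPoly (Fin n) ℂ ∣ f ∧
      complexity f ≤ complexity (perPoly (Fin n) ℝ≥0 * h) := by
  classical
  refine ⟨MvPolynomial.map (Complex.ofRealHom.comp NNReal.toRealHom) (perPoly (Fin n) ℝ≥0 * h),
    ?_, ?_, complexity_map_le _ _⟩
  · intro h0
    apply mul_ne_zero (perPoly_ne_zero (Fin n) ℝ≥0) hh
    apply MvPolynomial.map_injective _ toC_injective
    rw [h0, map_zero]
  · exact ⟨MvPolynomial.map _ h, by rw [map_mul, map_perPoly]⟩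

/-- **A refutation makes the complex exclusion complexity of the permanent quasi-polynomial
infinitely often**: `¬ PerMultiplesHard` gives `c` and, beyond every `n₀`, an `n` and a nonzero
complex multiple `f` of `per_n` with `L_ℂ(f) ≤ 2^{(log₂ n + c)^c}`. [cite: Burgisser2004Factors, §1.1] -/
theorem exclusion_quasipoly_io_of_not_perMultiplesHard (hneg : ¬ PerMultiplesHard) :
    ∃ c : ℕ, ∀ n₀ : ℕ, ∃ n ≥ n₀, ∃ f : MvPolynomial (Fin n × Fin n) ℂ, f ≠ 0 ∧ perPoly (Fin n) ℂ ∣ f ∧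
      complexity f ≤ 2 ^ ((Nat.log 2 n + c) ^ c) := by
  unfold PerMultiplesHard at hneg
  push Not at hneg
  obtain ⟨c, hc⟩ := hneg
  refine ⟨c, fun n₀ => ?_⟩
  obtain ⟨n, hn, h, hh, hle⟩ := hc n₀
  obtain ⟨f, hf0, hdvd, hfc⟩ := exists_complex_multiple_le hh
  exact ⟨n, hn, f, hf0, hdvd, hfc.trans hle⟩

/-- LITERATURE HYPOTHESIS (not in the tree): **the border determinantal complexity of `per_n` is
quasi-polynomially bounded in its complex exclusion complexity.**  Composition of
(1) Bürgisser 2004, Thm 1.3: `L̲(g) ≤ O(M(d)M(d⁴)·EC(g) + d^{2γ}M(d)²)` for every `g` of degree `d` over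
a field of characteristic zero (`L̲` = approximative complexity), applied to `g = per_n`, `d = n`; and
(2) an approximative circuit of size `S` for a form of degree `n` yields, by Valiant–Skyum–Berkowitz–
Rackoff depth reduction over `ℂ(ε)` and universality of the determinant for the resulting formulas,
`ℓ^{m-n} per_n ∈ \overline{GL_{m²} det_m}` with `n ≤ m ≤ S^{O(log n)}` (Bürgisser 2004 §5;
Bürgisser–Landsberg–Manivel–Weyman 2011 §9).  Constants absorbed into one exponent `a`.
[cite: Burgisser2004Factors, Thm 1.3] [topic: Computability/AlgebraicComplexity] -/
def ExclusionControlsBorderDc : Prop :=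
  ∃ a : ℕ, ∀ n : ℕ, ∀ f : MvPolynomial (Fin n × Fin n) ℂ, f ≠ 0 → perPoly (Fin n) ℂ ∣ f →
    borderDetComplexityPer ℂ n ≤ 2 ^ ((Nat.log 2 (complexity f + n) + a) ^ a)

/-- The quasi-polynomial, almost-everywhere Mulmuley–Sohoni hypothesis for the permanent:
`\underline{dc}(per_n)` eventually exceeds every quasi-polynomial `2^{(log₂ n + c)^c}`
("`per ∉ \overline{VQP}`", the working hypothesis of geometric complexity theory; the tree's
`BorderDcPerSuperpolynomial` is its polynomial/i.o. shadow). [cite: MulmuleySohoni2001, §4] -/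
def BorderDcPerSuperQuasiPoly : Prop :=
  ∀ c : ℕ, ∃ n₀ : ℕ, ∀ n ≥ n₀, 2 ^ ((Nat.log 2 n + c) ^ c) < borderDetComplexityPer ℂ n

/-- SANITY LINK to the tree's registered open statement: the quasi-polynomial a.e. hypothesis used
here is at least as strong as `BorderDcPerSuperpolynomial` (Bürgisser–Landsberg–Manivel–Weyman 2011
Conj. 1.1, the i.o./polynomial shadow of Mulmuley–Sohoni Conj. 4.3, `Literature/…/GCT.lean`). -/
theorem borderDcPerSuperpolynomial_of_superQuasiPoly (h : BorderDcPerSuperQuasiPoly) :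
    BorderDcPerSuperpolynomial := by
  rintro ⟨c, hc⟩
  obtain ⟨n₀, hn₀⟩ := h (c + 2)
  obtain ⟨m, inst, hnm, hmle, hrepr⟩ := hc n₀
  have hbdc : borderDetComplexityPer ℂ n₀ ≤ m :=
    Nat.sInf_le ⟨Nat.pos_of_ne_zero (NeZero.ne m), hnm, hrepr⟩
  have hlt := hn₀ n₀ le_rfl
  set L := Nat.log 2 n₀ with hL
  have hn : n₀ ≤ 2 ^ (L + 1) := (Nat.lt_pow_succ_log_self (by norm_num) n₀).le
  have h1 : n₀ ^ c ≤ 2 ^ ((L + 1) * c) := by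
    rw [pow_mul]; exact Nat.pow_le_pow_left hn c
  have h2 : 1 ≤ 2 ^ ((L + 1) * c) := Nat.one_le_two_pow
  have hc2 : c + 1 ≤ 2 ^ c := Nat.lt_two_pow_self
  have h3 : n₀ ^ c + c ≤ 2 ^ ((L + 1) * c + c) := by
    rw [pow_add]
    have key : ∀ x y : ℕ, 1 ≤ x → x + y ≤ x * (y + 1) := fun x y hx => by nlinarith
    calc n₀ ^ c + c ≤ 2 ^ ((L + 1) * c) + c := by omega
      _ ≤ 2 ^ ((L + 1) * c) * (c + 1) := key _ _ h2
      _ ≤ 2 ^ ((L + 1) * c) * 2 ^ c := Nat.mul_le_mul_left _ hc2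
  have h4 : (L + 1) * c + c ≤ (L + (c + 2)) ^ (c + 2) := by
    calc (L + 1) * c + c ≤ (L + (c + 2)) ^ 2 := by nlinarith
      _ ≤ (L + (c + 2)) ^ (c + 2) := Nat.pow_le_pow_right (by omega) (by omega)
  have h5 : n₀ ^ c + c ≤ 2 ^ ((L + (c + 2)) ^ (c + 2)) :=
    h3.trans (Nat.pow_le_pow_right (by norm_num) h4)
  omega

/-- Arithmetic: `T + P ≤ T·P + 1` for `T, P ≥ 1`. [folklore] -/
theorem add_le_mul_add_one {T P : ℕ} (hT : 1 ≤ T) (hP : 1 ≤ P) : T + P ≤ T * P + 1 := by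
  obtain ⟨t, rfl⟩ : ∃ t, T = t + 1 := ⟨T - 1, by omega⟩
  obtain ⟨p, rfl⟩ : ∃ p, P = p + 1 := ⟨P - 1, by omega⟩
  nlinarith [Nat.zero_le (t * p)]

/-- Arithmetic: one quasi-polynomial exponent absorbs the composition of two. [folklore] -/
theorem growth_absorb (L c a : ℕ) :
    ((L + c) ^ c + (L + 1) + a) ^ a ≤ (L + (c + a + 2) * (a + 1)) ^ ((c + a + 2) * (a + 1)) := by
  have h1 : 1 ≤ (L + c) ^ c := by
    cases c with
    | zero => simp
    | succ k => exact Nat.one_le_pow _ _ (by omega)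
  have hA : (L + c) ^ c + (L + 1) + a ≤ (L + c + a + 2) ^ (c + 1) := by
    have hmono : (L + c) ^ c ≤ (L + c + a + 2) ^ c := Nat.pow_le_pow_left (by omega) c
    have e1 := Nat.mul_le_mul_right (L + c + a + 2) hmono
    have e2 := Nat.mul_le_mul_right (L + c + a + 1) h1
    rw [pow_succ]
    nlinarith [e1, e2]
  calc ((L + c) ^ c + (L + 1) + a) ^ a
      ≤ ((L + c + a + 2) ^ (c + 1)) ^ a := Nat.pow_le_pow_left hA a
    _ = (L + c + a + 2) ^ ((c + 1) * a) := by rw [← pow_mul]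
    _ ≤ (L + (c + a + 2) * (a + 1)) ^ ((c + 1) * a) := Nat.pow_le_pow_left (by nlinarith) _
    _ ≤ (L + (c + a + 2) * (a + 1)) ^ ((c + a + 2) * (a + 1)) :=
        Nat.pow_le_pow_right (by nlinarith) (by nlinarith)

/-- **The cost of a refutation (checked modulo the literature hypothesis `H`).**  A refutation of
`PerMultiplesHard` yields `\underline{dc}(per_n) ≤ 2^{(log₂ n + c)^c}` for infinitely many `n`.
[cite: Burgisser2004Factors, Thm 1.3] -/
theorem borderDc_quasipoly_io_of_not_perMultiplesHard (H : ExclusionControlsBorderDc)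
    (hneg : ¬ PerMultiplesHard) :
    ∃ c : ℕ, ∀ n₀ : ℕ, ∃ n ≥ n₀, borderDetComplexityPer ℂ n ≤ 2 ^ ((Nat.log 2 n + c) ^ c) := by
  obtain ⟨a, ha⟩ := H
  obtain ⟨c, hc⟩ := exclusion_quasipoly_io_of_not_perMultiplesHard hneg
  refine ⟨(c + a + 2) * (a + 1), fun n₀ => ?_⟩
  obtain ⟨n, hn, f, hf0, hdvd, hfc⟩ := hc n₀
  refine ⟨n, hn, ?_⟩
  have hle := ha n f hf0 hdvd
  have hT : 1 ≤ 2 ^ ((Nat.log 2 n + c) ^ c) := Nat.one_le_two_pow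
  have hP : 1 ≤ 2 ^ (Nat.log 2 n + 1) := Nat.one_le_two_pow
  have hnlt : n < 2 ^ (Nat.log 2 n + 1) := Nat.lt_pow_succ_log_self (by norm_num) n
  have hkey := add_le_mul_add_one hT hP
  have hsum : complexity f + n ≤ 2 ^ ((Nat.log 2 n + c) ^ c + (Nat.log 2 n + 1)) := by
    rw [pow_add]
    omega
  have hlog : Nat.log 2 (complexity f + n) ≤ (Nat.log 2 n + c) ^ c + (Nat.log 2 n + 1) := by
    have := Nat.log_mono_right (b := 2) hsum
    rwa [Nat.log_pow (by norm_num)] at this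
  have hexp : (Nat.log 2 (complexity f + n) + a) ^ a ≤
      (Nat.log 2 n + (c + a + 2) * (a + 1)) ^ ((c + a + 2) * (a + 1)) :=
    (Nat.pow_le_pow_left (Nat.add_le_add_right hlog a) a).trans (growth_absorb (Nat.log 2 n) c a)
  exact hle.trans (Nat.pow_le_pow_right (by norm_num) hexp)

/-- … equivalently: under `H`, `¬ PerMultiplesHard` refutes the quasi-polynomial Mulmuley–Sohoni
hypothesis for the permanent.  So no cheap kill exists: a counterexample `h` — of any degree, any
multiplicity — puts `per_n` in border-`VQP` over `ℂ` for infinitely many `n`.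
[cite: Burgisser2004Factors, Thm 1.3] -/
theorem not_borderDcPerSuperQuasiPoly_of_not_perMultiplesHard (H : ExclusionControlsBorderDc)
    (hneg : ¬ PerMultiplesHard) : ¬ BorderDcPerSuperQuasiPoly := by
  intro hB
  obtain ⟨c, hc⟩ := borderDc_quasipoly_io_of_not_perMultiplesHard H hneg
  obtain ⟨n₀, hn₀⟩ := hB c
  obtain ⟨n, hn, hle⟩ := hc n₀
  exact absurd (hn₀ n hn) (not_lt.mpr hle)

/-- … and positively (workfile only; a conditional derivation, not a proof of the crux): the crux
FOLLOWS from the literature bound and the quasi-polynomial Mulmuley–Sohoni hypothesis. -/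
theorem perMultiplesHard_of_qpMS (H : ExclusionControlsBorderDc) (hMS : BorderDcPerSuperQuasiPoly) :
    PerMultiplesHard := by
  by_contra hneg
  exact not_borderDcPerSuperQuasiPoly_of_not_perMultiplesHard H hneg hMS

/-- NEAR-MISS (sorried; literature, see `ExclusionControlsBorderDc`): vendoring Bürgisser 2004
Thm 1.3 needs approximative circuits over `ℂ[[ε]]` and their conversion to orbit-closure membership,
neither in the tree (several hundred lines; a Literature task, not a crux task). -/
theorem exclusionControlsBorderDc_holds : ExclusionControlsBorderDc := by
  sorry

end Exclusion

end Summit.ValiantsHypothesis.ValiantsHypothesis.Cruxes.PerMultiplesHard.Disproof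

/-! ## (h) TOP FORMS ARE FREE — WLOG the multiplier is multihomogeneous (sorry-free)

Landing copy: `Theorems/PerMultiplesHard/Negative/TopForms.lean`.  Over `ℝ≥0` the top
`w`-homogeneous component of every gate of a monotone circuit is computed by a monotone circuit of the
same size (`complexity_topForm_le`); `per_n` is homogeneous for the `2n` row/column weights, so
`L⁺(per_n · multiTop h) ≤ L⁺(per_n · h)` with `multiTop h ≠ 0` multihomogeneous
(`exists_multihomogeneous_multiple_le`), and the crux is equivalent to its restriction to
multihomogeneous multipliers (`perMultiplesHard_iff_multihomogeneous`). -/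

namespace Summit.ValiantsHypothesis.ValiantsHypothesis.Cruxes.PerMultiplesHard.Disproof.TopForm

open MvPolynomial
open Finsupp (weight)
open scoped NNReal

variable {σ : Type*} (w : σ → ℕ)

/-- The top `w`-homogeneous component ("leading form") of a polynomial over `ℝ≥0`. -/
def topForm (p : MvPolynomial σ ℝ≥0) : MvPolynomial σ ℝ≥0 :=
  weightedHomogeneousComponent w (weightedTotalDegree w p) p

theorem coeff_topForm [DecidableEq ℕ] (p : MvPolynomial σ ℝ≥0) (d : σ →₀ ℕ) :
    coeff d (topForm w p) = if weight w d = weightedTotalDegree w p then coeff d p else 0 := by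
  classical
  unfold topForm
  convert coeff_weightedHomogeneousComponent (weightedTotalDegree w p) p d

@[simp] theorem topForm_zero : topForm w (0 : MvPolynomial σ ℝ≥0) = 0 := by
  simp [topForm]

theorem isWeightedHomogeneous_topForm (p : MvPolynomial σ ℝ≥0) :
    IsWeightedHomogeneous w (topForm w p) (weightedTotalDegree w p) :=
  weightedHomogeneousComponent_isWeightedHomogeneous _ _

theorem exists_weight_eq {p : MvPolynomial σ ℝ≥0} (hp : p ≠ 0) :
    ∃ d ∈ p.support, weight w d = weightedTotalDegree w p := by
  obtain ⟨d, hd, h⟩ := Finset.exists_mem_eq_sup p.support (support_nonempty.mpr hp) (fun s => weight w s)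
  exact ⟨d, hd, h.symm⟩

theorem topForm_ne_zero {p : MvPolynomial σ ℝ≥0} (hp : p ≠ 0) : topForm w p ≠ 0 := by
  classical
  obtain ⟨d, hd, hdeg⟩ := exists_weight_eq w hp
  intro h0
  have h := congrArg (coeff d) h0
  rw [coeff_topForm, if_pos hdeg, coeff_zero] at h
  exact (MvPolynomial.mem_support_iff.1 hd) h

theorem topForm_of_isWeightedHomogeneous {p : MvPolynomial σ ℝ≥0} {m : ℕ}
    (hp : IsWeightedHomogeneous w p m) : topForm w p = p := by
  by_cases h0 : p = 0
  · rw [h0, topForm_zero]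
  · have hdeg : weightedTotalDegree w p = m := by
      have h := hp.weighted_total_degree h0
      rw [weightedTotalDegree_coe w p h0] at h
      exact_mod_cast h
    rw [topForm, hdeg]
    exact hp.weightedHomogeneousComponent_same

@[simp] theorem topForm_X (i : σ) : topForm w (X i : MvPolynomial σ ℝ≥0) = X i :=
  topForm_of_isWeightedHomogeneous w (isWeightedHomogeneous_X ℝ≥0 w i)

@[simp] theorem topForm_C (c : ℝ≥0) : topForm w (C c : MvPolynomial σ ℝ≥0) = C c :=
  topForm_of_isWeightedHomogeneous w (isWeightedHomogeneous_C w c)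

@[simp] theorem topForm_one : topForm w (1 : MvPolynomial σ ℝ≥0) = 1 :=
  topForm_of_isWeightedHomogeneous w (isWeightedHomogeneous_one ℝ≥0 w)

/-! No cancellation over `ℝ≥0`. -/

theorem coeff_list_sum (d : σ →₀ ℕ) (ts : List (MvPolynomial σ ℝ≥0)) :
    coeff d ts.sum = (ts.map fun t => coeff d t).sum := by
  induction ts with
  | nil => simp
  | cons t ts ih => rw [List.sum_cons, coeff_add, List.map_cons, List.sum_cons, ih]

theorem support_subset_of_mem_list {ts : List (MvPolynomial σ ℝ≥0)} {t : MvPolynomial σ ℝ≥0}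
    (ht : t ∈ ts) : t.support ⊆ ts.sum.support := by
  intro d hd
  rw [MvPolynomial.mem_support_iff] at hd ⊢
  have hle : coeff d t ≤ coeff d ts.sum := by
    rw [coeff_list_sum]
    exact List.le_sum_of_mem (List.mem_map.2 ⟨t, ht, rfl⟩)
  exact fun h0 => hd (nonpos_iff_eq_zero.1 (h0 ▸ hle))

theorem weightedTotalDegree_mono {p q : MvPolynomial σ ℝ≥0} (h : p.support ⊆ q.support) :
    weightedTotalDegree w p ≤ weightedTotalDegree w q :=
  Finset.sup_mono h

theorem coeff_eq_zero_of_lt {p : MvPolynomial σ ℝ≥0} {d : σ →₀ ℕ}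
    (h : weightedTotalDegree w p < weight w d) : coeff d p = 0 := by
  by_contra hne
  exact absurd (le_weightedTotalDegree w (MvPolynomial.mem_support_iff.2 hne)) (not_le.2 h)

/-- **Top forms of sums over `ℝ≥0`:** the top form of a (list) sum is the sum of the top forms of
those summands whose degree attains the degree of the sum. -/
theorem topForm_list_sum (ts : List (MvPolynomial σ ℝ≥0)) :
    topForm w ts.sum =
      (ts.map fun t => if weightedTotalDegree w t = weightedTotalDegree w ts.sum then topForm w t else 0).sum := by
  classical
  refine MvPolynomial.ext _ _ fun d => ?_
  rw [coeff_topForm, coeff_list_sum d (List.map _ ts), List.map_map]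
  by_cases hd : weight w d = weightedTotalDegree w ts.sum
  · rw [if_pos hd, coeff_list_sum]
    congr 1
    apply List.map_congr_left
    intro t ht
    simp only [Function.comp_apply]
    by_cases hdeg : weightedTotalDegree w t = weightedTotalDegree w ts.sum
    · rw [if_pos hdeg, coeff_topForm, if_pos (hd.trans hdeg.symm)]
    · rw [if_neg hdeg, coeff_zero]
      apply coeff_eq_zero_of_lt w
      have hle := weightedTotalDegree_mono w (support_subset_of_mem_list ht)
      omega
  · rw [if_neg hd]
    symm
    apply List.sum_eq_zero
    intro x hx
    obtain ⟨t, -, rfl⟩ := List.mem_map.1 hx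
    simp only [Function.comp_apply]
    split_ifs with hdeg
    · rw [coeff_topForm, if_neg (hdeg ▸ hd)]
    · rfl

/-- **Top forms of products over `ℝ≥0`** (no zero divisors): multiplicative. -/
theorem topForm_mul (p q : MvPolynomial σ ℝ≥0) : topForm w (p * q) = topForm w p * topForm w q := by
  classical
  by_cases hp : p = 0
  · simp [hp]
  by_cases hq : q = 0
  · simp [hq]
  set a := weightedTotalDegree w p with ha
  set b := weightedTotalDegree w q with hb
  -- (1) every monomial of `p * q` has weight `≤ a + b`
  have hle : ∀ d ∈ (p * q).support, weight w d ≤ a + b := by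
    intro d hd
    obtain ⟨e, he, f, hf, rfl⟩ := Finset.mem_add.1 (support_mul p q hd)
    rw [map_add]
    exact add_le_add (le_weightedTotalDegree w he) (le_weightedTotalDegree w hf)
  -- (2) on weight `a + b` the coefficients of `p * q` and `Tp * Tq` agree
  have hcoeff : ∀ d, weight w d = a + b → coeff d (p * q) = coeff d (topForm w p * topForm w q) := by
    intro d hd
    rw [coeff_mul, coeff_mul]
    apply Finset.sum_congr rfl
    intro x hx
    rw [Finset.HasAntidiagonal.mem_antidiagonal] at hx
    rw [coeff_topForm, coeff_topForm]
    by_cases he : weight w x.1 = a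
    · by_cases hf : weight w x.2 = b
      · rw [if_pos he, if_pos hf]
      · -- weight x.2 ≠ b: then coeff x.2 q = 0 unless weight < b, but weights must add up
        rw [if_pos he, if_neg hf, mul_zero]
        by_cases hq0 : coeff x.2 q = 0
        · rw [hq0, mul_zero]
        · exfalso
          have h2 := le_weightedTotalDegree w (MvPolynomial.mem_support_iff.2 hq0)
          have hsum : weight w x.1 + weight w x.2 = a + b := by rw [← map_add, hx, hd]
          omega
    · rw [if_neg he, zero_mul]
      by_cases hp0 : coeff x.1 p = 0
      · rw [hp0, zero_mul]
      · by_cases hq0 : coeff x.2 q = 0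
        · rw [hq0, mul_zero]
        · exfalso
          have h1 := le_weightedTotalDegree w (MvPolynomial.mem_support_iff.2 hp0)
          have h2 := le_weightedTotalDegree w (MvPolynomial.mem_support_iff.2 hq0)
          have hsum : weight w x.1 + weight w x.2 = a + b := by rw [← map_add, hx, hd]
          omega
  -- (3) `Tp * Tq` is nonzero and homogeneous of weight `a + b`, so `wdeg (p q) = a + b`
  have hhom : IsWeightedHomogeneous w (topForm w p * topForm w q) (a + b) :=
    (isWeightedHomogeneous_topForm w p).mul (isWeightedHomogeneous_topForm w q)
  have hne : topForm w p * topForm w q ≠ 0 := mul_ne_zero (topForm_ne_zero w hp) (topForm_ne_zero w hq)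
  have hdeg : weightedTotalDegree w (p * q) = a + b := by
    apply le_antisymm (Finset.sup_le hle)
    obtain ⟨d, hd⟩ := exists_coeff_ne_zero hne
    have hwd : weight w d = a + b := hhom hd
    rw [← hcoeff d hwd] at hd
    exact hwd ▸ le_weightedTotalDegree w (MvPolynomial.mem_support_iff.2 hd)
  -- (4) conclude coefficientwise
  refine MvPolynomial.ext _ _ fun d => ?_
  rw [coeff_topForm, hdeg]
  split_ifs with hwd
  · exact hcoeff d hwd
  · exact (hhom.coeff_eq_zero d hwd).symm

theorem topForm_list_prod (ts : List (MvPolynomial σ ℝ≥0)) :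
    topForm w ts.prod = (ts.map (topForm w)).prod := by
  induction ts with
  | nil => simp
  | cons t ts ih => rw [List.prod_cons, List.map_cons, List.prod_cons, topForm_mul, ih]

theorem topForm_smul (c : ℝ≥0) (p : MvPolynomial σ ℝ≥0) : topForm w (c • p) = c • topForm w p := by
  classical
  by_cases hc : c = 0
  · simp [hc]
  have hsupp : (c • p).support = p.support := by
    ext d
    simp [MvPolynomial.mem_support_iff, hc]
  refine MvPolynomial.ext _ _ fun d => ?_
  rw [coeff_topForm, coeff_smul, coeff_smul, coeff_topForm]
  unfold weightedTotalDegree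
  rw [hsupp]
  split_ifs <;> simp


/-! ### Homogeneity is inherited by top forms -/

theorem IsWeightedHomogeneous.topForm_of {w' : σ → ℕ} {p : MvPolynomial σ ℝ≥0} {m : ℕ}
    (hp : IsWeightedHomogeneous w' p m) : IsWeightedHomogeneous w' (topForm w p) m := by
  classical
  intro d hd
  rw [coeff_topForm] at hd
  split_ifs at hd with h
  · exact hp hd
  · exact absurd rfl hd

/-! ### The circuit transformation: every gate replaced by its top form -/

open Literature.Computability.AlgebraicComplexity ArithCircuit

/-- Operands commute with top forms (inputs and constants are homogeneous; junk reads `0`). -/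
theorem Operand.eval_topForm (vals : List (MvPolynomial σ ℝ≥0)) (u : Operand ℝ≥0 σ) :
    u.eval (vals.map (topForm w)) = topForm w (u.eval vals) := by
  cases u with
  | var i => simp [Operand.eval]
  | const c => simp [Operand.eval]
  | gate j =>
    simp only [Operand.eval, List.getD_eq_getElem?_getD, List.getElem?_map]
    cases vals[j]? <;> simp

/-- The replacement gate: product gates are kept; in a sum gate the coefficients of the summands
whose degree does not attain the degree of the sum are set to `0`. -/
def newGate (vals : List (MvPolynomial σ ℝ≥0)) : Gate ℝ≥0 σ → Gate ℝ≥0 σ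
  | .prod args => .prod args
  | .sum args => .sum (args.map fun a =>
      (if weightedTotalDegree w (a.1 • a.2.eval vals) =
          weightedTotalDegree w ((Gate.sum args).eval vals) then a.1 else 0, a.2))

theorem fanIn_newGate (vals : List (MvPolynomial σ ℝ≥0)) (g : Gate ℝ≥0 σ) :
    (newGate w vals g).fanIn = g.fanIn := by
  cases g <;> simp [newGate, Gate.fanIn, Gate.args]

theorem eval_newGate (vals : List (MvPolynomial σ ℝ≥0)) (g : Gate ℝ≥0 σ) :
    (newGate w vals g).eval (vals.map (topForm w)) = topForm w (g.eval vals) := by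
  cases g with
  | sum args =>
    simp only [newGate, Gate.eval, List.map_map]
    rw [topForm_list_sum, List.map_map]
    congr 1
    apply List.map_congr_left
    intro a _
    simp only [Function.comp_apply, Operand.eval_topForm]
    split_ifs with h
    · rw [topForm_smul]
    · rw [zero_smul]
  | prod args =>
    simp only [newGate, Gate.eval]
    rw [topForm_list_prod, List.map_map]
    congr 1
    apply List.map_congr_left
    intro u _
    simp only [Function.comp_apply, Operand.eval_topForm]

/-- Gate lists: same length, same fan-in bound, values replaced by their top forms. -/
theorem exists_gates_topForm (gs : List (Gate ℝ≥0 σ)) (h2 : ∀ g ∈ gs, g.fanIn ≤ 2) :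
    ∃ gs' : List (Gate ℝ≥0 σ), gs'.length = gs.length ∧ (∀ g ∈ gs', g.fanIn ≤ 2) ∧
      gateValues gs' = (gateValues gs).map (topForm w) := by
  induction gs using List.reverseRecOn with
  | nil => exact ⟨[], rfl, fun g hg => by simp at hg, by simp [gateValues]⟩
  | append_singleton gs g ih =>
    obtain ⟨gs', hlen, hfan, hval⟩ := ih (fun g' hg' => h2 g' (List.mem_append_left _ hg'))
    refine ⟨gs' ++ [newGate w (gateValues gs) g], by simp [hlen], ?_, ?_⟩
    · intro g' hg'
      rw [List.mem_append, List.mem_singleton] at hg'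
      rcases hg' with h | rfl
      · exact hfan g' h
      · rw [fanIn_newGate]
        exact h2 g (List.mem_append_right _ (List.mem_singleton_self g))
    · rw [gateValues_append_singleton, gateValues_append_singleton, hval, List.map_append,
        List.map_singleton, eval_newGate]

/-- **Top forms are free for monotone circuits**: `L⁺(topForm_w f) ≤ L⁺(f)` over `ℝ≥0`, for every
weight `w` (no cancellation in sums, no zero divisors in products). [folklore] -/
theorem complexity_topForm_le (f : MvPolynomial σ ℝ≥0) : complexity (topForm w f) ≤ complexity f := by
  obtain ⟨P, h2, hf, hs⟩ := ArithCircuit.exists_computes_size_eq_complexity f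
  obtain ⟨gs', hlen, hfan, hval⟩ := exists_gates_topForm w P.gates h2
  let Q : ArithCircuit ℝ≥0 σ := ⟨gs', P.output⟩
  have hQ2 : Q.IsFanInTwo := hfan
  have hQf : Q.Computes (topForm w f) := by
    unfold ArithCircuit.Computes at hf ⊢
    change P.output.eval (gateValues gs') = topForm w f
    rw [hval, Operand.eval_topForm, ← hf]
    rfl
  calc complexity (topForm w f) ≤ Q.size := ArithCircuit.complexity_le_size hQ2 hQf
    _ = P.size := hlen
    _ = complexity f := hs

/-! ### Iterated top forms -/

/-- Iterate top forms over a list of weights (right fold: the head weight is applied last). -/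
def multiTop (ws : List (σ → ℕ)) (h : MvPolynomial σ ℝ≥0) : MvPolynomial σ ℝ≥0 :=
  ws.foldr (fun w' acc => topForm w' acc) h

@[simp] theorem multiTop_nil (h : MvPolynomial σ ℝ≥0) : multiTop [] h = h := rfl

@[simp] theorem multiTop_cons (w' : σ → ℕ) (ws : List (σ → ℕ)) (h : MvPolynomial σ ℝ≥0) :
    multiTop (w' :: ws) h = topForm w' (multiTop ws h) := rfl

theorem multiTop_ne_zero (ws : List (σ → ℕ)) {h : MvPolynomial σ ℝ≥0} (hh : h ≠ 0) :
    multiTop ws h ≠ 0 := by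
  induction ws with
  | nil => exact hh
  | cons w' ws ih => rw [multiTop_cons]; exact topForm_ne_zero w' ih

theorem isWeightedHomogeneous_multiTop (ws : List (σ → ℕ)) (h : MvPolynomial σ ℝ≥0)
    {w' : σ → ℕ} (hw : w' ∈ ws) : ∃ m, IsWeightedHomogeneous w' (multiTop ws h) m := by
  induction ws with
  | nil => simp at hw
  | cons w₀ ws ih =>
    rw [multiTop_cons]
    rw [List.mem_cons] at hw
    rcases hw with rfl | hw
    · exact ⟨_, isWeightedHomogeneous_topForm w' _⟩
    · obtain ⟨m, hm⟩ := ih hw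
      exact ⟨m, IsWeightedHomogeneous.topForm_of w₀ hm⟩

/-- `L⁺(multiTop ws h) ≤ L⁺(h)`. -/
theorem complexity_multiTop_le (ws : List (σ → ℕ)) (h : MvPolynomial σ ℝ≥0) :
    complexity (multiTop ws h) ≤ complexity h := by
  induction ws with
  | nil => exact le_rfl
  | cons w₀ ws ih => rw [multiTop_cons]; exact (complexity_topForm_le w₀ _).trans ih

/-- Multiplying by a polynomial `f` that is homogeneous for every weight in the list commutes
with `multiTop`, and costs nothing: `L⁺(f · multiTop ws h) ≤ L⁺(f · h)`. -/
theorem complexity_mul_multiTop_le (ws : List (σ → ℕ)) (f h : MvPolynomial σ ℝ≥0)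
    (hf : ∀ w' ∈ ws, ∃ m, IsWeightedHomogeneous w' f m) :
    complexity (f * multiTop ws h) ≤ complexity (f * h) := by
  induction ws with
  | nil => exact le_rfl
  | cons w₀ ws ih =>
    have hf' : ∀ w' ∈ ws, ∃ m, IsWeightedHomogeneous w' f m :=
      fun w' hw' => hf w' (List.mem_cons_of_mem _ hw')
    obtain ⟨m, hm⟩ := hf w₀ (List.mem_cons_self)
    rw [multiTop_cons]
    have key : f * topForm w₀ (multiTop ws h) = topForm w₀ (f * multiTop ws h) := by
      rw [topForm_mul, topForm_of_isWeightedHomogeneous w₀ hm]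
    rw [key]
    exact (complexity_topForm_le w₀ _).trans (ih hf')

/-! ### The permanent: row and column gradings -/

section Permanent

variable {n : ℕ}

/-- Potential weights `w(r, c) = a r + b c` — exactly the weights constant on permutation patterns. -/
def potWeight (a b : Fin n → ℕ) : Fin n × Fin n → ℕ := fun v => a v.1 + b v.2

/-- Row weight: counts the variables taken from row `r`. -/
def rowWeight (r : Fin n) : Fin n × Fin n → ℕ := fun v => if v.1 = r then 1 else 0

/-- Column weight: counts the variables taken from column `c`. -/
def colWeight (c : Fin n) : Fin n × Fin n → ℕ := fun v => if v.2 = c then 1 else 0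

theorem weight_permMonomial (w' : Fin n × Fin n → ℕ) (ρ : Equiv.Perm (Fin n)) :
    weight w' (permMonomial ρ) = ∑ i, w' (ρ i, i) := by
  change weight w' (∑ i, Finsupp.single (ρ i, i) 1) = _
  rw [map_sum]
  exact Finset.sum_congr rfl fun i _ => by rw [Finsupp.weight_single, one_smul]

/-- The permanent is homogeneous for every potential weight. [folklore] -/
theorem isWeightedHomogeneous_perPoly_pot (a b : Fin n → ℕ) :
    IsWeightedHomogeneous (potWeight a b) (perPoly (Fin n) ℝ≥0) (∑ i, a i + ∑ i, b i) := by
  rw [perPoly_eq_sum_monomial]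
  apply IsWeightedHomogeneous.sum
  intro ρ _
  apply isWeightedHomogeneous_monomial
  rw [weight_permMonomial]
  simp only [potWeight, Finset.sum_add_distrib]
  rw [Equiv.sum_comp ρ a]

/-- The permanent is homogeneous of degree `1` for every row weight. [folklore] -/
theorem isWeightedHomogeneous_perPoly_row (r : Fin n) :
    IsWeightedHomogeneous (rowWeight r) (perPoly (Fin n) ℝ≥0) 1 := by
  rw [perPoly_eq_sum_monomial]
  apply IsWeightedHomogeneous.sum
  intro ρ _
  apply isWeightedHomogeneous_monomial
  rw [weight_permMonomial]
  simp only [rowWeight]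
  simp [Equiv.apply_eq_iff_eq_symm_apply, Finset.sum_ite_eq']

/-- The permanent is homogeneous of degree `1` for every column weight. [folklore] -/
theorem isWeightedHomogeneous_perPoly_col (c : Fin n) :
    IsWeightedHomogeneous (colWeight c) (perPoly (Fin n) ℝ≥0) 1 := by
  rw [perPoly_eq_sum_monomial]
  apply IsWeightedHomogeneous.sum
  intro ρ _
  apply isWeightedHomogeneous_monomial
  rw [weight_permMonomial]
  simp only [colWeight]
  simp [Finset.sum_ite_eq']

/-- All `2n` row and column weights. -/
def rowColWeights (n : ℕ) : List (Fin n × Fin n → ℕ) :=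
  (List.finRange n).map rowWeight ++ (List.finRange n).map colWeight

theorem perPoly_homogeneous_rowCol : ∀ w' ∈ rowColWeights n, ∃ m, IsWeightedHomogeneous w' (perPoly (Fin n) ℝ≥0) m := by
  intro w' hw
  simp only [rowColWeights, List.mem_append, List.mem_map, List.mem_finRange, true_and] at hw
  rcases hw with ⟨r, rfl⟩ | ⟨c, rfl⟩
  · exact ⟨1, isWeightedHomogeneous_perPoly_row r⟩
  · exact ⟨1, isWeightedHomogeneous_perPoly_col c⟩

/-- `h` is multihomogeneous: every monomial of `h` takes the same number of variables from row `r`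
(for each `r`) and from column `c` (for each `c`). -/
def IsMultihomogeneous (h : MvPolynomial (Fin n × Fin n) ℝ≥0) : Prop :=
  (∀ r : Fin n, ∃ m, IsWeightedHomogeneous (rowWeight r) h m) ∧
    (∀ c : Fin n, ∃ m, IsWeightedHomogeneous (colWeight c) h m)

theorem isMultihomogeneous_multiTop (h : MvPolynomial (Fin n × Fin n) ℝ≥0) :
    IsMultihomogeneous (multiTop (rowColWeights n) h) := by
  refine ⟨fun r => isWeightedHomogeneous_multiTop _ _ ?_, fun c => isWeightedHomogeneous_multiTop _ _ ?_⟩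
  · simp [rowColWeights]
  · simp [rowColWeights]

/-- **WLOG the multiplier is multihomogeneous (at no cost).** For every nonzero `h` there is a
nonzero multihomogeneous `h'` (all row and column degrees of its monomials fixed) with
`L⁺(per_n · h') ≤ L⁺(per_n · h)`: take iterated top forms for the `2n` row/column gradings, for
which `per_n` is homogeneous. So counterexamples to `PerMultiplesHard`, if any, may be sought among
multihomogeneous multipliers only. [folklore] -/
theorem exists_multihomogeneous_multiple_le {h : MvPolynomial (Fin n × Fin n) ℝ≥0} (hh : h ≠ 0) :
    ∃ h' : MvPolynomial (Fin n × Fin n) ℝ≥0, h' ≠ 0 ∧ IsMultihomogeneous h' ∧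
      complexity (perPoly (Fin n) ℝ≥0 * h') ≤ complexity (perPoly (Fin n) ℝ≥0 * h) :=
  ⟨multiTop (rowColWeights n) h, multiTop_ne_zero _ hh, isMultihomogeneous_multiTop h,
    complexity_mul_multiTop_le _ _ _ perPoly_homogeneous_rowCol⟩


/-- **WLOG for the charged pair as well** (crux `PerDivisionHard`, H1 of the route): for every nonzero
`h` there is a nonzero multihomogeneous `h'` with `L⁺(per_n · h') ≤ L⁺(per_n · h)` AND
`L⁺(h') ≤ L⁺(h)`. [folklore] -/
theorem exists_multihomogeneous_pair_le {h : MvPolynomial (Fin n × Fin n) ℝ≥0} (hh : h ≠ 0) :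
    ∃ h' : MvPolynomial (Fin n × Fin n) ℝ≥0, h' ≠ 0 ∧
      IsMultihomogeneous h' ∧
      complexity (perPoly (Fin n) ℝ≥0 * h') ≤ complexity (perPoly (Fin n) ℝ≥0 * h) ∧
      complexity h' ≤ complexity h :=
  ⟨multiTop (rowColWeights n) h, multiTop_ne_zero _ hh, isMultihomogeneous_multiTop h,
    complexity_mul_multiTop_le _ _ _ perPoly_homogeneous_rowCol, complexity_multiTop_le _ _⟩

end Permanent


/-! ### Faces of the Birkhoff polytope: counterexamples are hereditary -/

section Faces

variable {n : ℕ}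

/-- The `0/1` weight of a set of positions `G` (a bipartite graph). -/
def graphWeight (G : Finset (Fin n × Fin n)) : Fin n × Fin n → ℕ := fun v => if v ∈ G then 1 else 0

/-- The permanent restricted to `G`: the sum of the permutation monomials contained in `G` — the
face of the Birkhoff polytope cut out by `G` (e.g. `G` block-diagonal: a product of smaller
permanents in disjoint variables). -/
def perRestrict (G : Finset (Fin n × Fin n)) : MvPolynomial (Fin n × Fin n) ℝ≥0 :=
  ∑ ρ ∈ Finset.univ.filter (fun ρ : Equiv.Perm (Fin n) => ∀ j, (ρ j, j) ∈ G),
    monomial (permMonomial ρ) 1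

theorem weight_graph_permMonomial (G : Finset (Fin n × Fin n)) (ρ : Equiv.Perm (Fin n)) :
    weight (graphWeight G) (permMonomial ρ) = (Finset.univ.filter fun j => (ρ j, j) ∈ G).card := by
  rw [weight_permMonomial, Finset.card_filter]
  rfl

theorem weight_graph_le (G : Finset (Fin n × Fin n)) (ρ : Equiv.Perm (Fin n)) :
    weight (graphWeight G) (permMonomial ρ) ≤ n := by
  rw [weight_graph_permMonomial]
  exact (Finset.card_filter_le _ _).trans (by simp)

theorem weight_graph_eq_iff (G : Finset (Fin n × Fin n)) (ρ : Equiv.Perm (Fin n)) :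
    weight (graphWeight G) (permMonomial ρ) = n ↔ ∀ j, (ρ j, j) ∈ G := by
  rw [weight_graph_permMonomial]
  constructor
  · intro h j
    have huniv : (Finset.univ.filter fun j => (ρ j, j) ∈ G) = Finset.univ :=
      Finset.eq_univ_of_card _ (by simpa using h)
    have hj := Finset.mem_univ j
    rw [← huniv, Finset.mem_filter] at hj
    exact hj.2
  · intro h
    rw [Finset.filter_true_of_mem (fun j _ => h j)]
    simp

theorem weightedTotalDegree_graph_perPoly {G : Finset (Fin n × Fin n)}
    (hG : ∃ ρ : Equiv.Perm (Fin n), ∀ j, (ρ j, j) ∈ G) :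
    weightedTotalDegree (graphWeight G) (perPoly (Fin n) ℝ≥0) = n := by
  apply le_antisymm
  · apply Finset.sup_le
    intro d hd
    obtain ⟨ρ, rfl⟩ := exists_permMonomial_eq_of_coeff_perPoly_ne_zero ℝ≥0
      (MvPolynomial.mem_support_iff.1 hd)
    exact weight_graph_le G ρ
  · obtain ⟨ρ, hρ⟩ := hG
    calc n = weight (graphWeight G) (permMonomial ρ) := ((weight_graph_eq_iff G ρ).2 hρ).symm
      _ ≤ weightedTotalDegree (graphWeight G) (perPoly (Fin n) ℝ≥0) := by
          apply le_weightedTotalDegree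
          rw [MvPolynomial.mem_support_iff, coeff_permMonomial_perPoly]
          exact one_ne_zero

/-- For `G` containing a perfect matching, the top `1_G`-form of `per_n` is `per_n` restricted to `G`. -/
theorem topForm_graph_perPoly {G : Finset (Fin n × Fin n)}
    (hG : ∃ ρ : Equiv.Perm (Fin n), ∀ j, (ρ j, j) ∈ G) :
    topForm (graphWeight G) (perPoly (Fin n) ℝ≥0) = perRestrict G := by
  classical
  refine MvPolynomial.ext _ _ fun d => ?_
  rw [coeff_topForm, weightedTotalDegree_graph_perPoly hG, perRestrict, coeff_sum, coeff_perPoly,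
    Finset.sum_filter]
  simp only [coeff_monomial]
  split_ifs with hw
  · apply Finset.sum_congr rfl
    intro ρ _
    by_cases hρd : permMonomial ρ = d
    · subst hρd
      simp [(weight_graph_eq_iff G ρ).1 hw]
    · simp [hρd]
  · symm
    apply Finset.sum_eq_zero
    intro ρ _
    by_cases hρG : ∀ j, (ρ j, j) ∈ G
    · rw [if_pos hρG]
      by_cases hρd : permMonomial ρ = d
      · subst hρd
        exact absurd ((weight_graph_eq_iff G ρ).2 hρG) hw
      · rw [if_neg hρd]
    · rw [if_neg hρG]

/-- **Counterexamples are hereditary to faces of the Birkhoff polytope.**  If `G` contains a perfect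
matching then for every nonzero `h` there is a nonzero `h'` with
`L⁺(per_n|_G · h') ≤ L⁺(per_n · h)`: a cheap multiple of `per_n` yields an equally cheap multiple of
every face restriction `per_n|_G` (e.g. of `per_k ⊗ per_{n-k}` for block-diagonal `G`). [folklore] -/
theorem exists_face_multiple_le {G : Finset (Fin n × Fin n)}
    (hG : ∃ ρ : Equiv.Perm (Fin n), ∀ j, (ρ j, j) ∈ G)
    {h : MvPolynomial (Fin n × Fin n) ℝ≥0} (hh : h ≠ 0) :
    ∃ h' : MvPolynomial (Fin n × Fin n) ℝ≥0, h' ≠ 0 ∧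
      complexity (perRestrict G * h') ≤ complexity (perPoly (Fin n) ℝ≥0 * h) := by
  refine ⟨topForm (graphWeight G) h, topForm_ne_zero _ hh, ?_⟩
  rw [← topForm_graph_perPoly hG, ← topForm_mul]
  exact complexity_topForm_le _ _

end Faces



/-- **The crux is equivalent to its restriction to multihomogeneous multipliers.** [folklore] -/
theorem perMultiplesHard_iff_multihomogeneous :
    Summit.ValiantsHypothesis.ValiantsHypothesis.Theses.DivisionGap.PerMultiplesHard ↔
      ∀ c : ℕ, ∃ n₀ : ℕ, ∀ n ≥ n₀, ∀ h : MvPolynomial (Fin n × Fin n) ℝ≥0, h ≠ 0 →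
        IsMultihomogeneous h → 2 ^ ((Nat.log 2 n + c) ^ c) < complexity (perPoly (Fin n) ℝ≥0 * h) := by
  constructor
  · intro H c
    obtain ⟨n₀, hn₀⟩ := H c
    exact ⟨n₀, fun n hn h hh _ => hn₀ n hn h hh⟩
  · intro H c
    obtain ⟨n₀, hn₀⟩ := H c
    refine ⟨n₀, fun n hn h hh => ?_⟩
    obtain ⟨h', hh', hmh, hle⟩ := exists_multihomogeneous_multiple_le hh
    exact (hn₀ n hn h' hh' hmh).trans_le hle

end Summit.ValiantsHypothesis.ValiantsHypothesis.Cruxes.PerMultiplesHard.Disproof.TopForm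


/-! ## (i) DIVIDING BY A VARIABLE COSTS A FACTOR 8 (sorry-free; landing copy `Negative/DivX.lean`)

`L(f) ≤ 8 · L(x_v · f)` over any additively cancellative commutative semiring (`complexity_le_of_X_mul`):
each gate `u` is replaced by eight gates computing the `x_v`-free part `u₀ = u %ᵐ x_v` and the quotient
`u₁ = u /ᵐ x_v` (`(uw)₀ = u₀w₀`, `(uw)₁ = u₁w₀ + u₀w₁ + x_v u₁w₁`).  The degree-one case of
Jukna–Seiwert–Sergeev 2022 Thm 1 / HY21 Prop 43(3) ("monomial multipliers do not help"), which is all the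
degree-`≤ 1` rung below needs. -/

namespace Summit.ValiantsHypothesis.ValiantsHypothesis.Cruxes.PerMultiplesHard.Disproof.DivX

open MvPolynomial
open Literature.Computability.AlgebraicComplexity ArithCircuit
open ArithCircuit (Gate Operand gateValues gateValues_append_singleton gateValues_length)

variable {k : Type*} [CommSemiring k] {σ : Type*} (v : σ)

/-- The `x_v`-free part. -/
abbrev P0 (p : MvPolynomial σ k) : MvPolynomial σ k := p.modMonomial (Finsupp.single v 1)
/-- The quotient part: `p = X v * P1 p + P0 p`. -/
abbrev P1 (p : MvPolynomial σ k) : MvPolynomial σ k := p.divMonomial (Finsupp.single v 1)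

theorem decomp (p : MvPolynomial σ k) : X v * P1 v p + P0 v p = p :=
  p.divMonomial_add_modMonomial_single v

theorem support_P0 (p : MvPolynomial σ k) : ∀ n ∈ (P0 v p).support, n v = 0 := by
  intro n hn
  by_contra h
  have hle : Finsupp.single v 1 ≤ n := by
    rw [Finsupp.single_le_iff]; omega
  exact (MvPolynomial.mem_support_iff.1 hn) (coeff_modMonomial_of_le p hle)

section Cancel
variable [IsLeftCancelAdd k]

theorem P0_mul (p q : MvPolynomial σ k) : P0 v (p * q) = P0 v p * P0 v q := by
  symm
  apply eq_modMonomial_single (q := P1 v p * P0 v q + P0 v p * P1 v q + X v * (P1 v p * P1 v q))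
  · conv_lhs => rw [← decomp v p, ← decomp v q]
    ring
  · intro n hn
    classical
    obtain ⟨a, ha, b, hb, rfl⟩ := Finset.mem_add.1 (support_mul _ _ hn)
    simp [support_P0 v p a ha, support_P0 v q b hb]

theorem P1_mul (p q : MvPolynomial σ k) :
    P1 v (p * q) = P1 v p * P0 v q + P0 v p * P1 v q + X v * (P1 v p * P1 v q) := by
  symm
  apply eq_divMonomial_single (r := P0 v p * P0 v q)
  · conv_lhs => rw [← decomp v p, ← decomp v q]
    ring
  · intro n hn
    classical
    obtain ⟨a, ha, b, hb, rfl⟩ := Finset.mem_add.1 (support_mul _ _ hn)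
    simp [support_P0 v p a ha, support_P0 v q b hb]

end Cancel

theorem P1_add (p q : MvPolynomial σ k) : P1 v (p + q) = P1 v p + P1 v q := add_divMonomial _ _ _

theorem P0_add (p q : MvPolynomial σ k) : P0 v (p + q) = P0 v p + P0 v q := by
  refine MvPolynomial.ext _ _ fun n => ?_
  by_cases h : Finsupp.single v 1 ≤ n
  · simp [coeff_modMonomial_of_le _ h]
  · simp [coeff_modMonomial_of_not_le _ h]

theorem P1_smul (c : k) (p : MvPolynomial σ k) : P1 v (c • p) = c • P1 v p := by
  refine MvPolynomial.ext _ _ fun n => ?_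
  simp [coeff_divMonomial, coeff_smul]

theorem P0_smul (c : k) (p : MvPolynomial σ k) : P0 v (c • p) = c • P0 v p := by
  refine MvPolynomial.ext _ _ fun n => ?_
  by_cases h : Finsupp.single v 1 ≤ n
  · simp [coeff_modMonomial_of_le _ h, coeff_smul]
  · simp [coeff_modMonomial_of_not_le _ h, coeff_smul]

@[simp] theorem P0_zero : P0 v (0 : MvPolynomial σ k) = 0 := by
  refine MvPolynomial.ext _ _ fun n => ?_
  by_cases h : Finsupp.single v 1 ≤ n
  · simp [coeff_modMonomial_of_le _ h]
  · simp [coeff_modMonomial_of_not_le _ h]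

@[simp] theorem P1_zero : P1 v (0 : MvPolynomial σ k) = 0 := zero_divMonomial _

@[simp] theorem P0_X_self : P0 v (X v : MvPolynomial σ k) = 0 := modMonomial_X v
@[simp] theorem P1_X_self : P1 v (X v : MvPolynomial σ k) = 1 := X_divMonomial v

theorem P0_of_support (p : MvPolynomial σ k) (hp : ∀ n ∈ p.support, n v = 0) : P0 v p = p := by
  refine MvPolynomial.ext _ _ fun n => ?_
  by_cases h : Finsupp.single v 1 ≤ n
  · rw [coeff_modMonomial_of_le _ h]
    symm
    by_contra hne
    have := hp n (MvPolynomial.mem_support_iff.2 hne)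
    have h1 : 1 ≤ n v := by simpa [Finsupp.single_le_iff] using h
    omega
  · rw [coeff_modMonomial_of_not_le _ h]

theorem P1_of_support (p : MvPolynomial σ k) (hp : ∀ n ∈ p.support, n v = 0) : P1 v p = 0 := by
  refine MvPolynomial.ext _ _ fun n => ?_
  rw [coeff_divMonomial, coeff_zero]
  by_contra hne
  have := hp _ (MvPolynomial.mem_support_iff.2 hne)
  simp at this

@[simp] theorem P0_C (c : k) : P0 v (C c : MvPolynomial σ k) = C c :=
  P0_of_support v _ (fun n hn => by
    classical
    rw [support_C] at hn
    split_ifs at hn with h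
    · simp at hn
    · rw [Finset.mem_singleton] at hn; simp [hn])

@[simp] theorem P1_C (c : k) : P1 v (C c : MvPolynomial σ k) = 0 :=
  P1_of_support v _ (fun n hn => by
    classical
    rw [support_C] at hn
    split_ifs at hn with h
    · simp at hn
    · rw [Finset.mem_singleton] at hn; simp [hn])

theorem P0_X_ne {u : σ} (hu : u ≠ v) : P0 v (X u : MvPolynomial σ k) = X u := by
  nontriviality k
  apply P0_of_support
  intro n hn
  rw [support_X, Finset.mem_singleton] at hn
  simp [hn, hu]

theorem P1_X_ne {u : σ} (hu : u ≠ v) : P1 v (X u : MvPolynomial σ k) = 0 := by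
  nontriviality k
  apply P1_of_support
  intro n hn
  rw [support_X, Finset.mem_singleton] at hn
  simp [hn, hu]


/-! ### Generic bookkeeping (no decidability needed) -/

section Generic

/-- Sequential evaluation of a block of gates after the prefix values `w`. -/
def evalBlock : List (MvPolynomial σ k) → List (Gate k σ) → List (MvPolynomial σ k)
  | _, [] => []
  | w, g :: B => g.eval w :: evalBlock (w ++ [g.eval w]) B

theorem gateValues_append_block (G B : List (Gate k σ)) :
    gateValues (G ++ B) = gateValues G ++ evalBlock (gateValues G) B := by
  induction B generalizing G with
  | nil => simp [evalBlock]
  | cons g B ih =>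
    have : G ++ g :: B = (G ++ [g]) ++ B := by simp
    rw [this, ih, gateValues_append_singleton]
    simp [evalBlock]

variable {v}

/-- Agreement at positions `8j + 6` survives appending up to six further values. -/
theorem agree0_append {vals w : List (MvPolynomial σ k)}
    (hA : ∀ j, w.getD (8 * j + 6) 0 = P0 v (vals.getD j 0)) (hw : w.length = 8 * vals.length)
    (L : List (MvPolynomial σ k)) (hL : L.length ≤ 6) :
    ∀ j, (w ++ L).getD (8 * j + 6) 0 = P0 v (vals.getD j 0) := by
  intro j
  by_cases hj : 8 * j + 6 < w.length
  · rw [List.getD_eq_getElem?_getD, List.getElem?_append_left hj, ← List.getD_eq_getElem?_getD]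
    exact hA j
  · have hj' : vals.length ≤ j := by omega
    rw [List.getD_eq_getElem?_getD, List.getD_eq_getElem?_getD,
      List.getElem?_eq_none_iff.2 (by simp; omega), List.getElem?_eq_none_iff.2 hj']
    simp

/-- Agreement at positions `8j + 7` survives appending up to seven further values. -/
theorem agree1_append {vals w : List (MvPolynomial σ k)}
    (hA : ∀ j, w.getD (8 * j + 7) 0 = P1 v (vals.getD j 0)) (hw : w.length = 8 * vals.length)
    (L : List (MvPolynomial σ k)) (hL : L.length ≤ 7) :
    ∀ j, (w ++ L).getD (8 * j + 7) 0 = P1 v (vals.getD j 0) := by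
  intro j
  by_cases hj : 8 * j + 7 < w.length
  · rw [List.getD_eq_getElem?_getD, List.getElem?_append_left hj, ← List.getD_eq_getElem?_getD]
    exact hA j
  · have hj' : vals.length ≤ j := by omega
    rw [List.getD_eq_getElem?_getD, List.getD_eq_getElem?_getD,
      List.getElem?_eq_none_iff.2 (by simp; omega), List.getElem?_eq_none_iff.2 hj']
    simp

/-- Reading a value appended inside the current block. -/
theorem getD_append_at (w L : List (MvPolynomial σ k)) (j : ℕ) :
    (w ++ L).getD (w.length + j) 0 = L.getD j 0 := by
  rw [List.getD_eq_getElem?_getD, List.getElem?_append_right (Nat.le_add_right _ _),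
    Nat.add_sub_cancel_left, ← List.getD_eq_getElem?_getD]

@[simp] theorem P0_one : P0 v (1 : MvPolynomial σ k) = 1 := by
  rw [← C_1]; exact P0_C v 1

@[simp] theorem P1_one : P1 v (1 : MvPolynomial σ k) = 0 := by
  rw [← C_1]; exact P1_C v 1

theorem evalBlock_cons (w : List (MvPolynomial σ k)) (g : Gate k σ) (B : List (Gate k σ)) :
    evalBlock w (g :: B) = g.eval w :: evalBlock (w ++ [g.eval w]) B := rfl

theorem eval_sum_nil' (w : List (MvPolynomial σ k)) : (Gate.sum ([] : List (k × Operand k σ))).eval w = 0 := by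
  simp [Gate.eval]

/-- Six dummy gates first. -/
theorem evalBlock_six (w : List (MvPolynomial σ k)) (B : List (Gate k σ)) :
    evalBlock w (.sum [] :: .sum [] :: .sum [] :: .sum [] :: .sum [] :: .sum [] :: B) =
      [0, 0, 0, 0, 0, 0] ++ evalBlock (w ++ [0, 0, 0, 0, 0, 0]) B := by
  simp only [evalBlock_cons, eval_sum_nil', List.append_assoc, List.cons_append, List.nil_append]

end Generic

/-! ### The circuit transformation -/

section Circuit

variable [DecidableEq σ]

/-- Operand for the `x_v`-free part (old gate `j` ↦ new position `8j + 6`). -/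
def o0 : Operand k σ → Operand k σ
  | .var u => if u = v then .const 0 else .var u
  | .const c => .const c
  | .gate j => .gate (8 * j + 6)

/-- Operand for the quotient part (old gate `j` ↦ new position `8j + 7`). -/
def o1 : Operand k σ → Operand k σ
  | .var u => if u = v then .const 1 else .const 0
  | .const _ => .const 0
  | .gate j => .gate (8 * j + 7)

/-- The eight gates replacing old gate `i` (base position `8 i`); positions `8i+6`, `8i+7` carry the
`x_v`-free part and the quotient part of the old value. -/
def block (i : ℕ) : Gate k σ → List (Gate k σ)
  | .prod [x, y] =>
      [.prod [o0 v x, o0 v y], .prod [o1 v x, o0 v y], .prod [o0 v x, o1 v y], .prod [o1 v x, o1 v y],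
       .prod [.var v, .gate (8 * i + 3)], .sum [(1, .gate (8 * i + 1)), (1, .gate (8 * i + 2))],
       .sum [(1, .gate (8 * i))], .sum [(1, .gate (8 * i + 5)), (1, .gate (8 * i + 4))]]
  | .prod [x] =>
      [.sum [], .sum [], .sum [], .sum [], .sum [], .sum [], .sum [(1, o0 v x)], .sum [(1, o1 v x)]]
  | .prod [] =>
      [.sum [], .sum [], .sum [], .sum [], .sum [], .sum [], .sum [(1, .const 1)], .sum []]
  | .prod (_ :: _ :: _ :: _) =>
      [.sum [], .sum [], .sum [], .sum [], .sum [], .sum [], .sum [], .sum []]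
  | .sum [] =>
      [.sum [], .sum [], .sum [], .sum [], .sum [], .sum [], .sum [], .sum []]
  | .sum [(c, x)] =>
      [.sum [], .sum [], .sum [], .sum [], .sum [], .sum [], .sum [(c, o0 v x)], .sum [(c, o1 v x)]]
  | .sum [(c, x), (d, y)] =>
      [.sum [], .sum [], .sum [], .sum [], .sum [], .sum [],
       .sum [(c, o0 v x), (d, o0 v y)], .sum [(c, o1 v x), (d, o1 v y)]]
  | .sum (_ :: _ :: _ :: _) =>
      [.sum [], .sum [], .sum [], .sum [], .sum [], .sum [], .sum [], .sum []]

/-- The new gate list. -/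
def gatesAux : ℕ → List (Gate k σ) → List (Gate k σ)
  | _, [] => []
  | i, g :: gs => block v i g ++ gatesAux (i + 1) gs

theorem length_block (i : ℕ) (g : Gate k σ) : (block v i g).length = 8 := by
  cases g with
  | prod args => rcases args with _ | ⟨x, _ | ⟨y, _ | ⟨z, rest⟩⟩⟩ <;> rfl
  | sum args => rcases args with _ | ⟨⟨c, x⟩, _ | ⟨⟨d, y⟩, _ | ⟨e, rest⟩⟩⟩ <;> rfl

theorem gatesAux_append (i : ℕ) (gs : List (Gate k σ)) (g : Gate k σ) :
    gatesAux v i (gs ++ [g]) = gatesAux v i gs ++ block v (i + gs.length) g := by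
  induction gs generalizing i with
  | nil => simp [gatesAux]
  | cons g' gs ih =>
    simp only [List.cons_append, gatesAux, ih (i + 1), List.append_assoc, List.length_cons]
    rw [show i + (gs.length + 1) = i + 1 + gs.length by omega]

theorem length_gatesAux (i : ℕ) (gs : List (Gate k σ)) : (gatesAux v i gs).length = 8 * gs.length := by
  induction gs generalizing i with
  | nil => rfl
  | cons g gs ih => simp [gatesAux, ih, length_block]; ring

theorem mem_gatesAux {i : ℕ} {gs : List (Gate k σ)} {g' : Gate k σ} (h : g' ∈ gatesAux v i gs) :
    ∃ j g, g ∈ gs ∧ g' ∈ block v j g := by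
  induction gs generalizing i with
  | nil => simp [gatesAux] at h
  | cons g gs ih =>
    simp only [gatesAux, List.mem_append] at h
    rcases h with h | h
    · exact ⟨i, g, List.mem_cons_self, h⟩
    · obtain ⟨j, g₀, hg₀, hj⟩ := ih h
      exact ⟨j, g₀, List.mem_cons_of_mem _ hg₀, hj⟩

/-- All new gates have fan-in at most two (whatever the old gate). -/
theorem fanIn_of_mem_block {i : ℕ} {g g' : Gate k σ} (h : g' ∈ block v i g) : g'.fanIn ≤ 2 := by
  cases g with
  | prod args =>
    rcases args with _ | ⟨x, _ | ⟨y, _ | ⟨z, rest⟩⟩⟩ <;> simp [block] at h <;>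
      rcases h with rfl | rfl | rfl | rfl | rfl | rfl | rfl | rfl <;> simp [Gate.fanIn, Gate.args]
  | sum args =>
    rcases args with _ | ⟨⟨c, x⟩, _ | ⟨⟨d, y⟩, _ | ⟨e, rest⟩⟩⟩ <;> simp [block] at h <;>
      rcases h with rfl | rfl | rfl | rfl | rfl | rfl | rfl | rfl <;> simp [Gate.fanIn, Gate.args]

/-! ### Semantics -/

variable {v}

/-- Reading the `x_v`-free parts through `o0`. -/
theorem eval_o0 {vals w : List (MvPolynomial σ k)} (hA : ∀ j, w.getD (8 * j + 6) 0 = P0 v (vals.getD j 0))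
    (u : Operand k σ) : (o0 v u).eval w = P0 v (u.eval vals) := by
  cases u with
  | var i =>
    by_cases h : i = v
    · subst h; simp [o0, Operand.eval]
    · simp [o0, Operand.eval, h, P0_X_ne v h]
  | const c => simp [o0, Operand.eval]
  | gate j => simp only [o0, Operand.eval]; exact hA j

/-- Reading the quotient parts through `o1`. -/
theorem eval_o1 {vals w : List (MvPolynomial σ k)} (hA : ∀ j, w.getD (8 * j + 7) 0 = P1 v (vals.getD j 0))
    (u : Operand k σ) : (o1 v u).eval w = P1 v (u.eval vals) := by
  cases u with
  | var i =>
    by_cases h : i = v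
    · subst h; simp [o1, Operand.eval]
    · simp [o1, Operand.eval, h, P1_X_ne v h]
  | const c => simp [o1, Operand.eval]
  | gate j => simp only [o1, Operand.eval]; exact hA j

/-- **The block computes the two parts of the old value** (positions 6 and 7). -/
theorem evalBlock_block {vals w : List (MvPolynomial σ k)} [IsLeftCancelAdd k]
    (hA0 : ∀ j, w.getD (8 * j + 6) 0 = P0 v (vals.getD j 0))
    (hA1 : ∀ j, w.getD (8 * j + 7) 0 = P1 v (vals.getD j 0))
    (hw : w.length = 8 * vals.length) (g : Gate k σ) (hg : g.fanIn ≤ 2) :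
    ∃ l : List (MvPolynomial σ k), l.length = 6 ∧
      evalBlock w (block v vals.length g) = l ++ [P0 v (g.eval vals), P1 v (g.eval vals)] := by
  have A0 : ∀ L : List (MvPolynomial σ k), L.length ≤ 6 → ∀ u : Operand k σ,
      (o0 v u).eval (w ++ L) = P0 v (u.eval vals) :=
    fun L hL u => eval_o0 (agree0_append hA0 hw L hL) u
  have A1 : ∀ L : List (MvPolynomial σ k), L.length ≤ 7 → ∀ u : Operand k σ,
      (o1 v u).eval (w ++ L) = P1 v (u.eval vals) :=
    fun L hL u => eval_o1 (agree1_append hA1 hw L hL) u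
  have A0' : ∀ u : Operand k σ, (o0 v u).eval w = P0 v (u.eval vals) := fun u => eval_o0 hA0 u
  have R : ∀ (L : List (MvPolynomial σ k)) (j : ℕ), j < L.length →
      (Operand.gate (8 * vals.length + j) : Operand k σ).eval (w ++ L) = L.getD j 0 := by
    intro L j hj
    rw [ArithCircuit.Operand.eval_gate, ← hw, getD_append_at w L j]
  have R0 : ∀ (L : List (MvPolynomial σ k)), 0 < L.length →
      (Operand.gate (8 * vals.length) : Operand k σ).eval (w ++ L) = L.getD 0 0 := by
    intro L hL
    simpa using R L 0 hL
  -- the six-dummies shape: the two real gates read operands in contexts of length `+6` / `+7`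
  have SIX : ∀ (g6 g7 : Gate k σ) (S : MvPolynomial σ k),
      g6.eval (w ++ [0, 0, 0, 0, 0, 0]) = P0 v S →
      g7.eval (w ++ [0, 0, 0, 0, 0, 0, P0 v S]) = P1 v S →
      ∃ l : List (MvPolynomial σ k), l.length = 6 ∧
        evalBlock w [.sum [], .sum [], .sum [], .sum [], .sum [], .sum [], g6, g7] = l ++ [P0 v S, P1 v S] := by
    intro g6 g7 S h6 h7
    refine ⟨[0, 0, 0, 0, 0, 0], rfl, ?_⟩
    rw [evalBlock_six, evalBlock_cons, h6, evalBlock_cons]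
    simp only [List.append_assoc, List.cons_append, List.nil_append]
    rw [h7]
    rfl
  cases g with
  | prod args =>
    rcases args with _ | ⟨x, _ | ⟨y, _ | ⟨z, rest⟩⟩⟩
    · -- empty product `= 1`
      have hval : (Gate.prod ([] : List (Operand k σ))).eval vals = 1 := by simp [Gate.eval]
      rw [hval]
      exact SIX _ _ 1 (by simp [Gate.eval, Operand.eval]) (by simp [Gate.eval])
    · -- unary product `= x`
      have hval : (Gate.prod [x]).eval vals = x.eval vals := by simp [Gate.eval]
      rw [hval]
      refine SIX _ _ (x.eval vals) ?_ ?_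
      · rw [Gate.eval]
        simp only [List.map_cons, List.map_nil, List.sum_cons, List.sum_nil, add_zero, one_smul]
        exact A0 _ (by simp) x
      · rw [Gate.eval]
        simp only [List.map_cons, List.map_nil, List.sum_cons, List.sum_nil, add_zero, one_smul]
        exact A1 _ (by simp) x
    · -- binary product
      obtain ⟨X, hX⟩ : ∃ X, x.eval vals = X := ⟨_, rfl⟩
      obtain ⟨Y, hY⟩ : ∃ Y, y.eval vals = Y := ⟨_, rfl⟩
      have hval : (Gate.prod [x, y]).eval vals = X * Y := by simp [Gate.eval, hX, hY]
      rw [hval]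
      refine ⟨[P0 v X * P0 v Y, P1 v X * P0 v Y, P0 v X * P1 v Y, P1 v X * P1 v Y,
        MvPolynomial.X v * (P1 v X * P1 v Y), P1 v X * P0 v Y + P0 v X * P1 v Y], rfl, ?_⟩
      have PR : ∀ (a b : Operand k σ) (W : List (MvPolynomial σ k)),
          (Gate.prod [a, b]).eval W = a.eval W * b.eval W := by
        intro a b W; simp [Gate.eval]
      have SU1 : ∀ (a : Operand k σ) (W : List (MvPolynomial σ k)),
          (Gate.sum [((1 : k), a)]).eval W = a.eval W := by
        intro a W; simp [Gate.eval]
      have SU2 : ∀ (a b : Operand k σ) (W : List (MvPolynomial σ k)),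
          (Gate.sum [((1 : k), a), (1, b)]).eval W = a.eval W + b.eval W := by
        intro a b W; simp [Gate.eval]
      rw [show block v vals.length (Gate.prod [x, y]) =
        [.prod [o0 v x, o0 v y], .prod [o1 v x, o0 v y], .prod [o0 v x, o1 v y], .prod [o1 v x, o1 v y],
         .prod [.var v, .gate (8 * vals.length + 3)],
         .sum [(1, .gate (8 * vals.length + 1)), (1, .gate (8 * vals.length + 2))],
         .sum [(1, .gate (8 * vals.length))],
         .sum [(1, .gate (8 * vals.length + 5)), (1, .gate (8 * vals.length + 4))]] from rfl]
      -- gate 0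
      rw [evalBlock_cons, PR, A0' x, A0' y, hX, hY]
      -- gate 1
      rw [evalBlock_cons, PR, A1 _ (by simp) x, A0 _ (by simp) y, hX, hY]
      simp only [List.append_assoc, List.cons_append, List.nil_append]
      -- gate 2
      rw [evalBlock_cons, PR, A0 _ (by simp) x, A1 _ (by simp) y, hX, hY]
      simp only [List.append_assoc, List.cons_append, List.nil_append]
      -- gate 3
      rw [evalBlock_cons, PR, A1 _ (by simp) x, A1 _ (by simp) y, hX, hY]
      simp only [List.append_assoc, List.cons_append, List.nil_append]
      -- gate 4
      rw [evalBlock_cons, PR, R _ 3 (by simp)]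
      simp only [Operand.eval, List.getD_cons_succ, List.getD_cons_zero, List.append_assoc,
        List.cons_append, List.nil_append]
      -- gate 5
      rw [evalBlock_cons, SU2, R _ 1 (by simp), R _ 2 (by simp)]
      simp only [List.getD_cons_succ, List.getD_cons_zero, List.append_assoc, List.cons_append,
        List.nil_append]
      -- gate 6
      rw [evalBlock_cons, SU1, R0 _ (by simp)]
      simp only [List.getD_cons_zero, List.append_assoc, List.cons_append, List.nil_append]
      -- gate 7
      rw [evalBlock_cons, SU2, R _ 5 (by simp), R _ 4 (by simp)]
      simp only [List.getD_cons_succ, List.getD_cons_zero, evalBlock]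
      rw [P0_mul, P1_mul]
    · -- fan-in ≥ 3: excluded
      exfalso; simp [Gate.fanIn, Gate.args] at hg
  | sum args =>
    rcases args with _ | ⟨⟨c, x⟩, _ | ⟨⟨d, y⟩, _ | ⟨e, rest⟩⟩⟩
    · have hval : (Gate.sum ([] : List (k × Operand k σ))).eval vals = 0 := by simp [Gate.eval]
      rw [hval]
      exact SIX _ _ 0 (by simp [Gate.eval]) (by simp [Gate.eval])
    · have hval : (Gate.sum [(c, x)]).eval vals = c • x.eval vals := by simp [Gate.eval]
      rw [hval]
      refine SIX _ _ (c • x.eval vals) ?_ ?_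
      · rw [Gate.eval]
        simp only [List.map_cons, List.map_nil, List.sum_cons, List.sum_nil, add_zero]
        rw [A0 _ (by simp) x, P0_smul]
      · rw [Gate.eval]
        simp only [List.map_cons, List.map_nil, List.sum_cons, List.sum_nil, add_zero]
        rw [A1 _ (by simp) x, P1_smul]
    · have hval : (Gate.sum [(c, x), (d, y)]).eval vals = c • x.eval vals + d • y.eval vals := by
        simp [Gate.eval]
      rw [hval]
      refine SIX _ _ (c • x.eval vals + d • y.eval vals) ?_ ?_
      · rw [Gate.eval]
        simp only [List.map_cons, List.map_nil, List.sum_cons, List.sum_nil, add_zero]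
        rw [A0 _ (by simp) x, A0 _ (by simp) y, P0_add, P0_smul, P0_smul]
      · rw [Gate.eval]
        simp only [List.map_cons, List.map_nil, List.sum_cons, List.sum_nil, add_zero]
        rw [A1 _ (by simp) x, A1 _ (by simp) y, P1_add, P1_smul, P1_smul]
    · exfalso; simp [Gate.fanIn, Gate.args] at hg

/-- **The new circuit carries the parts of the old gate values at positions `8j+6`, `8j+7`.** -/
theorem agree_gateValues [IsLeftCancelAdd k] (gs : List (Gate k σ)) (h2 : ∀ g ∈ gs, g.fanIn ≤ 2) :
    (∀ j, (gateValues (gatesAux v 0 gs)).getD (8 * j + 6) 0 = P0 v ((gateValues gs).getD j 0)) ∧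
    (∀ j, (gateValues (gatesAux v 0 gs)).getD (8 * j + 7) 0 = P1 v ((gateValues gs).getD j 0)) := by
  induction gs using List.reverseRecOn with
  | nil => constructor <;> intro j <;> simp [gatesAux, gateValues]
  | append_singleton gs g ih =>
    have h2' : ∀ g' ∈ gs, g'.fanIn ≤ 2 := fun g' hg' => h2 g' (List.mem_append_left _ hg')
    have hg : g.fanIn ≤ 2 := h2 g (by simp)
    obtain ⟨hA0, hA1⟩ := ih h2'
    set vals := gateValues gs with hvals
    set w := gateValues (gatesAux v 0 gs) with hw
    have hwlen : w.length = 8 * vals.length := by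
      rw [hw, hvals, gateValues_length, gateValues_length, length_gatesAux]
    have hvl : vals.length = gs.length := by rw [hvals, gateValues_length]
    obtain ⟨l, hl, hblock⟩ := evalBlock_block hA0 hA1 hwlen g hg
    rw [gatesAux_append, Nat.zero_add, gateValues_append_block, ← hw, ← hvl, hblock,
      gateValues_append_singleton, ← hvals]
    have key : ∀ (j : ℕ) (t : ℕ) (ht : t = 6 ∨ t = 7) (Q : MvPolynomial σ k → MvPolynomial σ k)
        (hQ0 : Q 0 = 0)
        (hAQ : ∀ j, w.getD (8 * j + t) 0 = Q (vals.getD j 0))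
        (hread : (w ++ (l ++ [P0 v (g.eval vals), P1 v (g.eval vals)])).getD (8 * vals.length + t) 0 =
          Q (g.eval vals)),
        (w ++ (l ++ [P0 v (g.eval vals), P1 v (g.eval vals)])).getD (8 * j + t) 0 =
          Q ((vals ++ [g.eval vals]).getD j 0) := by
      intro j t ht Q hQ0 hAQ hread
      rcases Nat.lt_trichotomy j vals.length with hj | rfl | hj
      · rw [List.getD_eq_getElem?_getD, List.getElem?_append_left (by omega),
          List.getD_eq_getElem?_getD, List.getElem?_append_left hj, ← List.getD_eq_getElem?_getD,
          ← List.getD_eq_getElem?_getD]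
        exact hAQ j
      · rw [hread, List.getD_eq_getElem?_getD, List.getElem?_append_right le_rfl]
        simp
      · rw [List.getD_eq_getElem?_getD, List.getD_eq_getElem?_getD,
          List.getElem?_eq_none_iff.2 (by simp [hl]; omega),
          List.getElem?_eq_none_iff.2 (by simp; omega)]
        simpa using hQ0.symm
    have hl7 : (l ++ [P0 v (g.eval vals), P1 v (g.eval vals)]).length = 8 := by simp [hl]
    constructor
    · intro j
      refine key j 6 (Or.inl rfl) (P0 v) (P0_zero v) hA0 ?_
      rw [← hwlen, getD_append_at _ _ 6]
      rw [List.getD_eq_getElem?_getD, List.getElem?_append_right (by simp [hl])]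
      simp [hl]
    · intro j
      refine key j 7 (Or.inr rfl) (P1 v) (P1_zero v) hA1 ?_
      rw [← hwlen, getD_append_at _ _ 7]
      rw [List.getD_eq_getElem?_getD, List.getElem?_append_right (by simp [hl])]
      simp [hl]

/-- **Dividing by a variable costs a factor `8`:** `L(p /ᵐ x_v) ≤ 8 · L(p)` (and the same for the
`x_v`-free part), over any additively cancellative commutative semiring. -/
theorem complexity_P1_le [IsLeftCancelAdd k] (p : MvPolynomial σ k) :
    complexity (P1 v p) ≤ 8 * complexity p := by
  obtain ⟨P, h2, hf, hs⟩ := ArithCircuit.exists_computes_size_eq_complexity p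
  let Q : ArithCircuit k σ := ⟨gatesAux v 0 P.gates, o1 v P.output⟩
  have hQ2 : Q.IsFanInTwo := by
    intro g' hg'
    obtain ⟨j, g, -, hj⟩ := mem_gatesAux v hg'
    exact fanIn_of_mem_block v hj
  have hQf : Q.Computes (P1 v p) := by
    unfold ArithCircuit.Computes at hf ⊢
    change (o1 v P.output).eval (gateValues (gatesAux v 0 P.gates)) = P1 v p
    rw [eval_o1 (agree_gateValues P.gates h2).2, ← hf]
    rfl
  calc complexity (P1 v p) ≤ Q.size := ArithCircuit.complexity_le_size hQ2 hQf
    _ = 8 * P.size := length_gatesAux v 0 P.gates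
    _ = 8 * complexity p := by rw [hs]

theorem complexity_P0_le [IsLeftCancelAdd k] (p : MvPolynomial σ k) :
    complexity (P0 v p) ≤ 8 * complexity p := by
  obtain ⟨P, h2, hf, hs⟩ := ArithCircuit.exists_computes_size_eq_complexity p
  let Q : ArithCircuit k σ := ⟨gatesAux v 0 P.gates, o0 v P.output⟩
  have hQ2 : Q.IsFanInTwo := by
    intro g' hg'
    obtain ⟨j, g, -, hj⟩ := mem_gatesAux v hg'
    exact fanIn_of_mem_block v hj
  have hQf : Q.Computes (P0 v p) := by
    unfold ArithCircuit.Computes at hf ⊢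
    change (o0 v P.output).eval (gateValues (gatesAux v 0 P.gates)) = P0 v p
    rw [eval_o0 (agree_gateValues P.gates h2).1, ← hf]
    rfl
  calc complexity (P0 v p) ≤ Q.size := ArithCircuit.complexity_le_size hQ2 hQf
    _ = 8 * P.size := length_gatesAux v 0 P.gates
    _ = 8 * complexity p := by rw [hs]

/-- **`L(f) ≤ 8 · L(x_v · f)`.** -/
theorem complexity_le_of_X_mul [IsLeftCancelAdd k] (f : MvPolynomial σ k) :
    complexity f ≤ 8 * complexity (X v * f) := by
  have h := complexity_P1_le (v := v) (X v * f)
  rwa [show P1 v (X v * f) = f from X_mul_divMonomial v f] at h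

end Circuit


end Summit.ValiantsHypothesis.ValiantsHypothesis.Cruxes.PerMultiplesHard.Disproof.DivX

/-! ## (j) A NEW RUNG OF THE CRUX: multipliers of total degree `≤ 1` (sorry-free)

Combining (h) top forms, (i) division by a variable and Jerrum–Snir (through the sibling seat's
`PlainBridge`): for EVERY `c`, no counterexample `h` to `PerMultiplesHard` has total degree `≤ 1`
(`perMultiplesHard_rung_totalDegree_le_one`); in closed form `n (2^{n-1} - 1) ≤ 16 · L⁺(per_n · h) + 2`
(`js_bound_totalDegree_le_one`).  Mechanism: `multiTop h` is a nonzero multihomogeneous polynomial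
supported inside `supp h`, hence (degree `≤ 1`) a single monomial `a` or `a x_rc`; strip it. -/

namespace Summit.ValiantsHypothesis.ValiantsHypothesis.Cruxes.PerMultiplesHard.Disproof.Rung

open MvPolynomial
open Finsupp (weight degree)
open scoped NNReal
open Literature.Computability.AlgebraicComplexity
open Summit.ValiantsHypothesis.Theorems.PerDivisionHardNegative
open Summit.ValiantsHypothesis.ValiantsHypothesis.Cruxes.PerMultiplesHard.Disproof.TopForm
open Summit.ValiantsHypothesis.ValiantsHypothesis.Cruxes.PerMultiplesHard.Disproof.DivX

variable {n : ℕ}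

theorem support_topForm_subset {σ : Type*} (w : σ → ℕ) (p : MvPolynomial σ ℝ≥0) :
    (topForm w p).support ⊆ p.support := by
  classical
  intro d hd
  rw [MvPolynomial.mem_support_iff] at hd ⊢
  rw [coeff_topForm] at hd
  split_ifs at hd with h
  · exact hd
  · exact absurd rfl hd

theorem support_multiTop_subset {σ : Type*} (ws : List (σ → ℕ)) (p : MvPolynomial σ ℝ≥0) :
    (multiTop ws p).support ⊆ p.support := by
  induction ws with
  | nil => exact Finset.Subset.refl _
  | cons w ws ih => rw [multiTop_cons]; exact (support_topForm_subset w _).trans ih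

/-- Exponents of degree `≤ 1` are `0` or a unit vector. [folklore] -/
theorem eq_zero_or_single_of_degree_le_one {σ : Type*} (d : σ →₀ ℕ) (hd : degree d ≤ 1) :
    d = 0 ∨ ∃ i, d = Finsupp.single i 1 := by
  classical
  by_cases h0 : d = 0
  · exact Or.inl h0
  right
  obtain ⟨i, hi⟩ := Finsupp.support_nonempty_iff.2 h0
  have h1 : 1 ≤ d i := Nat.one_le_iff_ne_zero.2 (Finsupp.mem_support_iff.1 hi)
  have h2 : d i ≤ degree d := Finsupp.le_degree i d
  refine ⟨i, Finsupp.ext fun j => ?_⟩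
  by_cases hij : j = i
  · subst hij
    rw [Finsupp.single_eq_same]
    omega
  · rw [Finsupp.single_eq_of_ne hij]
    by_contra hne
    have hj : j ∈ d.support := Finsupp.mem_support_iff.2 hne
    have hsum : d i + d j ≤ degree d := by
      rw [Finsupp.degree_apply, ← Finset.sum_pair (Ne.symm hij)]
      exact Finset.sum_le_sum_of_subset (by
        intro x hx
        simp only [Finset.mem_insert, Finset.mem_singleton] at hx
        rcases hx with rfl | rfl
        · exact hi
        · exact hj)
    have : 1 ≤ d j := Nat.one_le_iff_ne_zero.2 hne
    omega

/-- Row weight of a unit vector. -/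
theorem weight_rowWeight_single (r i j : Fin n) :
    weight (rowWeight r) (Finsupp.single (i, j) 1) = if i = r then 1 else 0 := by
  rw [Finsupp.weight_single, one_smul]; rfl

/-- Column weight of a unit vector. -/
theorem weight_colWeight_single (c i j : Fin n) :
    weight (colWeight c) (Finsupp.single (i, j) 1) = if j = c then 1 else 0 := by
  rw [Finsupp.weight_single, one_smul]; rfl

/-- Two exponents of degree `≤ 1` with the same row and column weights coincide. [folklore] -/
theorem eq_of_weights_of_degree_le_one {d d' : Fin n × Fin n →₀ ℕ} (hd : degree d ≤ 1) (hd' : degree d' ≤ 1)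
    (hrow : ∀ r, weight (rowWeight r) d = weight (rowWeight r) d')
    (hcol : ∀ c, weight (colWeight c) d = weight (colWeight c) d') : d = d' := by
  rcases eq_zero_or_single_of_degree_le_one d hd with rfl | ⟨⟨i, j⟩, rfl⟩ <;>
    rcases eq_zero_or_single_of_degree_le_one d' hd' with rfl | ⟨⟨i', j'⟩, rfl⟩
  · rfl
  · have h := hrow i'
    rw [map_zero, weight_rowWeight_single] at h
    simp at h
  · have h := hrow i
    rw [map_zero, weight_rowWeight_single] at h
    simp at h
  · have hr := hrow i
    have hc := hcol j
    rw [weight_rowWeight_single, weight_rowWeight_single, if_pos rfl] at hr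
    rw [weight_colWeight_single, weight_colWeight_single, if_pos rfl] at hc
    by_cases h1 : i' = i
    · by_cases h2 : j' = j
      · rw [h1, h2]
      · rw [if_neg h2] at hc; exact absurd hc one_ne_zero
    · rw [if_neg h1] at hr; exact absurd hr one_ne_zero

/-- A nonzero multihomogeneous polynomial all of whose exponents have degree `≤ 1` is a monomial.
[folklore] -/
theorem exists_eq_monomial {h : MvPolynomial (Fin n × Fin n) ℝ≥0} (hh : h ≠ 0) (hmh : IsMultihomogeneous h)
    (hdeg : ∀ d ∈ h.support, degree d ≤ 1) :
    ∃ (d : Fin n × Fin n →₀ ℕ) (a : ℝ≥0), a ≠ 0 ∧ degree d ≤ 1 ∧ h = monomial d a := by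
  classical
  obtain ⟨d₁, hd₁⟩ := MvPolynomial.support_nonempty.2 hh
  refine ⟨d₁, coeff d₁ h, MvPolynomial.mem_support_iff.1 hd₁, hdeg _ hd₁, ?_⟩
  refine MvPolynomial.ext _ _ fun d => ?_
  rw [coeff_monomial]
  split_ifs with hdd
  · rw [hdd]
  · by_contra hne
    apply hdd
    have hd : d ∈ h.support := MvPolynomial.mem_support_iff.2 hne
    refine eq_of_weights_of_degree_le_one (hdeg _ hd₁) (hdeg _ hd) (fun r => ?_) (fun c => ?_)
    · obtain ⟨m, hm⟩ := hmh.1 r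
      rw [hm (MvPolynomial.mem_support_iff.1 hd₁), hm (MvPolynomial.mem_support_iff.1 hd)]
    · obtain ⟨m, hm⟩ := hmh.2 c
      rw [hm (MvPolynomial.mem_support_iff.1 hd₁), hm (MvPolynomial.mem_support_iff.1 hd)]

/-- `degree d = d.sum (fun _ e => e)` (the total degree of an exponent). -/
theorem degree_eq_sum' {σ : Type*} (d : σ →₀ ℕ) : degree d = d.sum fun _ e => e := rfl

/-- **Closed form of the new rung.** For `n ≥ 1` and every nonzero `h` of total degree `≤ 1`:
`n (2^{n-1} - 1) ≤ 16 · L⁺(per_n · h) + 2`. [folklore] -/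
theorem js_bound_totalDegree_le_one (hn : 1 ≤ n) {h : MvPolynomial (Fin n × Fin n) ℝ≥0} (hh : h ≠ 0)
    (hdeg : h.totalDegree ≤ 1) :
    n * (2 ^ (n - 1) - 1) ≤ 16 * complexity (perPoly (Fin n) ℝ≥0 * h) + 2 := by
  classical
  -- WLOG multihomogeneous: `h' = multiTop h`, a monomial of degree ≤ 1
  set h' := multiTop (rowColWeights n) h with hh'def
  have hh' : h' ≠ 0 := multiTop_ne_zero _ hh
  have hmh : IsMultihomogeneous h' := isMultihomogeneous_multiTop h
  have hle : complexity (perPoly (Fin n) ℝ≥0 * h') ≤ complexity (perPoly (Fin n) ℝ≥0 * h) :=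
    complexity_mul_multiTop_le _ _ _ perPoly_homogeneous_rowCol
  have hdeg' : ∀ d ∈ h'.support, degree d ≤ 1 := by
    intro d hd
    have h1 := le_totalDegree (support_multiTop_subset _ _ hd)
    rw [← degree_eq_sum'] at h1
    exact h1.trans hdeg
  obtain ⟨d, a, ha, hd1, heq⟩ := exists_eq_monomial hh' hmh hdeg'
  rw [heq] at hle
  have hjs := js_le_two_mul_complexity_perPoly (n := n) hn
  rcases eq_zero_or_single_of_degree_le_one d hd1 with rfl | ⟨v, rfl⟩
  · -- constant multiplier `C a`
    have hpair := pair_const_lower_bound (n := n) hn ha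
    have hC : complexity (C a : MvPolynomial (Fin n × Fin n) ℝ≥0) = 0 := complexity_C_holds a
    rw [hC, add_zero] at hpair
    have hmon : (monomial (0 : Fin n × Fin n →₀ ℕ) a : MvPolynomial (Fin n × Fin n) ℝ≥0) = C a := rfl
    rw [hmon] at hle
    omega
  · -- single-variable multiplier `a x_v`
    have hmon : perPoly (Fin n) ℝ≥0 * monomial (Finsupp.single v 1) a = X v * (a • perPoly (Fin n) ℝ≥0) := by
      rw [smul_eq_C_mul, show (monomial (Finsupp.single v 1) a : MvPolynomial (Fin n × Fin n) ℝ≥0) =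
        C a * X v by rw [X, C_mul_monomial, mul_one]]
      ring
    rw [hmon] at hle
    have hdiv := complexity_le_of_X_mul (v := v) (a • perPoly (Fin n) ℝ≥0)
    have hback : complexity (perPoly (Fin n) ℝ≥0) ≤ complexity (a • perPoly (Fin n) ℝ≥0) + 1 := by
      have h := complexity_smul_le_holds a⁻¹ (a • perPoly (Fin n) ℝ≥0)
      rwa [inv_smul_smul₀ ha] at h
    omega

/-- Polylog versus linear: `8 (L + c)^c < 2^L` for all large `L`. [folklore] -/
theorem polylog_eventually (c : ℕ) : ∃ L₀ : ℕ, ∀ L ≥ L₀, 8 * (L + c) ^ c < 2 ^ L := by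
  have ht := tendsto_pow_const_div_const_pow_of_one_lt c (one_lt_two : (1 : ℝ) < 2)
  have hε : (0 : ℝ) < 1 / (8 * 2 ^ c) := by positivity
  obtain ⟨N, hN⟩ := Filter.eventually_atTop.1 (ht.eventually (Iio_mem_nhds hε))
  refine ⟨N, fun L hL => ?_⟩
  have hM := hN (L + c) (by omega)
  rw [div_lt_iff₀ (by positivity)] at hM
  have h8 : ((8 * (L + c) ^ c : ℕ) : ℝ) < ((2 ^ L : ℕ) : ℝ) := by
    have h2c : (0 : ℝ) < 2 ^ c := by positivity
    have key : (1 / (8 * 2 ^ c) * 2 ^ (L + c) : ℝ) = 2 ^ L / 8 := by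
      rw [pow_add]; field_simp
    rw [key] at hM
    push_cast at hM ⊢
    linarith
  exact_mod_cast h8

/-- **NEW RUNG of `PerMultiplesHard`: no counterexample has total degree `≤ 1`** — for every `c`,
for all large `n`, every nonzero `h ∈ ℝ≥0[x_ij]` of total degree `≤ 1` has
`2^{(log₂ n + c)^c} < L⁺(per_n · h)`.  (Known before: `h` constant — Jerrum–Snir; `h` a monomial —
Jukna–Seiwert–Sergeev.  New reach: ARBITRARY affine-linear `h`, via the free passage to
multihomogeneous multipliers.) [folklore] -/
theorem perMultiplesHard_rung_totalDegree_le_one (c : ℕ) :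
    ∃ n₀ : ℕ, ∀ n ≥ n₀, ∀ h : MvPolynomial (Fin n × Fin n) ℝ≥0, h ≠ 0 → h.totalDegree ≤ 1 →
      2 ^ ((Nat.log 2 n + c) ^ c) < complexity (perPoly (Fin n) ℝ≥0 * h) := by
  obtain ⟨L₀, hL₀⟩ := polylog_eventually c
  refine ⟨2 ^ L₀ + 8, fun n hn h hh hdeg => ?_⟩
  have hT : 1 ≤ 2 ^ L₀ := Nat.one_le_two_pow
  have hn1 : 1 ≤ n := le_trans hT (by omega)
  have hn8 : 8 ≤ n := le_trans (Nat.le_add_left 8 _) hn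
  have hjs := js_bound_totalDegree_le_one hn1 hh hdeg
  have hL : L₀ ≤ Nat.log 2 n := Nat.le_log_of_pow_le (by norm_num) (le_trans (Nat.le_add_right _ _) hn)
  have h8 := hL₀ (Nat.log 2 n) hL
  have hpow : 2 ^ Nat.log 2 n ≤ n := Nat.pow_log_le_self 2 (by omega)
  -- atoms for linear arithmetic
  set E := (Nat.log 2 n + c) ^ c with hEdef
  set P := 2 ^ (n - 3) with hPdef
  have hexp : E + 4 ≤ n - 3 := by omega
  have hE : 2 ^ E * 16 ≤ P := by
    rw [hPdef, show (16 : ℕ) = 2 ^ 4 by norm_num, ← pow_add]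
    exact Nat.pow_le_pow_right (by norm_num) hexp
  have hP : 2 ^ (n - 1) = 4 * P := by
    rw [hPdef, show n - 1 = (n - 3) + 2 by omega, pow_add]; ring
  have hone : 1 ≤ 2 ^ E := Nat.one_le_two_pow
  have hmul : 2 ^ (n - 1) - 1 ≤ n * (2 ^ (n - 1) - 1) := Nat.le_mul_of_pos_left _ hn1
  rw [hP] at hmul hjs
  omega

end Summit.ValiantsHypothesis.ValiantsHypothesis.Cruxes.PerMultiplesHard.Disproof.Rung


/-! ## (k) TOWARDS THE NEXT RUNG: multipliers of total degree `≤ 2` (sorry-free)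

New ingredient — the **column-swap trick**: the permanent with one cell deleted,
`R = per_n %ᵐ x_{rc'}` (sum of the permutation monomials avoiding `(r,c')`), is as hard as `per_n`:
`L⁺(per_n) ≤ 9 · L⁺(R) + 2` (`complexity_perPoly_le_of_deleted`), because
`per_n = x_{rc'} · C' + R` and the minor `C'` is the column-swapped image of `C'' = R /ᵐ x_{rc''}`.
With top forms and division this settles every multihomogeneous degree-2 multiplier
`a x_{rc} x_{r'c'} + b x_{rc'} x_{r'c}` and hence (via `multiTop`) ALL `h` of total degree `≤ 2`:
`js_bound_totalDegree_le_two`, `perMultiplesHard_rung_totalDegree_le_two`. -/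

namespace Summit.ValiantsHypothesis.ValiantsHypothesis.Cruxes.PerMultiplesHard.Disproof.Rung2

open MvPolynomial
open Finsupp (weight degree)
open scoped NNReal
open Literature.Computability.AlgebraicComplexity
open Summit.ValiantsHypothesis.Theorems.PerDivisionHardNegative
open Summit.ValiantsHypothesis.ValiantsHypothesis.Cruxes.PerMultiplesHard.Disproof.TopForm
open Summit.ValiantsHypothesis.ValiantsHypothesis.Cruxes.PerMultiplesHard.Disproof.DivX
open Summit.ValiantsHypothesis.ValiantsHypothesis.Cruxes.PerMultiplesHard.Disproof.Rung

variable {n : ℕ}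

/-! ### Division calculus at a cell -/

section Calculus

variable {σ : Type*} (v : σ)

theorem P1_X_mul_self (q : MvPolynomial σ ℝ≥0) : P1 v (X v * q) = q := X_mul_divMonomial v q

theorem P0_X_mul_self (q : MvPolynomial σ ℝ≥0) : P0 v (X v * q) = 0 := X_mul_modMonomial v q

theorem P1_X_mul_ne {u : σ} (hu : u ≠ v) (q : MvPolynomial σ ℝ≥0) : P1 v (X u * q) = X u * P1 v q := by
  rw [P1_mul, P1_X_ne v hu, P0_X_ne v hu]; ring

theorem P0_X_mul_ne {u : σ} (hu : u ≠ v) (q : MvPolynomial σ ℝ≥0) : P0 v (X u * q) = X u * P0 v q := by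
  rw [P0_mul, P0_X_ne v hu]

/-- Renaming along an injection commutes with division by a variable. -/
theorem rename_P1 {τ' : Type*} {τ : σ → τ'} (hτ : Function.Injective τ) (q : MvPolynomial σ ℝ≥0) :
    rename τ (P1 v q) = P1 (τ v) (rename τ q) := by
  classical
  apply eq_divMonomial_single (r := rename τ (P0 v q))
  · conv_lhs => rw [← decomp v q]
    rw [map_add, map_mul, rename_X]
  · intro m hm
    rw [support_rename_of_injective hτ, Finset.mem_image] at hm
    obtain ⟨m', hm', rfl⟩ := hm
    rw [Finsupp.mapDomain_apply hτ]
    exact support_P0 v q m' hm'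

end Calculus

/-! ### Column swaps -/

/-- Swap of two columns on variable indices. -/
def colSwap (c' c'' : Fin n) : Fin n × Fin n → Fin n × Fin n := fun p => (p.1, Equiv.swap c' c'' p.2)

theorem colSwap_injective (c' c'' : Fin n) : Function.Injective (colSwap c' c'') := by
  intro p q h
  simp only [colSwap, Prod.mk.injEq] at h
  exact Prod.ext h.1 ((Equiv.swap c' c'').injective h.2)

theorem mapDomain_colSwap_permMonomial (c' c'' : Fin n) (ρ : Equiv.Perm (Fin n)) :
    Finsupp.mapDomain (colSwap c' c'') (permMonomial ρ) = permMonomial (ρ * Equiv.swap c' c'') := by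
  change Finsupp.mapDomain (colSwap c' c'') (∑ i, Finsupp.single (ρ i, i) 1) =
    ∑ i, Finsupp.single ((ρ * Equiv.swap c' c'') i, i) 1
  rw [Finsupp.mapDomain_finsetSum]
  simp only [Finsupp.mapDomain_single, colSwap, Equiv.Perm.mul_apply]
  exact Fintype.sum_equiv (Equiv.swap c' c'') _ _ (fun i => by simp)

/-- The permanent is invariant under a column swap. [folklore] -/
theorem rename_colSwap_perPoly (c' c'' : Fin n) :
    rename (colSwap c' c'') (perPoly (Fin n) ℝ≥0) = perPoly (Fin n) ℝ≥0 := by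
  rw [perPoly_eq_sum_monomial, map_sum]
  simp only [rename_monomial, mapDomain_colSwap_permMonomial]
  exact Fintype.sum_equiv (Equiv.mulRight (Equiv.swap c' c'')) _ _ (fun ρ => rfl)

/-! ### Row multilinearity: two divisions in one row kill the permanent -/

theorem rowCount_single (r : Fin n) (u : Fin n × Fin n) :
    rowCount (Finsupp.single u 1) r = if u.1 = r then 1 else 0 := by
  classical
  unfold rowCount
  simp only [Finsupp.single_apply]
  obtain ⟨i, j⟩ := u
  by_cases h : i = r
  · subst h
    simp only [Prod.mk.injEq, true_and, if_true]
    rw [Finset.sum_ite_eq]; simp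
  · rw [if_neg h]
    apply Finset.sum_eq_zero
    intro c _
    rw [if_neg]
    intro hc
    exact h (Prod.mk.injEq _ _ _ _ ▸ hc).1

theorem P1_P1_same_row_perPoly (r c' c'' : Fin n) :
    P1 (r, c'') (P1 (r, c') (perPoly (Fin n) ℝ≥0)) = 0 := by
  classical
  refine MvPolynomial.ext _ _ fun m => ?_
  rw [coeff_divMonomial, coeff_divMonomial, coeff_zero]
  by_contra hne
  obtain ⟨ρ, hρ⟩ := exists_permMonomial_eq_of_coeff_perPoly_ne_zero ℝ≥0 hne
  have h := congrArg (fun d => rowCount d r) hρ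
  simp only [rowCount_permMonomial, rowCount_add, rowCount_single, if_true] at h
  omega

/-! ### The column-swap trick -/

/-- **Deleting one cell does not make the permanent easy:** for `c' ≠ c''`,
`L⁺(per_n) ≤ 9 · L⁺(per_n %ᵐ x_{(r,c')}) + 2`. [folklore] -/
theorem complexity_perPoly_le_of_deleted {r c' c'' : Fin n} (hc : c' ≠ c'') :
    complexity (perPoly (Fin n) ℝ≥0) ≤ 9 * complexity (P0 (r, c') (perPoly (Fin n) ℝ≥0)) + 2 := by
  set per := perPoly (Fin n) ℝ≥0 with hper
  set R := P0 (r, c') per with hR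
  set C' := P1 (r, c') per with hC'
  have hτv : colSwap c' c'' (r, c'') = (r, c') := by simp [colSwap]
  have hne : ((r, c') : Fin n × Fin n) ≠ (r, c'') := by
    intro h; exact hc (Prod.mk.injEq _ _ _ _ ▸ h).2
  -- the minor at `(r,c')` is the column-swapped image of `R /ᵐ x_{(r,c'')}`
  have hmin : C' = rename (colSwap c' c'') (P1 (r, c'') R) := by
    have h1 : C' = rename (colSwap c' c'') (P1 (r, c'') per) := by
      rw [rename_P1 _ (colSwap_injective c' c''), hτv, rename_colSwap_perPoly]
    have h2 : P1 (r, c'') per = P1 (r, c'') R := by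
      conv_lhs => rw [← decomp (r, c') per]
      rw [P1_add, P1_X_mul_ne _ hne, ← hC', P1_P1_same_row_perPoly, mul_zero, zero_add]
    rw [h1, h2]
  have hdec : per = X (r, c') * rename (colSwap c' c'') (P1 (r, c'') R) + R := by
    rw [← hmin]; exact (decomp (r, c') per).symm
  calc complexity per
      = complexity (X (r, c') * rename (colSwap c' c'') (P1 (r, c'') R) + R) := by rw [← hdec]
    _ ≤ complexity (X (r, c') * rename (colSwap c' c'') (P1 (r, c'') R)) + complexity R + 1 :=
        complexity_add_le_holds _ _
    _ ≤ (complexity (X (r, c') : MvPolynomial (Fin n × Fin n) ℝ≥0) +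
          complexity (rename (colSwap c' c'') (P1 (r, c'') R)) + 1) + complexity R + 1 := by
        gcongr; exact complexity_mul_le_holds _ _
    _ = complexity (P1 (r, c'') R) + complexity R + 2 := by
        rw [complexity_X_holds, complexity_rename_of_injective_holds (colSwap_injective c' c'')]; ring
    _ ≤ 8 * complexity R + complexity R + 2 := by gcongr; exact complexity_P1_le _
    _ = 9 * complexity R + 2 := by ring

/-! ### Exponents of degree `≤ 2` and their margins -/

/-- Row weights are the row marginal. -/
theorem weight_rowWeight_eq_mapDomain (r : Fin n) (d : Fin n × Fin n →₀ ℕ) :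
    weight (rowWeight r) d = Finsupp.mapDomain Prod.fst d r := by
  classical
  rw [Finsupp.weight_apply, Finsupp.mapDomain, Finsupp.sum_apply]
  unfold Finsupp.sum
  apply Finset.sum_congr rfl
  intro x _
  simp [rowWeight, Finsupp.single_apply]

/-- Column weights are the column marginal. -/
theorem weight_colWeight_eq_mapDomain (c : Fin n) (d : Fin n × Fin n →₀ ℕ) :
    weight (colWeight c) d = Finsupp.mapDomain Prod.snd d c := by
  classical
  rw [Finsupp.weight_apply, Finsupp.mapDomain, Finsupp.sum_apply]
  unfold Finsupp.sum
  apply Finset.sum_congr rfl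
  intro x _
  simp [colWeight, Finsupp.single_apply]

/-- Exponents of degree `≤ 2`: `0`, a unit vector, or a sum of two unit vectors. [folklore] -/
theorem degree_le_two_cases {σ : Type*} (d : σ →₀ ℕ) (hd : degree d ≤ 2) :
    d = 0 ∨ (∃ u, d = Finsupp.single u 1) ∨ ∃ u v, d = Finsupp.single u 1 + Finsupp.single v 1 := by
  classical
  by_cases h1 : degree d ≤ 1
  · rcases eq_zero_or_single_of_degree_le_one d h1 with h | ⟨u, h⟩
    · exact Or.inl h
    · exact Or.inr (Or.inl ⟨u, h⟩)
  · right; right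
    have h0 : d ≠ 0 := by rintro rfl; simp at h1
    obtain ⟨u, hu⟩ := Finsupp.support_nonempty_iff.2 h0
    have hu1 : 1 ≤ d u := Nat.one_le_iff_ne_zero.2 (Finsupp.mem_support_iff.1 hu)
    set d₁ := d - Finsupp.single u 1 with hd₁
    have hsplit : d = d₁ + Finsupp.single u 1 := by
      ext x
      simp only [hd₁, Finsupp.coe_add, Finsupp.coe_tsub, Pi.add_apply, Pi.sub_apply,
        Finsupp.single_apply]
      split_ifs with hx
      · subst hx; omega
      · omega
    have hdeg₁ : degree d₁ ≤ 1 := by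
      have := congrArg degree hsplit
      rw [map_add, Finsupp.degree_single] at this
      omega
    have hd₁0 : d₁ ≠ 0 := by
      intro h
      rw [h, zero_add] at hsplit
      rw [hsplit, Finsupp.degree_single] at h1
      exact h1 le_rfl
    rcases eq_zero_or_single_of_degree_le_one d₁ hdeg₁ with h | ⟨v, hv⟩
    · exact absurd h hd₁0
    · exact ⟨v, u, by rw [hsplit, hv]⟩

/-- **Pairs of exponents of degree `≤ 2` with the same row and column marginals**: equal, or the two
"diagonals" of a genuine `2 × 2` block. [folklore] -/
theorem pairwise_degree_le_two {d d' : Fin n × Fin n →₀ ℕ} (hd : degree d ≤ 2) (hd' : degree d' ≤ 2)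
    (hrow : Finsupp.mapDomain Prod.fst d = Finsupp.mapDomain Prod.fst d')
    (hcol : Finsupp.mapDomain Prod.snd d = Finsupp.mapDomain Prod.snd d') :
    d' = d ∨ ∃ i i₂ j j₂ : Fin n, i ≠ i₂ ∧ j ≠ j₂ ∧
      d = Finsupp.single (i, j) 1 + Finsupp.single (i₂, j₂) 1 ∧
      d' = Finsupp.single (i, j₂) 1 + Finsupp.single (i₂, j) 1 := by
  have hdeg : degree d = degree d' := by
    rw [← Finsupp.degree_mapDomain Prod.fst d, hrow, Finsupp.degree_mapDomain]
  rcases degree_le_two_cases d hd with rfl | ⟨u, rfl⟩ | ⟨u, v, rfl⟩ <;>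
    rcases degree_le_two_cases d' hd' with rfl | ⟨u', rfl⟩ | ⟨u', v', rfl⟩ <;>
    simp only [map_zero, map_add, Finsupp.degree_single] at hdeg <;>
    try (exfalso; omega)
  · exact Or.inl rfl
  · left
    rw [Finsupp.mapDomain_single, Finsupp.mapDomain_single, Finsupp.single_left_inj one_ne_zero] at hrow hcol
    rw [Prod.ext hrow hcol]
  · -- two singles versus two singles
    rw [Finsupp.mapDomain_add, Finsupp.mapDomain_add, Finsupp.mapDomain_single, Finsupp.mapDomain_single,
      Finsupp.mapDomain_single, Finsupp.mapDomain_single,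
      Finsupp.single_add_single_eq_single_add_single one_ne_zero one_ne_zero] at hrow hcol
    obtain ⟨i, j⟩ := u
    obtain ⟨i₂, j₂⟩ := v
    obtain ⟨i', j'⟩ := u'
    obtain ⟨i₂', j₂'⟩ := v'
    simp only at hrow hcol ⊢
    have two : ¬ ((1 : ℕ) + 1 = 0) := by omega
    rcases hrow with ⟨h1, h2⟩ | ⟨-, h1, h2⟩ | ⟨h0, -⟩
    · rcases hcol with ⟨h3, h4⟩ | ⟨-, h3, h4⟩ | ⟨h0, -⟩
      · left; subst h1; subst h2; subst h3; subst h4; rfl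
      · -- rows aligned, columns crossed
        subst h1; subst h2; subst h3; subst h4
        by_cases hii : i = i₂
        · subst hii; left; rw [add_comm]
        by_cases hjj : j = j₂
        · subst hjj; left; rfl
        · exact Or.inr ⟨i, i₂, j, j₂, hii, hjj, rfl, rfl⟩
      · exact absurd h0 two
    · rcases hcol with ⟨h3, h4⟩ | ⟨-, h3, h4⟩ | ⟨h0, -⟩
      · -- rows crossed, columns aligned
        subst h1; subst h2; subst h3; subst h4
        by_cases hii : i = i₂
        · subst hii; left; rfl
        by_cases hjj : j = j₂
        · subst hjj; left; rw [add_comm]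
        · exact Or.inr ⟨i, i₂, j, j₂, hii, hjj, rfl, by rw [add_comm]⟩
      · left; subst h1; subst h2; subst h3; subst h4; rw [add_comm]
      · exact absurd h0 two
    · exact absurd h0 two

/-! ### The degree-two rung -/

/-- Constant bookkeeping: Jerrum–Snir through a scaled permanent. -/
theorem js_of_smul_bound (hn : 1 ≤ n) {a : ℝ≥0} (ha : a ≠ 0) {B : ℕ}
    (hK : complexity (a • perPoly (Fin n) ℝ≥0) ≤ B) :
    n * (2 ^ (n - 1) - 1) ≤ 2 * B + 2 := by
  have hjs := js_le_two_mul_complexity_perPoly (n := n) hn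
  have hback : complexity (perPoly (Fin n) ℝ≥0) ≤ complexity (a • perPoly (Fin n) ℝ≥0) + 1 := by
    have h := complexity_smul_le_holds a⁻¹ (a • perPoly (Fin n) ℝ≥0)
    rwa [inv_smul_smul₀ ha] at h
  omega

/-- **Closed form of the degree-two rung.** For `n ≥ 2` and every nonzero `h` of total degree `≤ 2`:
`n (2^{n-1} - 1) ≤ 9216 · L⁺(per_n · h) + 40`. [folklore] -/
theorem js_bound_totalDegree_le_two (hn : 2 ≤ n) {h : MvPolynomial (Fin n × Fin n) ℝ≥0} (hh : h ≠ 0)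
    (hdeg : h.totalDegree ≤ 2) :
    n * (2 ^ (n - 1) - 1) ≤ 9216 * complexity (perPoly (Fin n) ℝ≥0 * h) + 40 := by
  classical
  have hn1 : 1 ≤ n := by omega
  -- WLOG multihomogeneous
  set h' := multiTop (rowColWeights n) h with hh'def
  have hh' : h' ≠ 0 := multiTop_ne_zero _ hh
  have hmh : IsMultihomogeneous h' := isMultihomogeneous_multiTop h
  have hle : complexity (perPoly (Fin n) ℝ≥0 * h') ≤ complexity (perPoly (Fin n) ℝ≥0 * h) :=
    complexity_mul_multiTop_le _ _ _ perPoly_homogeneous_rowCol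
  have hdeg' : ∀ d ∈ h'.support, degree d ≤ 2 := by
    intro d hd
    have h1 := le_totalDegree (support_multiTop_subset _ _ hd)
    rw [← degree_eq_sum'] at h1
    exact h1.trans hdeg
  have hmarg : ∀ d ∈ h'.support, ∀ d' ∈ h'.support,
      Finsupp.mapDomain Prod.fst d = Finsupp.mapDomain Prod.fst d' ∧
      Finsupp.mapDomain Prod.snd d = Finsupp.mapDomain Prod.snd d' := by
    intro d hd d' hd'
    refine ⟨Finsupp.ext fun r => ?_, Finsupp.ext fun c => ?_⟩
    · obtain ⟨m, hm⟩ := hmh.1 r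
      rw [← weight_rowWeight_eq_mapDomain, ← weight_rowWeight_eq_mapDomain,
        hm (MvPolynomial.mem_support_iff.1 hd), hm (MvPolynomial.mem_support_iff.1 hd')]
    · obtain ⟨m, hm⟩ := hmh.2 c
      rw [← weight_colWeight_eq_mapDomain, ← weight_colWeight_eq_mapDomain,
        hm (MvPolynomial.mem_support_iff.1 hd), hm (MvPolynomial.mem_support_iff.1 hd')]
  obtain ⟨d₁, hd₁⟩ := MvPolynomial.support_nonempty.2 hh'
  have ha : coeff d₁ h' ≠ 0 := MvPolynomial.mem_support_iff.1 hd₁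
  set a := coeff d₁ h' with hadef
  by_cases hmono : ∀ d ∈ h'.support, d = d₁
  · -- Case A: `h'` is the monomial `a x^{d₁}`, `deg d₁ ≤ 2`
    have hh'eq : h' = monomial d₁ a := by
      refine MvPolynomial.ext _ _ fun d => ?_
      rw [coeff_monomial]
      split_ifs with hdd
      · rw [← hdd]
      · by_contra hne
        exact hdd (hmono d (MvPolynomial.mem_support_iff.2 hne)).symm
    rw [hh'eq] at hle
    rcases degree_le_two_cases d₁ (hdeg' _ hd₁) with hd | ⟨u, hd⟩ | ⟨u, v, hd⟩
    · -- constant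
      have hpair := pair_const_lower_bound (n := n) hn1 ha
      have hC : complexity (C a : MvPolynomial (Fin n × Fin n) ℝ≥0) = 0 := complexity_C_holds _
      rw [hC, add_zero] at hpair
      have hmon : (monomial d₁ a : MvPolynomial (Fin n × Fin n) ℝ≥0) = C a := by
        rw [hd]; rfl
      rw [hmon] at hle
      omega
    · -- one variable
      have hmon : perPoly (Fin n) ℝ≥0 * monomial d₁ a = X u * (a • perPoly (Fin n) ℝ≥0) := by
        rw [hd, smul_eq_C_mul, show (monomial (Finsupp.single u 1) a :
            MvPolynomial (Fin n × Fin n) ℝ≥0) = C a * X u by rw [X, C_mul_monomial, mul_one]]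
        ring
      rw [hmon] at hle
      have h1 := complexity_le_of_X_mul (v := u) (a • perPoly (Fin n) ℝ≥0)
      have := js_of_smul_bound hn1 ha (h1.trans (Nat.mul_le_mul_left 8 hle))
      omega
    · -- two variables
      have hmon : perPoly (Fin n) ℝ≥0 * monomial d₁ a = X u * (X v * (a • perPoly (Fin n) ℝ≥0)) := by
        rw [hd, smul_eq_C_mul, show (monomial (Finsupp.single u 1 + Finsupp.single v 1) a :
            MvPolynomial (Fin n × Fin n) ℝ≥0) = C a * X u * X v by
          rw [X, X, C_mul_monomial, mul_one, monomial_mul, mul_one]]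
        ring
      rw [hmon] at hle
      have h1 := complexity_le_of_X_mul (v := u) (X v * (a • perPoly (Fin n) ℝ≥0))
      have h2 := complexity_le_of_X_mul (v := v) (a • perPoly (Fin n) ℝ≥0)
      have := js_of_smul_bound hn1 ha (h2.trans (Nat.mul_le_mul_left 8 (h1.trans (Nat.mul_le_mul_left 8 hle))))
      omega
  · -- Case B: two distinct exponents ⇒ `h' = a x_{ij} x_{i₂j₂} + b x_{ij₂} x_{i₂j}`
    push Not at hmono
    obtain ⟨d₂, hd₂, hne⟩ := hmono
    obtain ⟨hr12, hc12⟩ := hmarg d₁ hd₁ d₂ hd₂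
    rcases pairwise_degree_le_two (hdeg' _ hd₁) (hdeg' _ hd₂) hr12 hc12 with h | ⟨i, i₂, j, j₂, hii, hjj, hd1, hd2⟩
    · exact absurd h hne
    have hb : coeff d₂ h' ≠ 0 := MvPolynomial.mem_support_iff.1 hd₂
    have hd12 : d₁ ≠ d₂ := fun h => hne h.symm
    -- every exponent of `h'` is `d₁` or `d₂`
    have hsupp : ∀ d ∈ h'.support, d = d₁ ∨ d = d₂ := by
      intro d hd
      obtain ⟨hr, hc⟩ := hmarg d₁ hd₁ d hd
      rcases pairwise_degree_le_two (hdeg' _ hd₁) (hdeg' _ hd) hr hc with h | ⟨i', i₂', j', j₂', -, -, hd1', hd'⟩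
      · exact Or.inl h
      · right
        rw [hd', hd2]
        rw [hd1, Finsupp.single_add_single_eq_single_add_single one_ne_zero one_ne_zero] at hd1'
        simp only [Prod.mk.injEq] at hd1'
        rcases hd1' with ⟨⟨h1, h2⟩, h3, h4⟩ | ⟨-, ⟨h1, h2⟩, h3, h4⟩ | ⟨h0, -⟩
        · subst h1; subst h2; subst h3; subst h4; rfl
        · subst h1; subst h2; subst h3; subst h4; rw [add_comm]
        · omega
    have hX1 : (X (i, j) * X (i₂, j₂) : MvPolynomial (Fin n × Fin n) ℝ≥0) = monomial d₁ 1 := by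
      rw [hd1, X, X, monomial_mul, mul_one]
    have hX2 : (X (i, j₂) * X (i₂, j) : MvPolynomial (Fin n × Fin n) ℝ≥0) = monomial d₂ 1 := by
      rw [hd2, X, X, monomial_mul, mul_one]
    have hh'eq : h' = a • (X (i, j) * X (i₂, j₂)) + coeff d₂ h' • (X (i, j₂) * X (i₂, j)) := by
      rw [hX1, hX2, smul_monomial, smul_monomial, smul_eq_mul, smul_eq_mul, mul_one, mul_one]
      refine MvPolynomial.ext _ _ fun d => ?_
      rw [coeff_add, coeff_monomial, coeff_monomial]
      by_cases h1 : d₁ = d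
      · subst h1; rw [if_pos rfl, if_neg (Ne.symm hd12), add_zero]
      · rw [if_neg h1]
        by_cases h2 : d₂ = d
        · subst h2; rw [if_pos rfl, zero_add]
        · rw [if_neg h2, add_zero]
          by_contra hne'
          rcases hsupp d (MvPolynomial.mem_support_iff.2 hne') with h | h
          · exact h1 h.symm
          · exact h2 h.symm
    -- divide at `(i₂, j₂)`, delete at `(i₂, j)`, strip `x_{ij}`
    have hv3 : ((i₂, j) : Fin n × Fin n) ≠ (i₂, j₂) := fun h => hjj (Prod.mk.injEq _ _ _ _ ▸ h).2
    have hv4 : ((i, j) : Fin n × Fin n) ≠ (i₂, j) := fun h => hii (Prod.mk.injEq _ _ _ _ ▸ h).1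
    have hv6 : ((i, j) : Fin n × Fin n) ≠ (i₂, j₂) := fun h => hii (Prod.mk.injEq _ _ _ _ ▸ h).1
    have hv7 : ((i, j₂) : Fin n × Fin n) ≠ (i₂, j₂) := fun h => hii (Prod.mk.injEq _ _ _ _ ▸ h).1
    set b := coeff d₂ h' with hbdef
    set R := P0 (i₂, j) (perPoly (Fin n) ℝ≥0) with hRdef
    have hΦ : P0 (i₂, j) (P1 (i₂, j₂) (perPoly (Fin n) ℝ≥0 * h')) = X (i, j) * (a • R) := by
      rw [hh'eq, mul_add, P1_add, P0_add]
      have e1 : perPoly (Fin n) ℝ≥0 * (a • (X (i, j) * X (i₂, j₂))) =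
          X (i₂, j₂) * (X (i, j) * (a • perPoly (Fin n) ℝ≥0)) := by
        rw [smul_eq_C_mul, smul_eq_C_mul]; ring
      have e2 : perPoly (Fin n) ℝ≥0 * (b • (X (i, j₂) * X (i₂, j))) =
          X (i₂, j) * (X (i, j₂) * (b • perPoly (Fin n) ℝ≥0)) := by
        rw [smul_eq_C_mul, smul_eq_C_mul]; ring
      rw [e1, e2, P1_X_mul_self, P1_X_mul_ne _ hv3, P0_X_mul_ne _ hv4, P0_X_mul_self, add_zero,
        smul_eq_C_mul, smul_eq_C_mul, P0_mul, P0_C]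
    have hc0 : complexity (P1 (i₂, j₂) (perPoly (Fin n) ℝ≥0 * h')) ≤ 8 * complexity (perPoly (Fin n) ℝ≥0 * h') :=
      complexity_P1_le _
    have hc1 : complexity (X (i, j) * (a • R)) ≤ 8 * complexity (P1 (i₂, j₂) (perPoly (Fin n) ℝ≥0 * h')) := by
      rw [← hΦ]; exact complexity_P0_le _
    have hc2 : complexity (a • R) ≤ 8 * complexity (X (i, j) * (a • R)) := complexity_le_of_X_mul _
    have hc3 : complexity R ≤ complexity (a • R) + 1 := by
      have h := complexity_smul_le_holds a⁻¹ (a • R)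
      rwa [inv_smul_smul₀ ha] at h
    have hc4 : complexity (perPoly (Fin n) ℝ≥0) ≤ 9 * complexity R + 2 :=
      complexity_perPoly_le_of_deleted (r := i₂) hjj
    have hjs := js_le_two_mul_complexity_perPoly (n := n) hn1
    omega

/-- **SECOND NEW RUNG of `PerMultiplesHard`: no counterexample has total degree `≤ 2`.** [folklore] -/
theorem perMultiplesHard_rung_totalDegree_le_two (c : ℕ) :
    ∃ n₀ : ℕ, ∀ n ≥ n₀, ∀ h : MvPolynomial (Fin n × Fin n) ℝ≥0, h ≠ 0 → h.totalDegree ≤ 2 →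
      2 ^ ((Nat.log 2 n + c) ^ c) < complexity (perPoly (Fin n) ℝ≥0 * h) := by
  obtain ⟨L₀, hL₀⟩ := polylog_eventually c
  refine ⟨2 ^ L₀ + 64, fun n hn h hh hdeg => ?_⟩
  have hT : 1 ≤ 2 ^ L₀ := Nat.one_le_two_pow
  have hn64 : 64 ≤ n := le_trans (Nat.le_add_left 64 _) hn
  have hn2 : 2 ≤ n := le_trans (by norm_num) hn64
  have hjs := js_bound_totalDegree_le_two hn2 hh hdeg
  have hL : L₀ ≤ Nat.log 2 n := Nat.le_log_of_pow_le (by norm_num) (le_trans (Nat.le_add_right _ _) hn)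
  have h8 := hL₀ (Nat.log 2 n) hL
  have hpow : 2 ^ Nat.log 2 n ≤ n := Nat.pow_log_le_self 2 (by omega)
  set E := (Nat.log 2 n + c) ^ c with hEdef
  set P := 2 ^ (n - 20) with hPdef
  have hexp : E + 17 ≤ n - 20 := by omega
  have hE : 2 ^ E * 2 ^ 17 ≤ P := by
    rw [hPdef, ← pow_add]
    exact Nat.pow_le_pow_right (by norm_num) hexp
  have hP : 2 ^ (n - 1) = 2 ^ 19 * P := by
    rw [hPdef, ← pow_add, show 19 + (n - 20) = n - 1 by omega]
  have hone : 1 ≤ 2 ^ E := Nat.one_le_two_pow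
  have hmul : 2 ^ (n - 1) - 1 ≤ n * (2 ^ (n - 1) - 1) := Nat.le_mul_of_pos_left _ (by omega)
  rw [hP] at hmul hjs
  norm_num at hE hmul hjs ⊢
  omega

end Summit.ValiantsHypothesis.ValiantsHypothesis.Cruxes.PerMultiplesHard.Disproof.Rung2


/-! ## (l) THE GENERAL RUNG: multipliers of sublinear total degree (sorry-free)

Design: after `multiTop` the multiplier lives in a `d × d` block `R_T × C_T`; a free column permutation makes
`R_T ∩ C_T = ∅`; the face `G = diag(J) ∪ (Jᶜ × Jᶜ)`, `J = R_T ∪ C_T`, turns `per_n` into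
`x^{diag J} · per(Jᶜ)` (a renamed smaller permanent, `perRestrict_diagBlock`) while leaving the multiplier
untouched; single-cell top forms inside the block then shrink the multiplier to ONE monomial for free
(`rounds`); stripping `≤ 3d` variables and Jerrum–Snir finish. -/

namespace Summit.ValiantsHypothesis.ValiantsHypothesis.Cruxes.PerMultiplesHard.Disproof.General

open MvPolynomial
open Finsupp (weight degree)
open scoped NNReal
open Literature.Computability.AlgebraicComplexity
open Summit.ValiantsHypothesis.Theorems.PerDivisionHardNegative
open Summit.ValiantsHypothesis.ValiantsHypothesis.Cruxes.PerMultiplesHard.Disproof.TopForm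
open Summit.ValiantsHypothesis.ValiantsHypothesis.Cruxes.PerMultiplesHard.Disproof.DivX
open Summit.ValiantsHypothesis.ValiantsHypothesis.Cruxes.PerMultiplesHard.Disproof.Rung
open Summit.ValiantsHypothesis.ValiantsHypothesis.Cruxes.PerMultiplesHard.Disproof.Rung2

variable {n : ℕ}

/-! ### G1. The permanent under index equivalences and column permutations -/

/-- Permutation patterns under an index equivalence. [folklore] -/
theorem mapDomain_prodMap_permMonomial {ι ι' : Type*} [Fintype ι] [DecidableEq ι] [Fintype ι'] [DecidableEq ι']
    (e : ι ≃ ι') (σ : Equiv.Perm ι) :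
    Finsupp.mapDomain (Prod.map e e) (permMonomial σ) = permMonomial (e.permCongr σ) := by
  change Finsupp.mapDomain (Prod.map e e) (∑ i, Finsupp.single (σ i, i) 1) =
    ∑ i', Finsupp.single ((e.permCongr σ) i', i') 1
  rw [Finsupp.mapDomain_finsetSum]
  simp only [Finsupp.mapDomain_single, Prod.map_apply]
  exact Fintype.sum_equiv e _ _ (fun i => by simp [Equiv.permCongr_apply])

/-- The generic permanent is natural under equivalences of the index type. [folklore] -/
theorem rename_prodMap_perPoly {ι ι' : Type*} [Fintype ι] [DecidableEq ι] [Fintype ι'] [DecidableEq ι']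
    (e : ι ≃ ι') : rename (Prod.map e e) (perPoly ι ℝ≥0) = perPoly ι' ℝ≥0 := by
  rw [perPoly_eq_sum_monomial, perPoly_eq_sum_monomial, map_sum]
  simp only [rename_monomial, mapDomain_prodMap_permMonomial]
  exact Fintype.sum_equiv (Equiv.permCongr e) _ _ (fun σ => rfl)

/-- A column permutation on variable indices. -/
def colMap (τ : Equiv.Perm (Fin n)) : Fin n × Fin n → Fin n × Fin n := fun p => (p.1, τ p.2)

/-- Column permutations are injective on variable indices. [folklore] -/
theorem colMap_injective (τ : Equiv.Perm (Fin n)) : Function.Injective (colMap τ) := by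
  intro p q h
  simp only [colMap, Prod.mk.injEq] at h
  exact Prod.ext h.1 (τ.injective h.2)

/-- Permutation patterns under a column permutation. [folklore] -/
theorem mapDomain_colMap_permMonomial (τ ρ : Equiv.Perm (Fin n)) :
    Finsupp.mapDomain (colMap τ) (permMonomial ρ) = permMonomial (ρ * τ.symm) := by
  change Finsupp.mapDomain (colMap τ) (∑ i, Finsupp.single (ρ i, i) 1) =
    ∑ j, Finsupp.single ((ρ * τ.symm) j, j) 1
  rw [Finsupp.mapDomain_finsetSum]
  simp only [Finsupp.mapDomain_single, colMap, Equiv.Perm.mul_apply]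
  exact Fintype.sum_equiv τ _ _ (fun i => by simp)

/-- The permanent is invariant under column permutations. [folklore] -/
theorem rename_colMap_perPoly (τ : Equiv.Perm (Fin n)) :
    rename (colMap τ) (perPoly (Fin n) ℝ≥0) = perPoly (Fin n) ℝ≥0 := by
  rw [perPoly_eq_sum_monomial, map_sum]
  simp only [rename_monomial, mapDomain_colMap_permMonomial]
  exact Fintype.sum_equiv (Equiv.mulRight τ.symm) _ _ (fun σ => rfl)

/-! ### G2. Supports, degrees and marginals -/

/-- The support of an exponent vector has at most `degree` points. [folklore] -/
theorem card_support_le_degree {α : Type*} (f : α →₀ ℕ) : f.support.card ≤ degree f := by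
  rw [Finsupp.degree_apply, Finset.card_eq_sum_ones]
  exact Finset.sum_le_sum fun a ha => Nat.one_le_iff_ne_zero.2 (Finsupp.mem_support_iff.1 ha)

/-- An entry is at most its row marginal. [folklore] -/
theorem le_mapDomain_fst (S : Fin n × Fin n →₀ ℕ) (i j : Fin n) :
    S (i, j) ≤ Finsupp.mapDomain Prod.fst S i := by
  classical
  rw [← weight_rowWeight_eq_mapDomain, Finsupp.weight_apply]
  by_cases h : (i, j) ∈ S.support
  · unfold Finsupp.sum
    refine le_trans ?_ (Finset.single_le_sum (fun u _ => Nat.zero_le _) h)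
    simp [rowWeight]
  · rw [Finsupp.notMem_support_iff.1 h]; exact Nat.zero_le _

/-- An entry is at most its column marginal. [folklore] -/
theorem le_mapDomain_snd (S : Fin n × Fin n →₀ ℕ) (i j : Fin n) :
    S (i, j) ≤ Finsupp.mapDomain Prod.snd S j := by
  classical
  rw [← weight_colWeight_eq_mapDomain, Finsupp.weight_apply]
  by_cases h : (i, j) ∈ S.support
  · unfold Finsupp.sum
    refine le_trans ?_ (Finset.single_le_sum (fun u _ => Nat.zero_le _) h)
    simp [colWeight]
  · rw [Finsupp.notMem_support_iff.1 h]; exact Nat.zero_le _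

/-! ### G5. Single-cell top forms: shrinking the multiplier for free -/

/-- The weight counting one cell. -/
def cellWeight {σ : Type*} [DecidableEq σ] (v : σ) : σ → ℕ := fun u => if u = v then 1 else 0

/-- The `cellWeight v`-weight of an exponent is its `v`-entry. [folklore] -/
theorem weight_cellWeight {σ : Type*} [DecidableEq σ] (v : σ) (S : σ →₀ ℕ) : weight (cellWeight v) S = S v := by
  rw [Finsupp.weight_apply]
  unfold Finsupp.sum
  simp only [cellWeight, smul_eq_mul, mul_ite, mul_one, mul_zero]
  rw [Finset.sum_ite_eq']
  split_ifs with h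
  · rfl
  · exact (Finsupp.notMem_support_iff.1 h).symm

/-- **Rounds.** If `W` is untouched by the top form at every admissible cell, then single-cell top forms
shrink any multiplier whose exponents only use admissible cells to ONE of its monomials, at no cost:
`∃ S ∈ supp g, L⁺(W · a x^S) ≤ L⁺(W · g)` with `a ≠ 0`. [folklore] -/
theorem rounds {σ : Type*} [DecidableEq σ] (W : MvPolynomial σ ℝ≥0) (P : σ → Prop)
    (hW : ∀ v, P v → IsWeightedHomogeneous (cellWeight v) W 0) :
    ∀ (k : ℕ) (g : MvPolynomial σ ℝ≥0), g ≠ 0 → g.support.card ≤ k → (∀ S ∈ g.support, ∀ v ∈ S.support, P v) →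
      ∃ S ∈ g.support, ∃ a : ℝ≥0, a ≠ 0 ∧ complexity (W * monomial S a) ≤ complexity (W * g) := by
  classical
  intro k
  induction k with
  | zero =>
    intro g hg hk _
    exact absurd (Finset.card_eq_zero.1 (Nat.le_zero.1 hk)) (Finset.nonempty_iff_ne_empty.1 (MvPolynomial.support_nonempty.2 hg))
  | succ k ih =>
    intro g hg hk hP
    by_cases hone : ∀ S ∈ g.support, ∀ S' ∈ g.support, S = S'
    · obtain ⟨S, hS⟩ := MvPolynomial.support_nonempty.2 hg
      refine ⟨S, hS, coeff S g, MvPolynomial.mem_support_iff.1 hS, le_of_eq ?_⟩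
      have hgeq : monomial S (coeff S g) = g := by
        refine MvPolynomial.ext _ _ fun d => ?_
        rw [coeff_monomial]
        split_ifs with hSd
        · rw [hSd]
        · by_contra hne
          exact hSd (hone S hS d (MvPolynomial.mem_support_iff.2 (Ne.symm hne)))
      rw [hgeq]
    · push Not at hone
      obtain ⟨S, hS, S', hS', hne⟩ := hone
      obtain ⟨v, hv⟩ : ∃ v, S v ≠ S' v := by
        by_contra h
        push Not at h
        exact hne (Finsupp.ext h)
      have hPv : P v := by
        by_cases h0 : S v = 0
        · have : S' v ≠ 0 := fun h' => hv (h0.trans h'.symm)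
          exact hP S' hS' v (Finsupp.mem_support_iff.2 this)
        · exact hP S hS v (Finsupp.mem_support_iff.2 h0)
      set g' := topForm (cellWeight v) g with hg'def
      have hg' : g' ≠ 0 := topForm_ne_zero _ hg
      have hsub : g'.support ⊆ g.support := support_topForm_subset _ _
      -- the exponent with the smaller `v`-entry drops out
      have drop : ∀ T ∈ g.support, ∀ T' ∈ g.support, T v < T' v → T ∉ g'.support := by
        intro T hT T' hT' hlt hTg'
        have hc := MvPolynomial.mem_support_iff.1 hTg'
        rw [hg'def, coeff_topForm] at hc
        split_ifs at hc with hw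
        · rw [weight_cellWeight] at hw
          have := le_weightedTotalDegree (cellWeight v) hT'
          rw [weight_cellWeight] at this
          omega
        · exact hc rfl
      have hlt : g'.support.card < g.support.card := by
        apply Finset.card_lt_card
        rw [Finset.ssubset_iff_of_subset hsub]
        rcases Nat.lt_or_gt_of_ne hv with h | h
        · exact ⟨S, hS, drop S hS S' hS' h⟩
        · exact ⟨S', hS', drop S' hS' S hS h⟩
      have hcomp : complexity (W * g') ≤ complexity (W * g) := by
        have h1 := complexity_topForm_le (cellWeight v) (W * g)
        rwa [topForm_mul, topForm_of_isWeightedHomogeneous _ (hW v hPv)] at h1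
      obtain ⟨T, hT, a, ha, hle⟩ := ih g' hg' (by omega) (fun T hT u hu => hP T (hsub hT) u hu)
      exact ⟨T, hsub hT, a, ha, hle.trans hcomp⟩

/-! ### G6. Stripping a monomial -/

/-- `L(r) ≤ 8^b · L(x_a^b · r)`. [folklore] -/
theorem complexity_le_of_X_pow_mul {σ : Type*} [DecidableEq σ] (a : σ) (b : ℕ) (r : MvPolynomial σ ℝ≥0) :
    complexity r ≤ 8 ^ b * complexity (X a ^ b * r) := by
  induction b generalizing r with
  | zero => simp
  | succ b ih =>
    calc complexity r ≤ 8 ^ b * complexity (X a ^ b * r) := ih r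
      _ ≤ 8 ^ b * (8 * complexity (X a * (X a ^ b * r))) :=
          Nat.mul_le_mul_left _ (complexity_le_of_X_mul (v := a) _)
      _ = 8 ^ (b + 1) * complexity (X a ^ (b + 1) * r) := by rw [pow_succ, pow_succ]; ring_nf

/-- **Stripping a monomial factor costs `8^{deg}`:** `L(q) ≤ 8^{deg D} · L(x^D · q)`. [folklore] -/
theorem complexity_le_of_monomial_mul {σ : Type*} [DecidableEq σ] (D : σ →₀ ℕ) (q : MvPolynomial σ ℝ≥0) :
    complexity q ≤ 8 ^ degree D * complexity (monomial D 1 * q) := by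
  induction D using Finsupp.induction generalizing q with
  | zero => simp
  | single_add a b f _ _ ih =>
    have hsplit : (monomial (Finsupp.single a b + f) 1 : MvPolynomial σ ℝ≥0) = X a ^ b * monomial f 1 := by
      rw [X_pow_eq_monomial, monomial_mul, mul_one]
    rw [hsplit, map_add, Finsupp.degree_single, pow_add, mul_assoc (X a ^ b), mul_assoc (8 ^ b)]
    calc complexity q ≤ 8 ^ degree f * complexity (monomial f 1 * q) := ih q
      _ ≤ 8 ^ degree f * (8 ^ b * complexity (X a ^ b * (monomial f 1 * q))) :=
          Nat.mul_le_mul_left _ (complexity_le_of_X_pow_mul a b _)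
      _ = 8 ^ b * (8 ^ degree f * complexity (X a ^ b * (monomial f 1 * q))) := by ring

/-! ### G3. The diagonal-plus-block face -/

/-- The face graph `diag(J) ∪ (Jᶜ × Jᶜ)`. -/
def diagBlock (J : Finset (Fin n)) : Finset (Fin n × Fin n) :=
  Finset.univ.filter (fun p => (p.1 = p.2 ∧ p.2 ∈ J) ∨ (p.1 ∉ J ∧ p.2 ∉ J))

/-- Membership in the face graph. [folklore] -/
theorem mem_diagBlock {J : Finset (Fin n)} {p : Fin n × Fin n} :
    p ∈ diagBlock J ↔ (p.1 = p.2 ∧ p.2 ∈ J) ∨ (p.1 ∉ J ∧ p.2 ∉ J) := by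
  simp [diagBlock]

/-- Permutations inside the face graph: identity on `J`, stabilising `Jᶜ`. [folklore] -/
theorem subset_diagBlock_iff {J : Finset (Fin n)} (ρ : Equiv.Perm (Fin n)) :
    (∀ j, (ρ j, j) ∈ diagBlock J) ↔ (∀ j ∈ J, ρ j = j) ∧ (∀ j ∉ J, ρ j ∉ J) := by
  simp only [mem_diagBlock]
  constructor
  · intro h
    refine ⟨fun j hj => ?_, fun j hj => ?_⟩
    · rcases h j with ⟨h1, -⟩ | ⟨-, h2⟩
      · exact h1
      · exact absurd hj h2
    · rcases h j with ⟨-, h2⟩ | ⟨h1, -⟩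
      · exact absurd h2 hj
      · exact h1
  · rintro ⟨hin, hout⟩ j
    by_cases hj : j ∈ J
    · exact Or.inl ⟨hin j hj, hj⟩
    · exact Or.inr ⟨hout j hj, hj⟩

/-- The identity permutation lies inside the face graph. [folklore] -/
theorem one_subset_diagBlock (J : Finset (Fin n)) : ∀ j, ((1 : Equiv.Perm (Fin n)) j, j) ∈ diagBlock J := by
  rw [subset_diagBlock_iff]; exact ⟨fun j _ => rfl, fun j hj => hj⟩

/-- Permutations inside the face graph are exactly the extensions by the identity of permutations of
`Jᶜ`. [folklore] -/
theorem subset_diagBlock_iff_exists {J : Finset (Fin n)} (ρ : Equiv.Perm (Fin n)) :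
    (∀ j, (ρ j, j) ∈ diagBlock J) ↔ ∃ σ : Equiv.Perm {x // x ∉ J}, Equiv.Perm.ofSubtype σ = ρ := by
  rw [subset_diagBlock_iff]
  constructor
  · rintro ⟨hin, hout⟩
    have h₁ : ∀ x, ρ x ∉ J ↔ x ∉ J := by
      intro x
      by_cases hx : x ∈ J
      · rw [hin x hx]
      · exact ⟨fun _ => hx, fun _ => hout x hx⟩
    refine ⟨ρ.subtypePerm h₁, Equiv.Perm.ofSubtype_subtypePerm h₁ (fun x hx => ?_)⟩
    by_contra hxJ
    have hxJ' : x ∈ J := by simpa using hxJ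
    exact hx (hin x hxJ')
  · rintro ⟨σ, rfl⟩
    refine ⟨fun j hj => Equiv.Perm.ofSubtype_apply_of_not_mem σ (not_not.2 hj), fun j hj => ?_⟩
    rw [Equiv.Perm.ofSubtype_apply_of_mem σ hj]
    exact (σ ⟨j, hj⟩).2

/-- The diagonal pattern of `J`. -/
def diagPat (J : Finset (Fin n)) : Fin n × Fin n →₀ ℕ := ∑ j ∈ J, Finsupp.single (j, j) 1

/-- The degree of the diagonal pattern is `|J|`. [folklore] -/
theorem degree_diagPat (J : Finset (Fin n)) : degree (diagPat J) = J.card := by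
  unfold diagPat
  rw [map_sum]
  simp [Finsupp.degree_single]

/-- The pattern of an extended permutation: diagonal on `J` plus the renamed pattern on `Jᶜ`. [folklore] -/
theorem permMonomial_ofSubtype {J : Finset (Fin n)} (σ : Equiv.Perm {x // x ∉ J}) :
    permMonomial (Equiv.Perm.ofSubtype σ) =
      diagPat J + Finsupp.mapDomain (Prod.map Subtype.val Subtype.val) (permMonomial σ) := by
  classical
  change (∑ j, Finsupp.single ((Equiv.Perm.ofSubtype σ) j, j) 1) = _
  rw [← Finset.sum_filter_add_sum_filter_not Finset.univ (fun j => j ∈ J)]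
  congr 1
  · rw [Finset.filter_mem_eq_inter, Finset.univ_inter]
    apply Finset.sum_congr rfl
    intro j hj
    rw [Equiv.Perm.ofSubtype_apply_of_not_mem σ (not_not.2 hj)]
  · change _ = Finsupp.mapDomain _ (∑ x : {x // x ∉ J}, Finsupp.single (σ x, x) 1)
    rw [Finsupp.mapDomain_finsetSum]
    simp only [Finsupp.mapDomain_single, Prod.map_apply]
    rw [Finset.sum_subtype (Finset.univ.filter (fun j => j ∉ J)) (p := fun j => j ∉ J) (by simp)]
    apply Fintype.sum_congr
    intro x
    rw [Equiv.Perm.ofSubtype_apply_coe]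

/-- **The face `diag(J) ∪ (Jᶜ × Jᶜ)` of the permanent** is `x^{diag J}` times the (renamed) permanent of
`Jᶜ`. [folklore] -/
theorem perRestrict_diagBlock (J : Finset (Fin n)) :
    perRestrict (diagBlock J) =
      monomial (diagPat J) 1 * rename (Prod.map Subtype.val Subtype.val) (perPoly {x // x ∉ J} ℝ≥0) := by
  classical
  unfold perRestrict
  have hset : Finset.univ.filter (fun ρ : Equiv.Perm (Fin n) => ∀ j, (ρ j, j) ∈ diagBlock J) =
      Finset.univ.map ⟨(Equiv.Perm.ofSubtype : Equiv.Perm {x // x ∉ J} → Equiv.Perm (Fin n)),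
        Equiv.Perm.ofSubtype_injective⟩ := by
    ext ρ
    simp only [Finset.mem_filter, Finset.mem_univ, true_and, Finset.mem_map, Function.Embedding.coeFn_mk]
    exact subset_diagBlock_iff_exists ρ
  rw [hset, Finset.sum_map]
  simp only [Function.Embedding.coeFn_mk, permMonomial_ofSubtype]
  rw [perPoly_eq_sum_monomial, map_sum, Finset.mul_sum]
  apply Finset.sum_congr rfl
  intro σ _
  rw [rename_monomial, monomial_mul, one_mul]

/-! ### G4. Homogeneity: block cells do not touch the face, the face does not touch the multiplier -/

/-- At a cell `(i, j)` with `j ∈ J`, `i ≠ j`, the face polynomial is untouched by the single-cell top form.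
[folklore] -/
theorem isWeightedHomogeneous_perRestrict_cell {J : Finset (Fin n)} {i j : Fin n} (hij : i ≠ j) (hj : j ∈ J) :
    IsWeightedHomogeneous (cellWeight (i, j)) (perRestrict (diagBlock J)) 0 := by
  classical
  unfold perRestrict
  apply IsWeightedHomogeneous.sum
  intro ρ hρ
  apply isWeightedHomogeneous_monomial
  rw [Finset.mem_filter] at hρ
  have hfix : ρ j = j := ((subset_diagBlock_iff ρ).1 hρ.2).1 j hj
  rw [weight_cellWeight, permMonomial_apply, if_neg]
  intro h
  exact hij (h.symm.trans hfix)

/-- A polynomial none of whose monomials meets `G` has `1_G`-weight `0`. [folklore] -/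
theorem isWeightedHomogeneous_graphWeight_zero {G : Finset (Fin n × Fin n)}
    {p : MvPolynomial (Fin n × Fin n) ℝ≥0} (hp : ∀ S ∈ p.support, ∀ u ∈ S.support, u ∉ G) :
    IsWeightedHomogeneous (graphWeight G) p 0 := by
  intro S hS
  rw [Finsupp.weight_apply]
  unfold Finsupp.sum
  apply Finset.sum_eq_zero
  intro u hu
  simp [graphWeight, hp S (MvPolynomial.mem_support_iff.2 hS) u hu]

/-! ### G7. Assembly: the sublinear-degree rung -/

/-- **Closed form of the general rung.** For `2d < n` and every nonzero `h` of total degree `≤ d` there is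
`m ≥ n - 2d` with `m (2^{m-1} - 1) ≤ 2 · 8^{3d} · (L⁺(per_n · h) + 1)`. [folklore] -/
theorem js_bound_totalDegree {d : ℕ} (hdn : 2 * d < n) {h : MvPolynomial (Fin n × Fin n) ℝ≥0}
    (hh : h ≠ 0) (hdeg : h.totalDegree ≤ d) :
    ∃ m : ℕ, n ≤ m + 2 * d ∧
      m * (2 ^ (m - 1) - 1) ≤ 2 * 8 ^ (3 * d) * (complexity (perPoly (Fin n) ℝ≥0 * h) + 1) := by
  classical
  -- (1) WLOG multihomogeneous
  set h' := multiTop (rowColWeights n) h with hh'def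
  have hh' : h' ≠ 0 := multiTop_ne_zero _ hh
  have hmh : IsMultihomogeneous h' := isMultihomogeneous_multiTop h
  have hle₁ : complexity (perPoly (Fin n) ℝ≥0 * h') ≤ complexity (perPoly (Fin n) ℝ≥0 * h) :=
    complexity_mul_multiTop_le _ _ _ perPoly_homogeneous_rowCol
  have hsupp' : h'.support ⊆ h.support := support_multiTop_subset _ _
  have hdegS : ∀ S ∈ h'.support, degree S ≤ d := fun S hS => by
    have h1 := le_totalDegree (hsupp' hS)
    rw [← degree_eq_sum'] at h1
    exact h1.trans hdeg
  have hmarg : ∀ S ∈ h'.support, ∀ S' ∈ h'.support,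
      Finsupp.mapDomain Prod.fst S = Finsupp.mapDomain Prod.fst S' ∧
      Finsupp.mapDomain Prod.snd S = Finsupp.mapDomain Prod.snd S' := by
    intro S hS S' hS'
    refine ⟨Finsupp.ext fun r => ?_, Finsupp.ext fun c => ?_⟩
    · obtain ⟨m, hm⟩ := hmh.1 r
      rw [← weight_rowWeight_eq_mapDomain, ← weight_rowWeight_eq_mapDomain,
        hm (MvPolynomial.mem_support_iff.1 hS), hm (MvPolynomial.mem_support_iff.1 hS')]
    · obtain ⟨m, hm⟩ := hmh.2 c
      rw [← weight_colWeight_eq_mapDomain, ← weight_colWeight_eq_mapDomain,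
        hm (MvPolynomial.mem_support_iff.1 hS), hm (MvPolynomial.mem_support_iff.1 hS')]
  -- (2) the block
  obtain ⟨S₀, hS₀⟩ := MvPolynomial.support_nonempty.2 hh'
  set RT := (Finsupp.mapDomain Prod.fst S₀).support with hRT
  set CT := (Finsupp.mapDomain Prod.snd S₀).support with hCT
  have hRT_card : RT.card ≤ d :=
    (card_support_le_degree _).trans (by rw [Finsupp.degree_mapDomain]; exact hdegS S₀ hS₀)
  have hCT_card : CT.card ≤ d :=
    (card_support_le_degree _).trans (by rw [Finsupp.degree_mapDomain]; exact hdegS S₀ hS₀)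
  have hblock : ∀ S ∈ h'.support, ∀ u ∈ S.support, u.1 ∈ RT ∧ u.2 ∈ CT := by
    intro S hS u hu
    obtain ⟨hr, hc⟩ := hmarg S hS S₀ hS₀
    obtain ⟨i, j⟩ := u
    have hpos : 0 < S (i, j) := Nat.pos_of_ne_zero (Finsupp.mem_support_iff.1 hu)
    have h1 := le_mapDomain_fst S i j
    have h2 := le_mapDomain_snd S i j
    constructor
    · rw [hRT, Finsupp.mem_support_iff, ← hr]; exact (lt_of_lt_of_le hpos h1).ne'
    · rw [hCT, Finsupp.mem_support_iff, ← hc]; exact (lt_of_lt_of_le hpos h2).ne'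
  -- (3) a column permutation making the column block disjoint from `RT`
  have hroom : CT.card ≤ (RTᶜ).card := by rw [Finset.card_compl, Fintype.card_fin]; omega
  obtain ⟨Y, hYsub, hYcard⟩ := Finset.exists_subset_card_eq hroom
  have hYRT : ∀ y ∈ Y, y ∉ RT := fun y hy => Finset.mem_compl.1 (hYsub hy)
  have hcardEq : Fintype.card {x // x ∈ CT} = Fintype.card {x // x ∈ Y} := by simp [hYcard]
  set e := Fintype.equivOfCardEq hcardEq with he
  set τ : Equiv.Perm (Fin n) := e.extendSubtype with hτ
  have hτY : ∀ c ∈ CT, τ c ∈ Y := fun c hc => e.extendSubtype_mem c hc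
  set h'' := rename (colMap τ) h' with hh''def
  have hh'' : h'' ≠ 0 := fun h0 =>
    hh' (rename_injective _ (colMap_injective τ) (by rw [← hh''def, h0, map_zero]))
  have hle₂ : complexity (perPoly (Fin n) ℝ≥0 * h'') = complexity (perPoly (Fin n) ℝ≥0 * h') := by
    have hmul : perPoly (Fin n) ℝ≥0 * h'' = rename (colMap τ) (perPoly (Fin n) ℝ≥0 * h') := by
      rw [map_mul, rename_colMap_perPoly]
    rw [hmul]
    exact complexity_rename_of_injective_holds (colMap_injective τ) _
  have hblock'' : ∀ S ∈ h''.support, ∀ u ∈ S.support, u.1 ∈ RT ∧ u.2 ∈ Y := by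
    intro S hS u hu
    rw [hh''def, support_rename_of_injective (colMap_injective τ), Finset.mem_image] at hS
    obtain ⟨S', hS', rfl⟩ := hS
    rw [Finsupp.mapDomain_support_of_injective (colMap_injective τ), Finset.mem_image] at hu
    obtain ⟨u', hu', rfl⟩ := hu
    obtain ⟨h1, h2⟩ := hblock S' hS' u' hu'
    exact ⟨h1, hτY _ h2⟩
  have hdegS'' : ∀ S ∈ h''.support, degree S ≤ d := by
    intro S hS
    rw [hh''def, support_rename_of_injective (colMap_injective τ), Finset.mem_image] at hS
    obtain ⟨S', hS', rfl⟩ := hS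
    rw [Finsupp.degree_mapDomain]
    exact hdegS S' hS'
  -- (4) the face `diag(J) ∪ (Jᶜ × Jᶜ)`, `J = RT ∪ Y`
  set J := RT ∪ Y with hJ
  have hJcard : J.card ≤ 2 * d := by
    rw [hJ]
    calc (RT ∪ Y).card ≤ RT.card + Y.card := Finset.card_union_le _ _
      _ ≤ 2 * d := by omega
  have hGpm : ∃ ρ : Equiv.Perm (Fin n), ∀ j, (ρ j, j) ∈ diagBlock J := ⟨1, one_subset_diagBlock J⟩
  have hcellG : ∀ u : Fin n × Fin n, u.1 ∈ RT → u.2 ∈ Y → u ∉ diagBlock J := by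
    rintro ⟨i, j⟩ hi hj hu
    rw [mem_diagBlock] at hu
    rcases hu with ⟨hij, -⟩ | ⟨hiJ, -⟩
    · simp only at hij
      subst hij
      exact hYRT _ hj hi
    · exact hiJ (Finset.mem_union_left _ hi)
  have hhom'' : IsWeightedHomogeneous (graphWeight (diagBlock J)) h'' 0 :=
    isWeightedHomogeneous_graphWeight_zero
      (fun S hS u hu => hcellG u (hblock'' S hS u hu).1 (hblock'' S hS u hu).2)
  set W := perRestrict (diagBlock J) with hWdef
  have hle₃ : complexity (W * h'') ≤ complexity (perPoly (Fin n) ℝ≥0 * h'') := by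
    have h1 := complexity_topForm_le (graphWeight (diagBlock J)) (perPoly (Fin n) ℝ≥0 * h'')
    rwa [topForm_mul, topForm_graph_perPoly hGpm, topForm_of_isWeightedHomogeneous _ hhom''] at h1
  -- (5) rounds: shrink the multiplier to one monomial, for free
  have hWcell : ∀ v : Fin n × Fin n, (v.1 ∈ RT ∧ v.2 ∈ Y) → IsWeightedHomogeneous (cellWeight v) W 0 := by
    rintro ⟨i, j⟩ ⟨hi, hj⟩
    refine isWeightedHomogeneous_perRestrict_cell (fun hij => ?_) (Finset.mem_union_right _ hj)
    subst hij
    exact hYRT _ hj hi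
  obtain ⟨S, hS, a, ha, hle₄⟩ :=
    rounds W (fun v => v.1 ∈ RT ∧ v.2 ∈ Y) hWcell h''.support.card h'' hh'' le_rfl hblock''
  -- (6) the face is `x^{diag J}` times a renamed smaller permanent; strip and rescale
  set R := rename (Prod.map Subtype.val Subtype.val) (perPoly {x // x ∉ J} ℝ≥0) with hR
  have hWeq : W = monomial (diagPat J) 1 * R := perRestrict_diagBlock J
  have hprod : W * monomial S a = a • (monomial (S + diagPat J) 1 * R) := by
    rw [hWeq, smul_eq_C_mul, show (monomial S a : MvPolynomial (Fin n × Fin n) ℝ≥0) = C a * monomial S 1 by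
      rw [C_mul_monomial, mul_one], show (monomial (S + diagPat J) 1 : MvPolynomial (Fin n × Fin n) ℝ≥0) =
      monomial S 1 * monomial (diagPat J) 1 by rw [monomial_mul, mul_one]]
    ring
  have hstrip : complexity R ≤ 8 ^ (3 * d) * complexity (monomial (S + diagPat J) 1 * R) := by
    refine (complexity_le_of_monomial_mul _ _).trans (Nat.mul_le_mul_right _ (Nat.pow_le_pow_right (by norm_num) ?_))
    rw [map_add, degree_diagPat]
    have := hdegS'' S hS
    omega
  have hscale : complexity (monomial (S + diagPat J) 1 * R) ≤ complexity (W * monomial S a) + 1 := by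
    rw [hprod]
    have h1 := complexity_smul_le_holds a⁻¹ (a • (monomial (S + diagPat J) 1 * R))
    rwa [inv_smul_smul₀ ha] at h1
  -- (7) the renamed smaller permanent is a genuine permanent of size `m = n - |J|`
  set m := Fintype.card {x // x ∉ J} with hm
  have hRm : complexity R = complexity (perPoly (Fin m) ℝ≥0) := by
    rw [hR, complexity_rename_of_injective_holds (Subtype.val_injective.prodMap Subtype.val_injective),
      ← rename_prodMap_perPoly (Fintype.equivFinOfCardEq hm.symm),
      complexity_rename_of_injective_holds
        ((Fintype.equivFinOfCardEq hm.symm).injective.prodMap (Fintype.equivFinOfCardEq hm.symm).injective)]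
  have hmn : n ≤ m + 2 * d := by
    have hmJ : m = n - J.card := by
      rw [hm, Fintype.card_subtype_compl, Fintype.card_fin, Fintype.card_coe]
    omega
  have hm1 : 1 ≤ m := by omega
  have hjs := js_le_two_mul_complexity_perPoly (n := m) hm1
  refine ⟨m, hmn, ?_⟩
  have hfinal : complexity (W * monomial S a) ≤ complexity (perPoly (Fin n) ℝ≥0 * h) :=
    hle₄.trans (hle₃.trans (hle₂.le.trans hle₁))
  calc m * (2 ^ (m - 1) - 1) ≤ 2 * complexity (perPoly (Fin m) ℝ≥0) := hjs
    _ = 2 * complexity R := by rw [hRm]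
    _ ≤ 2 * (8 ^ (3 * d) * complexity (monomial (S + diagPat J) 1 * R)) := Nat.mul_le_mul_left 2 hstrip
    _ ≤ 2 * (8 ^ (3 * d) * (complexity (perPoly (Fin n) ℝ≥0 * h) + 1)) :=
        Nat.mul_le_mul_left 2 (Nat.mul_le_mul_left _ (hscale.trans (by omega)))
    _ = 2 * 8 ^ (3 * d) * (complexity (perPoly (Fin n) ℝ≥0 * h) + 1) := by ring

/-- **THE SUBLINEAR-DEGREE RUNG of `PerMultiplesHard`.**  For every `c`, for all large `n`, every nonzero
`h ∈ ℝ≥0[x_ij]` with `16 · deg h ≤ n` satisfies the crux's bound `2^{(log₂ n + c)^c} < L⁺(per_n · h)`: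
counterexamples, if any, have total degree `> n/16`.  (In print: `h` constant — Jerrum–Snir 1982; `h` a
monomial of any degree — Jukna–Seiwert–Sergeev 2022; bounded-degree `h` only at quasi-polynomial strength
via shadows — Hrubeš–Yehudayoff 2021 Prop 43(2).  Mechanism here: top forms are free ⇒ multihomogeneous
multiplier in a `d × d` block; the face `diag(J) ∪ (Jᶜ × Jᶜ)` isolates a renamed `per_{n-2d}`; single-cell
top forms shrink the multiplier to one monomial; strip, rescale, Jerrum–Snir.) [folklore] -/
theorem perMultiplesHard_rung_sublinear (c : ℕ) :
    ∃ n₀ : ℕ, ∀ n ≥ n₀, ∀ h : MvPolynomial (Fin n × Fin n) ℝ≥0, h ≠ 0 → 16 * h.totalDegree ≤ n →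
      2 ^ ((Nat.log 2 n + c) ^ c) < complexity (perPoly (Fin n) ℝ≥0 * h) := by
  obtain ⟨L₀, hL₀⟩ := polylog_eventually c
  refine ⟨2 ^ L₀ + 22, fun n hn h hh hdeg => ?_⟩
  have hT : 1 ≤ 2 ^ L₀ := Nat.one_le_two_pow
  have hn22 : 22 ≤ n := le_trans (Nat.le_add_left 22 _) hn
  set d := h.totalDegree with hd
  have hdn : 2 * d < n := by omega
  obtain ⟨m, hmn, hjs⟩ := js_bound_totalDegree hdn hh le_rfl
  have hL : L₀ ≤ Nat.log 2 n := Nat.le_log_of_pow_le (by norm_num) (le_trans (Nat.le_add_right _ _) hn)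
  have h8 := hL₀ (Nat.log 2 n) hL
  have hpow : 2 ^ Nat.log 2 n ≤ n := Nat.pow_log_le_self 2 (by omega)
  set E := (Nat.log 2 n + c) ^ c with hEdef
  by_contra hcontra
  push Not at hcontra
  -- `L ≤ 2^E` and the closed form squeeze `m`
  set L := complexity (perPoly (Fin n) ℝ≥0 * h) with hLdef
  have hm2 : 2 ≤ m := by omega
  have hA : 2 ^ (m - 2) ≤ m * (2 ^ (m - 1) - 1) := by
    have h1 : 2 ^ (m - 1) = 2 * 2 ^ (m - 2) := by
      rw [← pow_succ', show m - 2 + 1 = m - 1 by omega]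
    have h2 : 1 ≤ 2 ^ (m - 2) := Nat.one_le_two_pow
    calc 2 ^ (m - 2) ≤ 1 * (2 ^ (m - 1) - 1) := by rw [one_mul]; omega
      _ ≤ m * (2 ^ (m - 1) - 1) := Nat.mul_le_mul_right _ (by omega)
  have hB : 2 * 8 ^ (3 * d) * (L + 1) ≤ 2 ^ (9 * d + E + 2) := by
    have h83 : (8 : ℕ) ^ (3 * d) = 2 ^ (9 * d) := by
      rw [show (8 : ℕ) = 2 ^ 3 by norm_num, ← pow_mul]; ring_nf
    have hE1 : 1 ≤ 2 ^ E := Nat.one_le_two_pow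
    have hL1 : L + 1 ≤ 2 ^ (E + 1) := by rw [pow_succ]; omega
    calc 2 * 8 ^ (3 * d) * (L + 1) ≤ 2 * 2 ^ (9 * d) * 2 ^ (E + 1) := by
          rw [h83]; exact Nat.mul_le_mul_left _ hL1
      _ = 2 ^ (9 * d + E + 2) := by ring
  have hC : m - 2 ≤ 9 * d + E + 2 :=
    (Nat.pow_le_pow_iff_right (by norm_num)).1 (hA.trans (hjs.trans hB))
  omega

/-- **Fixed-degree rungs, all at once:** for every `c` and `d`, for all large `n`, no nonzero `h` of total
degree `≤ d` is a counterexample to `PerMultiplesHard`. [folklore] -/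
theorem perMultiplesHard_rung_totalDegree_le (c d : ℕ) :
    ∃ n₀ : ℕ, ∀ n ≥ n₀, ∀ h : MvPolynomial (Fin n × Fin n) ℝ≥0, h ≠ 0 → h.totalDegree ≤ d →
      2 ^ ((Nat.log 2 n + c) ^ c) < complexity (perPoly (Fin n) ℝ≥0 * h) := by
  obtain ⟨n₀, hn₀⟩ := perMultiplesHard_rung_sublinear c
  exact ⟨max n₀ (16 * d), fun n hn h hh hdeg =>
    hn₀ n (le_trans (le_max_left _ _) hn) h hh (le_trans (Nat.mul_le_mul_left 16 hdeg) (le_trans (le_max_right _ _) hn))⟩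

/-- **Projection upgrade (no stripping cost):** substituting `1` for every variable outside `Jᶜ × Jᶜ` is
free (`IsProjection.complexity_le`), so the monomial `a x^{S + diag J}` in front of the renamed smaller
permanent costs nothing: for `2d < n` and every nonzero `h` of total degree `≤ d` there is `m ≥ n - 2d` with
`m (2^{m-1} - 1) ≤ 2 · L⁺(per_n · h) + 2`. [folklore] -/
theorem js_bound_totalDegree_proj {d : ℕ} (hdn : 2 * d < n) {h : MvPolynomial (Fin n × Fin n) ℝ≥0}
    (hh : h ≠ 0) (hdeg : h.totalDegree ≤ d) :
    ∃ m : ℕ, n ≤ m + 2 * d ∧ m * (2 ^ (m - 1) - 1) ≤ 2 * complexity (perPoly (Fin n) ℝ≥0 * h) + 2 := by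
  classical
  -- (1) WLOG multihomogeneous
  set h' := multiTop (rowColWeights n) h with hh'def
  have hh' : h' ≠ 0 := multiTop_ne_zero _ hh
  have hmh : IsMultihomogeneous h' := isMultihomogeneous_multiTop h
  have hle₁ : complexity (perPoly (Fin n) ℝ≥0 * h') ≤ complexity (perPoly (Fin n) ℝ≥0 * h) :=
    complexity_mul_multiTop_le _ _ _ perPoly_homogeneous_rowCol
  have hsupp' : h'.support ⊆ h.support := support_multiTop_subset _ _
  have hdegS : ∀ S ∈ h'.support, degree S ≤ d := fun S hS => by
    have h1 := le_totalDegree (hsupp' hS)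
    rw [← degree_eq_sum'] at h1
    exact h1.trans hdeg
  have hmarg : ∀ S ∈ h'.support, ∀ S' ∈ h'.support,
      Finsupp.mapDomain Prod.fst S = Finsupp.mapDomain Prod.fst S' ∧
      Finsupp.mapDomain Prod.snd S = Finsupp.mapDomain Prod.snd S' := by
    intro S hS S' hS'
    refine ⟨Finsupp.ext fun r => ?_, Finsupp.ext fun c => ?_⟩
    · obtain ⟨m, hm⟩ := hmh.1 r
      rw [← weight_rowWeight_eq_mapDomain, ← weight_rowWeight_eq_mapDomain,
        hm (MvPolynomial.mem_support_iff.1 hS), hm (MvPolynomial.mem_support_iff.1 hS')]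
    · obtain ⟨m, hm⟩ := hmh.2 c
      rw [← weight_colWeight_eq_mapDomain, ← weight_colWeight_eq_mapDomain,
        hm (MvPolynomial.mem_support_iff.1 hS), hm (MvPolynomial.mem_support_iff.1 hS')]
  -- (2) the block
  obtain ⟨S₀, hS₀⟩ := MvPolynomial.support_nonempty.2 hh'
  set RT := (Finsupp.mapDomain Prod.fst S₀).support with hRT
  set CT := (Finsupp.mapDomain Prod.snd S₀).support with hCT
  have hRT_card : RT.card ≤ d :=
    (card_support_le_degree _).trans (by rw [Finsupp.degree_mapDomain]; exact hdegS S₀ hS₀)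
  have hCT_card : CT.card ≤ d :=
    (card_support_le_degree _).trans (by rw [Finsupp.degree_mapDomain]; exact hdegS S₀ hS₀)
  have hblock : ∀ S ∈ h'.support, ∀ u ∈ S.support, u.1 ∈ RT ∧ u.2 ∈ CT := by
    intro S hS u hu
    obtain ⟨hr, hc⟩ := hmarg S hS S₀ hS₀
    obtain ⟨i, j⟩ := u
    have hpos : 0 < S (i, j) := Nat.pos_of_ne_zero (Finsupp.mem_support_iff.1 hu)
    have h1 := le_mapDomain_fst S i j
    have h2 := le_mapDomain_snd S i j
    constructor
    · rw [hRT, Finsupp.mem_support_iff, ← hr]; exact (lt_of_lt_of_le hpos h1).ne'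
    · rw [hCT, Finsupp.mem_support_iff, ← hc]; exact (lt_of_lt_of_le hpos h2).ne'
  -- (3) a column permutation making the column block disjoint from `RT`
  have hroom : CT.card ≤ (RTᶜ).card := by rw [Finset.card_compl, Fintype.card_fin]; omega
  obtain ⟨Y, hYsub, hYcard⟩ := Finset.exists_subset_card_eq hroom
  have hYRT : ∀ y ∈ Y, y ∉ RT := fun y hy => Finset.mem_compl.1 (hYsub hy)
  have hcardEq : Fintype.card {x // x ∈ CT} = Fintype.card {x // x ∈ Y} := by simp [hYcard]
  set e := Fintype.equivOfCardEq hcardEq with he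
  set τ : Equiv.Perm (Fin n) := e.extendSubtype with hτ
  have hτY : ∀ c ∈ CT, τ c ∈ Y := fun c hc => e.extendSubtype_mem c hc
  set h'' := rename (colMap τ) h' with hh''def
  have hh'' : h'' ≠ 0 := fun h0 =>
    hh' (rename_injective _ (colMap_injective τ) (by rw [← hh''def, h0, map_zero]))
  have hle₂ : complexity (perPoly (Fin n) ℝ≥0 * h'') = complexity (perPoly (Fin n) ℝ≥0 * h') := by
    have hmul : perPoly (Fin n) ℝ≥0 * h'' = rename (colMap τ) (perPoly (Fin n) ℝ≥0 * h') := by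
      rw [map_mul, rename_colMap_perPoly]
    rw [hmul]
    exact complexity_rename_of_injective_holds (colMap_injective τ) _
  have hblock'' : ∀ S ∈ h''.support, ∀ u ∈ S.support, u.1 ∈ RT ∧ u.2 ∈ Y := by
    intro S hS u hu
    rw [hh''def, support_rename_of_injective (colMap_injective τ), Finset.mem_image] at hS
    obtain ⟨S', hS', rfl⟩ := hS
    rw [Finsupp.mapDomain_support_of_injective (colMap_injective τ), Finset.mem_image] at hu
    obtain ⟨u', hu', rfl⟩ := hu
    obtain ⟨h1, h2⟩ := hblock S' hS' u' hu'
    exact ⟨h1, hτY _ h2⟩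
  have hdegS'' : ∀ S ∈ h''.support, degree S ≤ d := by
    intro S hS
    rw [hh''def, support_rename_of_injective (colMap_injective τ), Finset.mem_image] at hS
    obtain ⟨S', hS', rfl⟩ := hS
    rw [Finsupp.degree_mapDomain]
    exact hdegS S' hS'
  -- (4) the face `diag(J) ∪ (Jᶜ × Jᶜ)`, `J = RT ∪ Y`
  set J := RT ∪ Y with hJ
  have hJcard : J.card ≤ 2 * d := by
    rw [hJ]
    calc (RT ∪ Y).card ≤ RT.card + Y.card := Finset.card_union_le _ _
      _ ≤ 2 * d := by omega
  have hGpm : ∃ ρ : Equiv.Perm (Fin n), ∀ j, (ρ j, j) ∈ diagBlock J := ⟨1, one_subset_diagBlock J⟩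
  have hcellG : ∀ u : Fin n × Fin n, u.1 ∈ RT → u.2 ∈ Y → u ∉ diagBlock J := by
    rintro ⟨i, j⟩ hi hj hu
    rw [mem_diagBlock] at hu
    rcases hu with ⟨hij, -⟩ | ⟨hiJ, -⟩
    · simp only at hij
      subst hij
      exact hYRT _ hj hi
    · exact hiJ (Finset.mem_union_left _ hi)
  have hhom'' : IsWeightedHomogeneous (graphWeight (diagBlock J)) h'' 0 :=
    isWeightedHomogeneous_graphWeight_zero
      (fun S hS u hu => hcellG u (hblock'' S hS u hu).1 (hblock'' S hS u hu).2)
  set W := perRestrict (diagBlock J) with hWdef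
  have hle₃ : complexity (W * h'') ≤ complexity (perPoly (Fin n) ℝ≥0 * h'') := by
    have h1 := complexity_topForm_le (graphWeight (diagBlock J)) (perPoly (Fin n) ℝ≥0 * h'')
    rwa [topForm_mul, topForm_graph_perPoly hGpm, topForm_of_isWeightedHomogeneous _ hhom''] at h1
  -- (5) rounds: shrink the multiplier to one monomial, for free
  have hWcell : ∀ v : Fin n × Fin n, (v.1 ∈ RT ∧ v.2 ∈ Y) → IsWeightedHomogeneous (cellWeight v) W 0 := by
    rintro ⟨i, j⟩ ⟨hi, hj⟩
    refine isWeightedHomogeneous_perRestrict_cell (fun hij => ?_) (Finset.mem_union_right _ hj)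
    subst hij
    exact hYRT _ hj hi
  obtain ⟨S, hS, a, ha, hle₄⟩ :=
    rounds W (fun v => v.1 ∈ RT ∧ v.2 ∈ Y) hWcell h''.support.card h'' hh'' le_rfl hblock''
  -- (6') project: every variable outside `Jᶜ × Jᶜ` ↦ 1 (free)
  set per' := perPoly {x // x ∉ J} ℝ≥0 with hper'
  set emb : {x // x ∉ J} × {x // x ∉ J} → Fin n × Fin n := Prod.map Subtype.val Subtype.val with hemb
  set R := rename emb per' with hR
  have hWeq : W = monomial (diagPat J) 1 * R := perRestrict_diagBlock J
  set prj : Fin n × Fin n → MvPolynomial (Fin n × Fin n) ℝ≥0 :=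
    fun v => if v.1 ∉ J ∧ v.2 ∉ J then X v else C 1 with hprj
  have hprjR : aeval prj R = R := by
    have hcomp : (aeval prj).comp (rename emb) = rename emb := by
      refine MvPolynomial.algHom_ext (fun x => ?_)
      simp only [AlgHom.comp_apply, rename_X, aeval_X, hprj, hemb]
      rw [if_pos ⟨x.1.2, x.2.2⟩]
    have := congrArg (fun φ => φ per') hcomp
    simpa only [AlgHom.comp_apply] using this
  have hsuppSD : ∀ v ∈ (S + diagPat J).support, ¬ (v.1 ∉ J ∧ v.2 ∉ J) := by
    intro v hv hvJ
    rcases Finset.mem_union.1 (Finsupp.support_add hv) with h1 | h2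
    · exact hvJ.1 (Finset.mem_union_left _ (hblock'' S hS v h1).1)
    · -- diagonal cells `(j, j)`, `j ∈ J`
      have : v ∈ (∑ j ∈ J, Finsupp.single (j, j) (1 : ℕ)).support := h2
      obtain ⟨j, hj, hvj⟩ := Finset.mem_biUnion.1 (Finsupp.support_finsetSum this)
      obtain ⟨hvj', -⟩ := Finsupp.mem_support_single _ _ _ |>.1 hvj
      subst hvj'
      exact hvJ.1 hj
  have hprjMono : aeval prj (monomial (S + diagPat J) (1 : ℝ≥0)) = 1 := by
    rw [aeval_monomial, map_one, one_mul]
    unfold Finsupp.prod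
    apply Finset.prod_eq_one
    intro v hv
    simp only [hprj]
    rw [if_neg (hsuppSD v hv), ← C_pow, one_pow, C_1]
  have hproj : IsProjection (a • R) (W * monomial S a) := by
    refine ⟨prj, fun v => ?_, ?_⟩
    · by_cases hv : v.1 ∉ J ∧ v.2 ∉ J
      · exact Or.inl ⟨v, by simp only [hprj]; rw [if_pos hv]⟩
      · exact Or.inr ⟨1, by simp only [hprj]; rw [if_neg hv]⟩
    · have hprod : W * monomial S a = a • (monomial (S + diagPat J) 1 * R) := by
        rw [hWeq, smul_eq_C_mul, show (monomial S a : MvPolynomial (Fin n × Fin n) ℝ≥0) = C a * monomial S 1 by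
          rw [C_mul_monomial, mul_one], show (monomial (S + diagPat J) 1 : MvPolynomial (Fin n × Fin n) ℝ≥0) =
          monomial S 1 * monomial (diagPat J) 1 by rw [monomial_mul, mul_one]]
        ring
      rw [hprod, map_smul, map_mul, hprjMono, one_mul, hprjR]
  have hle₅ : complexity (a • R) ≤ complexity (W * monomial S a) := IsProjection.complexity_le_holds hproj
  have hscale : complexity R ≤ complexity (a • R) + 1 := by
    have h1 := complexity_smul_le_holds a⁻¹ (a • R)
    rwa [inv_smul_smul₀ ha] at h1
  -- (7) the renamed smaller permanent is a genuine permanent of size `m = n - |J|`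
  set m := Fintype.card {x // x ∉ J} with hm
  have hRm : complexity R = complexity (perPoly (Fin m) ℝ≥0) := by
    rw [hR, hemb, complexity_rename_of_injective_holds (Subtype.val_injective.prodMap Subtype.val_injective),
      ← rename_prodMap_perPoly (Fintype.equivFinOfCardEq hm.symm),
      complexity_rename_of_injective_holds
        ((Fintype.equivFinOfCardEq hm.symm).injective.prodMap (Fintype.equivFinOfCardEq hm.symm).injective)]
  have hmn : n ≤ m + 2 * d := by
    have hmJ : m = n - J.card := by
      rw [hm, Fintype.card_subtype_compl, Fintype.card_fin, Fintype.card_coe]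
    omega
  have hm1 : 1 ≤ m := by omega
  have hjs := js_le_two_mul_complexity_perPoly (n := m) hm1
  refine ⟨m, hmn, ?_⟩
  have hfinal : complexity (W * monomial S a) ≤ complexity (perPoly (Fin n) ℝ≥0 * h) :=
    hle₄.trans (hle₃.trans (hle₂.le.trans hle₁))
  calc m * (2 ^ (m - 1) - 1) ≤ 2 * complexity (perPoly (Fin m) ℝ≥0) := hjs
    _ = 2 * complexity R := by rw [hRm]
    _ ≤ 2 * (complexity (perPoly (Fin n) ℝ≥0 * h) + 1) := Nat.mul_le_mul_left 2 (hscale.trans (by omega))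
    _ = 2 * complexity (perPoly (Fin n) ℝ≥0 * h) + 2 := by ring

/-- **STRUCTURE OF COUNTEREXAMPLES (degree-free):** for every nonzero `h` and every exponent `S₀` of its
multihomogeneous top part `multiTop h` (whose row-marginal support has `r` rows and column-marginal support `c`
columns — the same for all exponents), if `r + c < n` then, with `m = n - r - c`:
`m (2^{m-1} - 1) ≤ 2 · L⁺(per_n · h) + 2`.  So any counterexample to `PerMultiplesHard` has a multihomogeneous
top part spread over `r + c ≥ n - polylog(n)` rows plus columns. [folklore] -/
theorem js_bound_rowcol {h : MvPolynomial (Fin n × Fin n) ℝ≥0} (hh : h ≠ 0)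
    {S₀ : Fin n × Fin n →₀ ℕ} (hS₀ : S₀ ∈ (multiTop (rowColWeights n) h).support)
    (hroom' : (Finsupp.mapDomain Prod.fst S₀).support.card + (Finsupp.mapDomain Prod.snd S₀).support.card < n) :
    ∃ m : ℕ, n = m + (Finsupp.mapDomain Prod.fst S₀).support.card + (Finsupp.mapDomain Prod.snd S₀).support.card ∧
      m * (2 ^ (m - 1) - 1) ≤ 2 * complexity (perPoly (Fin n) ℝ≥0 * h) + 2 := by
  classical
  -- (1) WLOG multihomogeneous
  set h' := multiTop (rowColWeights n) h with hh'def
  have hh' : h' ≠ 0 := multiTop_ne_zero _ hh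
  have hmh : IsMultihomogeneous h' := isMultihomogeneous_multiTop h
  have hle₁ : complexity (perPoly (Fin n) ℝ≥0 * h') ≤ complexity (perPoly (Fin n) ℝ≥0 * h) :=
    complexity_mul_multiTop_le _ _ _ perPoly_homogeneous_rowCol
  have hmarg : ∀ S ∈ h'.support, ∀ S' ∈ h'.support,
      Finsupp.mapDomain Prod.fst S = Finsupp.mapDomain Prod.fst S' ∧
      Finsupp.mapDomain Prod.snd S = Finsupp.mapDomain Prod.snd S' := by
    intro S hS S' hS'
    refine ⟨Finsupp.ext fun r => ?_, Finsupp.ext fun c => ?_⟩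
    · obtain ⟨m, hm⟩ := hmh.1 r
      rw [← weight_rowWeight_eq_mapDomain, ← weight_rowWeight_eq_mapDomain,
        hm (MvPolynomial.mem_support_iff.1 hS), hm (MvPolynomial.mem_support_iff.1 hS')]
    · obtain ⟨m, hm⟩ := hmh.2 c
      rw [← weight_colWeight_eq_mapDomain, ← weight_colWeight_eq_mapDomain,
        hm (MvPolynomial.mem_support_iff.1 hS), hm (MvPolynomial.mem_support_iff.1 hS')]
  -- (2) the block
  set RT := (Finsupp.mapDomain Prod.fst S₀).support with hRT
  set CT := (Finsupp.mapDomain Prod.snd S₀).support with hCT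
  have hblock : ∀ S ∈ h'.support, ∀ u ∈ S.support, u.1 ∈ RT ∧ u.2 ∈ CT := by
    intro S hS u hu
    obtain ⟨hr, hc⟩ := hmarg S hS S₀ hS₀
    obtain ⟨i, j⟩ := u
    have hpos : 0 < S (i, j) := Nat.pos_of_ne_zero (Finsupp.mem_support_iff.1 hu)
    have h1 := le_mapDomain_fst S i j
    have h2 := le_mapDomain_snd S i j
    constructor
    · rw [hRT, Finsupp.mem_support_iff, ← hr]; exact (lt_of_lt_of_le hpos h1).ne'
    · rw [hCT, Finsupp.mem_support_iff, ← hc]; exact (lt_of_lt_of_le hpos h2).ne'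
  -- (3) a column permutation making the column block disjoint from `RT`
  have hroom : CT.card ≤ (RTᶜ).card := by rw [Finset.card_compl, Fintype.card_fin]; omega
  obtain ⟨Y, hYsub, hYcard⟩ := Finset.exists_subset_card_eq hroom
  have hYRT : ∀ y ∈ Y, y ∉ RT := fun y hy => Finset.mem_compl.1 (hYsub hy)
  have hcardEq : Fintype.card {x // x ∈ CT} = Fintype.card {x // x ∈ Y} := by simp [hYcard]
  set e := Fintype.equivOfCardEq hcardEq with he
  set τ : Equiv.Perm (Fin n) := e.extendSubtype with hτ
  have hτY : ∀ c ∈ CT, τ c ∈ Y := fun c hc => e.extendSubtype_mem c hc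
  set h'' := rename (colMap τ) h' with hh''def
  have hh'' : h'' ≠ 0 := fun h0 =>
    hh' (rename_injective _ (colMap_injective τ) (by rw [← hh''def, h0, map_zero]))
  have hle₂ : complexity (perPoly (Fin n) ℝ≥0 * h'') = complexity (perPoly (Fin n) ℝ≥0 * h') := by
    have hmul : perPoly (Fin n) ℝ≥0 * h'' = rename (colMap τ) (perPoly (Fin n) ℝ≥0 * h') := by
      rw [map_mul, rename_colMap_perPoly]
    rw [hmul]
    exact complexity_rename_of_injective_holds (colMap_injective τ) _
  have hblock'' : ∀ S ∈ h''.support, ∀ u ∈ S.support, u.1 ∈ RT ∧ u.2 ∈ Y := by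
    intro S hS u hu
    rw [hh''def, support_rename_of_injective (colMap_injective τ), Finset.mem_image] at hS
    obtain ⟨S', hS', rfl⟩ := hS
    rw [Finsupp.mapDomain_support_of_injective (colMap_injective τ), Finset.mem_image] at hu
    obtain ⟨u', hu', rfl⟩ := hu
    obtain ⟨h1, h2⟩ := hblock S' hS' u' hu'
    exact ⟨h1, hτY _ h2⟩
  -- (4) the face `diag(J) ∪ (Jᶜ × Jᶜ)`, `J = RT ∪ Y`
  set J := RT ∪ Y with hJ
  have hJcard : J.card = RT.card + CT.card := by
    rw [hJ, Finset.card_union_of_disjoint (Finset.disjoint_left.2 (fun x hx hxY => hYRT x hxY hx)), hYcard]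
  have hGpm : ∃ ρ : Equiv.Perm (Fin n), ∀ j, (ρ j, j) ∈ diagBlock J := ⟨1, one_subset_diagBlock J⟩
  have hcellG : ∀ u : Fin n × Fin n, u.1 ∈ RT → u.2 ∈ Y → u ∉ diagBlock J := by
    rintro ⟨i, j⟩ hi hj hu
    rw [mem_diagBlock] at hu
    rcases hu with ⟨hij, -⟩ | ⟨hiJ, -⟩
    · simp only at hij
      subst hij
      exact hYRT _ hj hi
    · exact hiJ (Finset.mem_union_left _ hi)
  have hhom'' : IsWeightedHomogeneous (graphWeight (diagBlock J)) h'' 0 :=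
    isWeightedHomogeneous_graphWeight_zero
      (fun S hS u hu => hcellG u (hblock'' S hS u hu).1 (hblock'' S hS u hu).2)
  set W := perRestrict (diagBlock J) with hWdef
  have hle₃ : complexity (W * h'') ≤ complexity (perPoly (Fin n) ℝ≥0 * h'') := by
    have h1 := complexity_topForm_le (graphWeight (diagBlock J)) (perPoly (Fin n) ℝ≥0 * h'')
    rwa [topForm_mul, topForm_graph_perPoly hGpm, topForm_of_isWeightedHomogeneous _ hhom''] at h1
  -- (5) rounds: shrink the multiplier to one monomial, for free
  have hWcell : ∀ v : Fin n × Fin n, (v.1 ∈ RT ∧ v.2 ∈ Y) → IsWeightedHomogeneous (cellWeight v) W 0 := by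
    rintro ⟨i, j⟩ ⟨hi, hj⟩
    refine isWeightedHomogeneous_perRestrict_cell (fun hij => ?_) (Finset.mem_union_right _ hj)
    subst hij
    exact hYRT _ hj hi
  obtain ⟨S, hS, a, ha, hle₄⟩ :=
    rounds W (fun v => v.1 ∈ RT ∧ v.2 ∈ Y) hWcell h''.support.card h'' hh'' le_rfl hblock''
  -- (6') project: every variable outside `Jᶜ × Jᶜ` ↦ 1 (free)
  set per' := perPoly {x // x ∉ J} ℝ≥0 with hper'
  set emb : {x // x ∉ J} × {x // x ∉ J} → Fin n × Fin n := Prod.map Subtype.val Subtype.val with hemb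
  set R := rename emb per' with hR
  have hWeq : W = monomial (diagPat J) 1 * R := perRestrict_diagBlock J
  set prj : Fin n × Fin n → MvPolynomial (Fin n × Fin n) ℝ≥0 :=
    fun v => if v.1 ∉ J ∧ v.2 ∉ J then X v else C 1 with hprj
  have hprjR : aeval prj R = R := by
    have hcomp : (aeval prj).comp (rename emb) = rename emb := by
      refine MvPolynomial.algHom_ext (fun x => ?_)
      simp only [AlgHom.comp_apply, rename_X, aeval_X, hprj, hemb]
      rw [if_pos ⟨x.1.2, x.2.2⟩]
    have := congrArg (fun φ => φ per') hcomp
    simpa only [AlgHom.comp_apply] using this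
  have hsuppSD : ∀ v ∈ (S + diagPat J).support, ¬ (v.1 ∉ J ∧ v.2 ∉ J) := by
    intro v hv hvJ
    rcases Finset.mem_union.1 (Finsupp.support_add hv) with h1 | h2
    · exact hvJ.1 (Finset.mem_union_left _ (hblock'' S hS v h1).1)
    · -- diagonal cells `(j, j)`, `j ∈ J`
      have : v ∈ (∑ j ∈ J, Finsupp.single (j, j) (1 : ℕ)).support := h2
      obtain ⟨j, hj, hvj⟩ := Finset.mem_biUnion.1 (Finsupp.support_finsetSum this)
      obtain ⟨hvj', -⟩ := Finsupp.mem_support_single _ _ _ |>.1 hvj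
      subst hvj'
      exact hvJ.1 hj
  have hprjMono : aeval prj (monomial (S + diagPat J) (1 : ℝ≥0)) = 1 := by
    rw [aeval_monomial, map_one, one_mul]
    unfold Finsupp.prod
    apply Finset.prod_eq_one
    intro v hv
    simp only [hprj]
    rw [if_neg (hsuppSD v hv), ← C_pow, one_pow, C_1]
  have hproj : IsProjection (a • R) (W * monomial S a) := by
    refine ⟨prj, fun v => ?_, ?_⟩
    · by_cases hv : v.1 ∉ J ∧ v.2 ∉ J
      · exact Or.inl ⟨v, by simp only [hprj]; rw [if_pos hv]⟩
      · exact Or.inr ⟨1, by simp only [hprj]; rw [if_neg hv]⟩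
    · have hprod : W * monomial S a = a • (monomial (S + diagPat J) 1 * R) := by
        rw [hWeq, smul_eq_C_mul, show (monomial S a : MvPolynomial (Fin n × Fin n) ℝ≥0) = C a * monomial S 1 by
          rw [C_mul_monomial, mul_one], show (monomial (S + diagPat J) 1 : MvPolynomial (Fin n × Fin n) ℝ≥0) =
          monomial S 1 * monomial (diagPat J) 1 by rw [monomial_mul, mul_one]]
        ring
      rw [hprod, map_smul, map_mul, hprjMono, one_mul, hprjR]
  have hle₅ : complexity (a • R) ≤ complexity (W * monomial S a) := IsProjection.complexity_le_holds hproj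
  have hscale : complexity R ≤ complexity (a • R) + 1 := by
    have h1 := complexity_smul_le_holds a⁻¹ (a • R)
    rwa [inv_smul_smul₀ ha] at h1
  -- (7) the renamed smaller permanent is a genuine permanent of size `m = n - |J|`
  set m := Fintype.card {x // x ∉ J} with hm
  have hRm : complexity R = complexity (perPoly (Fin m) ℝ≥0) := by
    rw [hR, hemb, complexity_rename_of_injective_holds (Subtype.val_injective.prodMap Subtype.val_injective),
      ← rename_prodMap_perPoly (Fintype.equivFinOfCardEq hm.symm),
      complexity_rename_of_injective_holds
        ((Fintype.equivFinOfCardEq hm.symm).injective.prodMap (Fintype.equivFinOfCardEq hm.symm).injective)]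
  have hmn : n = m + RT.card + CT.card := by
    have hmJ : m = n - J.card := by
      rw [hm, Fintype.card_subtype_compl, Fintype.card_fin, Fintype.card_coe]
    have hJle : J.card ≤ n := by
      calc J.card ≤ (Finset.univ : Finset (Fin n)).card := Finset.card_le_univ _
        _ = n := by simp
    omega
  have hm1 : 1 ≤ m := by omega
  have hjs := js_le_two_mul_complexity_perPoly (n := m) hm1
  refine ⟨m, hmn, ?_⟩
  have hfinal : complexity (W * monomial S a) ≤ complexity (perPoly (Fin n) ℝ≥0 * h) :=
    hle₄.trans (hle₃.trans (hle₂.le.trans hle₁))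
  calc m * (2 ^ (m - 1) - 1) ≤ 2 * complexity (perPoly (Fin m) ℝ≥0) := hjs
    _ = 2 * complexity R := by rw [hRm]
    _ ≤ 2 * (complexity (perPoly (Fin n) ℝ≥0 * h) + 1) := Nat.mul_le_mul_left 2 (hscale.trans (by omega))
    _ = 2 * complexity (perPoly (Fin n) ℝ≥0 * h) + 2 := by ring


/-- **THE `n/3`-DEGREE RUNG:** for every `c`, for all large `n`, every nonzero `h` with `3 · deg h ≤ n` satisfies
the crux's bound. [folklore] -/
theorem perMultiplesHard_rung_third (c : ℕ) :
    ∃ n₀ : ℕ, ∀ n ≥ n₀, ∀ h : MvPolynomial (Fin n × Fin n) ℝ≥0, h ≠ 0 → 3 * h.totalDegree ≤ n →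
      2 ^ ((Nat.log 2 n + c) ^ c) < complexity (perPoly (Fin n) ℝ≥0 * h) := by
  obtain ⟨L₀, hL₀⟩ := polylog_eventually c
  refine ⟨2 ^ L₀ + 40, fun n hn h hh hdeg => ?_⟩
  have hT : 1 ≤ 2 ^ L₀ := Nat.one_le_two_pow
  have hn40 : 40 ≤ n := le_trans (Nat.le_add_left 40 _) hn
  set d := h.totalDegree with hd
  have hdn : 2 * d < n := by omega
  obtain ⟨m, hmn, hjs⟩ := js_bound_totalDegree_proj hdn hh le_rfl
  have hL : L₀ ≤ Nat.log 2 n := Nat.le_log_of_pow_le (by norm_num) (le_trans (Nat.le_add_right _ _) hn)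
  have h8 := hL₀ (Nat.log 2 n) hL
  have hpow : 2 ^ Nat.log 2 n ≤ n := Nat.pow_log_le_self 2 (by omega)
  set E := (Nat.log 2 n + c) ^ c with hEdef
  by_contra hcontra
  push Not at hcontra
  set L := complexity (perPoly (Fin n) ℝ≥0 * h) with hLdef
  have hm2 : 2 ≤ m := by omega
  have hA : 2 ^ (m - 2) ≤ m * (2 ^ (m - 1) - 1) := by
    have h1 : 2 ^ (m - 1) = 2 * 2 ^ (m - 2) := by
      rw [← pow_succ', show m - 2 + 1 = m - 1 by omega]
    have h2 : 1 ≤ 2 ^ (m - 2) := Nat.one_le_two_pow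
    calc 2 ^ (m - 2) ≤ 1 * (2 ^ (m - 1) - 1) := by rw [one_mul]; omega
      _ ≤ m * (2 ^ (m - 1) - 1) := Nat.mul_le_mul_right _ (by omega)
  have hE1 : 1 ≤ 2 ^ E := Nat.one_le_two_pow
  have hB : 2 * L + 2 ≤ 2 ^ (E + 2) := by
    rw [show E + 2 = E + 1 + 1 by ring, pow_succ, pow_succ]; omega
  have hC : m - 2 ≤ E + 2 := (Nat.pow_le_pow_iff_right (by norm_num)).1 (hA.trans (hjs.trans hB))
  omega

/-- **Every fixed degree, for all `c`** (from the linear floor). [folklore] -/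
theorem perMultiplesHard_rung_totalDegree_le' (c d : ℕ) :
    ∃ n₀ : ℕ, ∀ n ≥ n₀, ∀ h : MvPolynomial (Fin n × Fin n) ℝ≥0, h ≠ 0 → h.totalDegree ≤ d →
      2 ^ ((Nat.log 2 n + c) ^ c) < complexity (perPoly (Fin n) ℝ≥0 * h) := by
  obtain ⟨n₀, hn₀⟩ := perMultiplesHard_rung_third c
  exact ⟨max n₀ (3 * d), fun n hn h hh hdeg =>
    hn₀ n (le_trans (le_max_left _ _) hn) h hh
      (le_trans (Nat.mul_le_mul_left 3 hdeg) (le_trans (le_max_right _ _) hn))⟩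

/-- **The same floor for the charged pair (crux `PerDivisionHard`, H1 of the route):** for every `c`, for all
large `n`, every nonzero `h` with `3 · deg h ≤ n` has `2^{(log₂ n + c)^c} < L⁺(per_n · h) + L⁺(h)`. [folklore] -/
theorem perDivisionHard_rung_third (c : ℕ) :
    ∃ n₀ : ℕ, ∀ n ≥ n₀, ∀ h : MvPolynomial (Fin n × Fin n) ℝ≥0, h ≠ 0 → 3 * h.totalDegree ≤ n →
      2 ^ ((Nat.log 2 n + c) ^ c) < complexity (perPoly (Fin n) ℝ≥0 * h) + complexity h := by
  obtain ⟨n₀, hn₀⟩ := perMultiplesHard_rung_third c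
  exact ⟨n₀, fun n hn h hh hdeg => Nat.lt_of_lt_of_le (hn₀ n hn h hh hdeg) (Nat.le_add_right _ _)⟩

end Summit.ValiantsHypothesis.ValiantsHypothesis.Cruxes.PerMultiplesHard.Disproof.General

end
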